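import Mathlib
import HarnessLib
import Literature.NumberTheory.LFunctions.ZetaSubconvexity
import Literature.NumberTheory.LFunctions.ZetaSumBlockEstimates
import Literature.NumberTheory.LFunctions.HSumStructure5
import Literature.NumberTheory.LFunctions.SixthMomentFiveCoordinates
import Literature.NumberTheory.LFunctions.BourgainTheorem4Optimisation

/-!
# Bourgain's estimate (3.12)–(3.13) for the zeta sum `∑ e(T log(m/M))` from Corollary 3 (PROVED)

Topic `Literature/NumberTheory/LFunctions`. We prove the hypothesis `h312` of
`Bourgain2017_eq313_log_of_eq312` (file `BourgainTheorem4Optimisation`), i.e. Bourgain's bound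

  `|S|⁶ ≪_ε M^{6+ε} N⁻³ (N/R)`,  `S = ∑_{M/2 ≤ m ≤ M} e(T log(m/M))`,
  `N = M T^{-2/7} ∈ (1, M)`, `R = ⌈(2M³/(NT))^{1/2}⌉ ∈ [N^{1/2}, N]`, `M ≤ T^{1/2}`

(J. Bourgain, *Decoupling, exponential sums and the Riemann zeta function*, J. AMS 30 (2017), §4,
(3.12)–(3.13) with `c = 1`) from the decoupling input **Corollary 3** (the mean value bound for
`A₆`, taken as the hypothesis `hC3`), following §4 of the paper and the Huxley–Watt / Graham–Kolesnik
reduction it quotes ([H-W] §4, G–K §7.7), all of which is rebuilt in the imported files: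

* `LogSumBlocks`: `S` is cut into blocks of length `ℓ ≍ N` with Taylor points `m_k`, each block
  being a twisted cubic sum with data `(q, a, b, μ, s, λ)` attached to the rational approximation
  `a/q` of `x_k = -T/(2m_k²)` (`R ≤ q R'... ≤ 20R²`);
* `CubicSumStructure`, `CubicSumAiry`: Poisson summation and stationary phase turn a block into
  Gauss sums times Airy–Hardy integrals (major arcs: trivial; minor arcs: a main term over the
  stationary window plus explicit errors);
* `HSumStructure5`, `SixthMomentFiveCoordinates`: the main term is a five-coordinate `h`-sum
  `∑_{M₀<h≤H} e(x·(h, h², h^{3/2}, h^{1/2}, h^{-1/2}))`, whose sixth moment over a family of blocks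
  is bounded by Corollary 3 (Bourgain's (3.4)–(3.10)) in terms of the second spacing count `B`;
* `SecondSpacingOfBlocks`, `SecondSpacingLemma`: `B` is bounded by the Graham–Kolesnik
  Lemma 7.18 count of coincidences among the rationals `a/q`;
* `ZetaSumBlockEstimates`: block counts by denominator size, per-block bounds, explicit envelopes
  and the log-linear exponent bookkeeping behind (3.12).

This file assembles these inputs: the parameter regime `Good` (§4: `N ≥ 2²⁰`, `T ≥ 2⁷⁰`,
`T²N⁷ = M⁷`, `2M³ ≤ NTR² ≤ 8M³`, `R ≤ N ≤ R²`), the reduction of `‖S‖` to the blocks, the error,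
major-arc and trivial-class sums (all `≪ (log T)² M N^{-1/2}`), the sieve families
(`q ~ 2^i`, `r ~ 2^j`) treated by the family theorem `sum_norm_mainTerm_le` + the second spacing
bound + the monomial inequality `family_monomial_le`, and finally
`eq312_log_of_corollary3 : (Corollary 3) → h312`.

Everything is PROVED; no named fact is introduced. Constants are explicit but not optimised.

## References

* J. Bourgain, *Decoupling, exponential sums and the Riemann zeta function*, J. Amer. Math. Soc. 30
  (2017), 205–224 — §4, (3.4)–(3.13). [BourgainJAMS2017]
* S. W. Graham, G. Kolesnik, *Van der Corput's Method of Exponential Sums*, LMS Lecture Note Series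
  126, Cambridge Univ. Press 1991 — §7.7, Lemma 7.18. [GrahamKolesnik1991]
* M. N. Huxley, N. Watt, *Exponential sums and the Riemann zeta function*, Proc. London Math. Soc.
  (3) 57 (1988), 1–24 — §4. [HuxleyWatt1988]
-/

noncomputable section

open Real Complex Finset MeasureTheory
open Literature.Analysis.Fourier (fresnelC norm_fresnelC_le)
open Literature.Analysis.Fourier.AiryHardy (trap trap_nonneg trap_le_one)
open Literature.NumberTheory.EllipticCurves.ModularForms (quadGaussSum)
open Literature.NumberTheory.LFunctions.LogSumBlocks (blockStart blockCount qOf aOf bOf muOf sOf lamOf xcoef eta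
  eta_pos muOf_pos qOf_pos qOf_le abs_xcoef_sub_le isUnit_aOf abs_q_mul_lamOf_le abs_sOf_le farFromRationals_qOf
  block_le_cubicSum norm_bourgainSum_le_blocks)
open Literature.NumberTheory.LFunctions.SecondSpacingLog (kap kap_pos cube_mul_kap_sq delta2)
open Literature.NumberTheory.LFunctions.HSum (kappa kappa_pos fr xvec ampl ampl_le airyMain_eq ampl_pos
  xvec5 xvec5_castSucc thetaIntegral5 thetaIntegral5_nonneg norm_mainTerm5_le abs_fr_le)
open Literature.NumberTheory.LFunctions.CubicSum (cubicSum airyTrap airyMain window stationaryWindow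
  mem_stationaryWindow_iff mem_window_bounds cubicSum_structure cubicSum_airy norm_quadGaussSum_le_sqrt)
open Literature.NumberTheory.LFunctions.PartialSums (cutoffKernel)
open Literature.NumberTheory.DiophantineApproximation (FarFromRationals card_le_of_separated
  card_filter_farFromRationals_le card_filter_exists_near_rational_le)

namespace Literature.NumberTheory.LFunctions
namespace ZetaSum


/-! ### From the multiplicative relations to `LogRel` -/

/-- The logarithms of the parameters satisfy `LogRel`. [folklore] -/
theorem logRel_of {M N R Q T : ℝ} (hM : 0 < M) (hN : 0 < N) (hR : 0 < R) (hQ : 0 < Q) (hT : 0 < T)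
    (hrel1 : 2 * M ^ 3 ≤ N * T * R ^ 2) (hrel2 : N * T * R ^ 2 ≤ 8 * M ^ 3) (hRN : R ≤ N) (hNR : N ≤ R ^ 2)
    (hT7 : T ^ 2 * N ^ 7 = M ^ 7) (hsieve : R ^ 6 ≤ Q ^ 5 * N) (hQR : Q ≤ 11 * R ^ 2) (hQ1 : 1 ≤ Q)
    (hMT : M ^ 2 ≤ T) :
    LogRel (Real.log M) (Real.log N) (Real.log R) (Real.log Q) (Real.log T) := by
  have lM := Real.log_pow; have l2 : Real.log 2 = Real.log 2 := rfl
  refine ⟨?_, ?_, ?_, ?_, ?_, ?_, ?_, ?_, ?_⟩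
  · have := congrArg Real.log hT7
    rw [Real.log_mul (by positivity) (by positivity), Real.log_pow, Real.log_pow, Real.log_pow] at this
    push_cast at this; linarith
  · have := Real.log_le_log (by positivity) hrel1
    rw [Real.log_mul (by positivity) (by positivity), Real.log_pow,
      Real.log_mul (by positivity) (by positivity), Real.log_mul (by positivity) (by positivity), Real.log_pow] at this
    push_cast at this; linarith
  · have := Real.log_le_log (by positivity) hrel2
    rw [Real.log_mul (by positivity) (by positivity), Real.log_pow,
      Real.log_mul (by positivity) (by positivity), Real.log_mul (by positivity) (by positivity), Real.log_pow] at this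
    push_cast at this; linarith
  · exact Real.log_le_log hR hRN
  · have := Real.log_le_log hN hNR
    rw [Real.log_pow] at this; push_cast at this; linarith
  · have := Real.log_le_log (by positivity) hsieve
    rw [Real.log_pow, Real.log_mul (by positivity) (by positivity), Real.log_pow] at this
    push_cast at this; linarith
  · have := Real.log_le_log hQ hQR
    rw [Real.log_mul (by positivity) (by positivity), Real.log_pow] at this
    push_cast at this; linarith
  · exact Real.log_nonneg hQ1
  · have := Real.log_le_log (by positivity) hMT
    rw [Real.log_pow] at this; push_cast at this; linarith

/-! ### The per-family monomial inequality -/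

/-- A monomial inequality from its logarithmic form: if `log a ≤ c + log b` then `a ≤ e^c b`
(`a, b > 0`). [folklore] -/
theorem le_exp_mul_of_log {a b c : ℝ} (ha : 0 < a) (hb : 0 < b) (h : Real.log a ≤ c + Real.log b) :
    a ≤ Real.exp c * b := by
  have : Real.log a ≤ Real.log (Real.exp c * b) := by
    rw [Real.log_mul (Real.exp_pos c).ne' hb.ne', Real.log_exp]; exact h
  exact (Real.log_le_log_iff ha (by positivity)).1 this

/-- **The per-family product on the sieve arcs, one Graham–Kolesnik term at a time.** With
`X = T/M²` and the four monomials `t₁ = X²Q²R⁶/N⁴`, `t₂ = X²R⁸/N⁴`, `t₃ = XQ²`, `t₄ = X²Q²R²/N²`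
of `gk_terms_le`, and quantities bounded as on the sieve arcs
(`P ≤ cP R/√Q`, `cnt ≤ c₁(M/N)(Q/R)²` and `≤ c₂ max(MR²/(NQ²), R²/Q)`, `F, mx ≤ c max(1, R²/Q²)`,
`H ≤ cH QN/R²`), each product `P¹² cnt¹⁰ F mx² H¹² tᵢ` is `≤ C M¹²/(N⁴R²)`; `C` depends only on
the constants. This is the exponent bookkeeping of Bourgain's (3.12) (`bracket_*`). [cite: BourgainJAMS2017, §4 (3.12)] -/
theorem family_monomial_le {M N R Q T P cnt F mx Hr : ℝ} {cP c₁ c₂ cF cmx cH : ℝ}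
    (hM : 0 < M) (hN : 0 < N) (hR : 0 < R) (hQ : 0 < Q) (hT : 0 < T)
    (hrel1 : 2 * M ^ 3 ≤ N * T * R ^ 2) (hrel2 : N * T * R ^ 2 ≤ 8 * M ^ 3) (hRN : R ≤ N) (hNR : N ≤ R ^ 2)
    (hT7 : T ^ 2 * N ^ 7 = M ^ 7) (hsieve : R ^ 6 ≤ Q ^ 5 * N) (hQR : Q ≤ 11 * R ^ 2) (hQ1 : 1 ≤ Q)
    (hMT : M ^ 2 ≤ T)
    (hcP : 1 ≤ cP) (hc₁ : 1 ≤ c₁) (hc₂ : 1 ≤ c₂) (hcF : 1 ≤ cF) (hcmx : 1 ≤ cmx) (hcH : 1 ≤ cH)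
    (hP0 : 0 ≤ P) (hP : P ≤ cP * R / Real.sqrt Q)
    (hcnt0 : 0 ≤ cnt) (hcnt1 : cnt ≤ c₁ * (M / N) * (Q / R) ^ 2)
    (hcnt2 : cnt ≤ c₂ * max (M * R ^ 2 / (N * Q ^ 2)) (R ^ 2 / Q))
    (hF0 : 0 ≤ F) (hF : F ≤ cF * max 1 (R ^ 2 / Q ^ 2)) (hmx0 : 0 ≤ mx) (hmx : mx ≤ cmx * max 1 (R ^ 2 / Q ^ 2))
    (hH0 : 0 ≤ Hr) (hH : Hr ≤ cH * (Q * N / R ^ 2))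
    (tm : ℝ) (htm : tm = (T / M ^ 2) ^ 2 * Q ^ 2 * R ^ 6 / N ^ 4 ∨ tm = (T / M ^ 2) ^ 2 * R ^ 8 / N ^ 4 ∨
      tm = (T / M ^ 2) * Q ^ 2 ∨ tm = (T / M ^ 2) ^ 2 * Q ^ 2 * R ^ 2 / N ^ 2) :
    P ^ 12 * cnt ^ 10 * F * mx ^ 2 * Hr ^ 12 * tm ≤
      (cP ^ 12 * c₁ ^ 10 * c₂ ^ 10 * cF * cmx ^ 2 * cH ^ 12 * (8 : ℝ) ^ 40 * 11 ^ 40) * (M ^ 12 / (N ^ 4 * R ^ 2)) := by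
  have hX : 0 < T / M ^ 2 := by positivity
  have htm0 : 0 < tm := by rcases htm with h | h | h | h <;> rw [h] <;> positivity
  -- dispose of the degenerate cases where a factor vanishes
  set Cst : ℝ := cP ^ 12 * c₁ ^ 10 * c₂ ^ 10 * cF * cmx ^ 2 * cH ^ 12 * (8 : ℝ) ^ 40 * 11 ^ 40 with hCst
  have hCst0 : 0 < Cst := by positivity
  have hRHS : 0 < Cst * (M ^ 12 / (N ^ 4 * R ^ 2)) := by positivity
  rcases hP0.lt_or_eq with hP0 | hP0
  swap; · rw [← hP0]; simp; exact hRHS.le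
  rcases hcnt0.lt_or_eq with hcnt0 | hcnt0
  swap; · rw [← hcnt0]; simp; exact hRHS.le
  rcases hF0.lt_or_eq with hF0 | hF0
  swap; · rw [← hF0]; simp; exact hRHS.le
  rcases hmx0.lt_or_eq with hmx0 | hmx0
  swap; · rw [← hmx0]; simp; exact hRHS.le
  rcases hH0.lt_or_eq with hH0 | hH0
  swap; · rw [← hH0]; simp; exact hRHS.le
  -- logarithms
  set m := Real.log M with hm
  set n := Real.log N with hn
  set r := Real.log R with hr
  set κ := Real.log Q with hκ
  set t := Real.log T with ht
  have hL : LogRel m n r κ t := logRel_of hM hN hR hQ hT hrel1 hrel2 hRN hNR hT7 hsieve hQR hQ1 hMT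
  have l8 : 0 ≤ Real.log 8 := Real.log_nonneg (by norm_num)
  have l11 : 0 ≤ Real.log 11 := Real.log_nonneg (by norm_num)
  have lcP : 0 ≤ Real.log cP := Real.log_nonneg hcP
  have lc₁ : 0 ≤ Real.log c₁ := Real.log_nonneg hc₁
  have lc₂ : 0 ≤ Real.log c₂ := Real.log_nonneg hc₂
  have lcF : 0 ≤ Real.log cF := Real.log_nonneg hcF
  have lcmx : 0 ≤ Real.log cmx := Real.log_nonneg hcmx
  have lcH : 0 ≤ Real.log cH := Real.log_nonneg hcH
  -- log bounds of the factors
  have hsQ : 0 < Real.sqrt Q := Real.sqrt_pos.2 hQ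
  have eP : Real.log P ≤ Real.log cP + r - κ / 2 := by
    have := Real.log_le_log hP0 hP
    rw [Real.log_div (by positivity) hsQ.ne', Real.log_mul (by positivity) hR.ne', Real.log_sqrt hQ.le] at this
    linarith
  have ecnt1 : Real.log cnt ≤ Real.log c₁ + (m - n) + 2 * (κ - r) := by
    have := Real.log_le_log hcnt0 hcnt1
    rw [Real.log_mul (by positivity) (by positivity), Real.log_mul (by positivity) (by positivity), Real.log_pow,
      Real.log_div hM.ne' hN.ne', Real.log_div hQ.ne' hR.ne'] at this
    push_cast at this; linarith
  have eH : Real.log Hr ≤ Real.log cH + (κ + n - 2 * r) := by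
    have := Real.log_le_log hH0 hH
    rw [Real.log_mul (by positivity) (by positivity), Real.log_div (by positivity) (by positivity),
      Real.log_mul hQ.ne' hN.ne', Real.log_pow] at this
    push_cast at this; linarith
  -- `log tm`
  have etm : Real.log tm = 2 * (t - 2 * m) + 2 * κ + 6 * r - 4 * n ∨ Real.log tm = 2 * (t - 2 * m) + 8 * r - 4 * n ∨
      Real.log tm = (t - 2 * m) + 2 * κ ∨ Real.log tm = 2 * (t - 2 * m) + 2 * κ + 2 * r - 2 * n := by
    have eX : Real.log (T / M ^ 2) = t - 2 * m := by
      rw [Real.log_div hT.ne' (by positivity), Real.log_pow]; push_cast; ring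
    rcases htm with h | h | h | h
    · left; rw [h, Real.log_div (by positivity) (by positivity), Real.log_mul (by positivity) (by positivity),
        Real.log_mul (by positivity) (by positivity), Real.log_pow, eX, Real.log_pow, Real.log_pow, Real.log_pow]
      push_cast; ring
    · right; left; rw [h, Real.log_div (by positivity) (by positivity), Real.log_mul (by positivity) (by positivity),
        Real.log_pow, eX, Real.log_pow, Real.log_pow]
      push_cast; ring
    · right; right; left; rw [h, Real.log_mul (by positivity) (by positivity), eX, Real.log_pow]; push_cast; ring
    · right; right; right; rw [h, Real.log_div (by positivity) (by positivity), Real.log_mul (by positivity) (by positivity),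
        Real.log_mul (by positivity) (by positivity), Real.log_pow, eX, Real.log_pow, Real.log_pow, Real.log_pow]
      push_cast; ring
  -- the target in logs
  have hLHS : 0 < P ^ 12 * cnt ^ 10 * F * mx ^ 2 * Hr ^ 12 * tm := by positivity
  rw [← Real.log_le_log_iff hLHS hRHS]
  have eL : Real.log (P ^ 12 * cnt ^ 10 * F * mx ^ 2 * Hr ^ 12 * tm) =
      12 * Real.log P + 10 * Real.log cnt + Real.log F + 2 * Real.log mx + 12 * Real.log Hr + Real.log tm := by
    rw [Real.log_mul (by positivity) htm0.ne', Real.log_mul (by positivity) (by positivity),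
      Real.log_mul (by positivity) (by positivity), Real.log_mul (by positivity) (by positivity),
      Real.log_mul (by positivity) (by positivity), Real.log_pow, Real.log_pow, Real.log_pow, Real.log_pow]
    push_cast; ring
  have eR : Real.log (Cst * (M ^ 12 / (N ^ 4 * R ^ 2))) =
      (12 * Real.log cP + 10 * Real.log c₁ + 10 * Real.log c₂ + Real.log cF + 2 * Real.log cmx + 12 * Real.log cH
        + 40 * Real.log 8 + 40 * Real.log 11) + (12 * m - 4 * n - 2 * r) := by
    rw [Real.log_mul hCst0.ne' (by positivity), hCst, Real.log_div (by positivity) (by positivity),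
      Real.log_mul (by positivity) (by positivity)]
    rw [Real.log_mul (by positivity) (by positivity), Real.log_mul (by positivity) (by positivity),
      Real.log_mul (by positivity) (by positivity), Real.log_mul (by positivity) (by positivity),
      Real.log_mul (by positivity) (by positivity), Real.log_mul (by positivity) (by positivity),
      Real.log_mul (by positivity) (by positivity)]
    repeat rw [Real.log_pow]
    push_cast; ring
  rw [eL, eR]
  -- case split on `Q ≤ R` / `R ≤ Q` and on the four monomials
  rcases le_total κ r with hcase | hcase
  · -- `Q ≤ R`: near count, boxes `R²/Q²`
    have hmax : max 1 (R ^ 2 / Q ^ 2) = R ^ 2 / Q ^ 2 := by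
      refine max_eq_right ?_
      rw [le_div_iff₀ (by positivity), one_mul]
      have : Q ≤ R := by
        have := (Real.log_le_log_iff hQ hR).1 hcase; exact this
      exact pow_le_pow_left₀ hQ.le this 2
    have eF : Real.log F ≤ Real.log cF + (2 * r - 2 * κ) := by
      have := Real.log_le_log hF0 hF
      rw [hmax, Real.log_mul (by positivity) (by positivity), Real.log_div (by positivity) (by positivity),
        Real.log_pow, Real.log_pow] at this
      push_cast at this; linarith
    have emx : Real.log mx ≤ Real.log cmx + (2 * r - 2 * κ) := by
      have := Real.log_le_log hmx0 hmx
      rw [hmax, Real.log_mul (by positivity) (by positivity), Real.log_div (by positivity) (by positivity),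
        Real.log_pow, Real.log_pow] at this
      push_cast at this; linarith
    rcases etm with e | e | e | e <;> rw [e]
    · have := bracket_A_t1 hL hcase; linarith
    · have := bracket_A_t2 hL hcase; linarith
    · have := bracket_A_t3 hL hcase; linarith
    · have := bracket_A_t4 hL hcase; linarith
  · -- `R ≤ Q`: far count, boxes `1`
    have hRQ : R ≤ Q := (Real.log_le_log_iff hR hQ).1 hcase
    have hmax : max 1 (R ^ 2 / Q ^ 2) = 1 := by
      refine max_eq_left ?_
      rw [div_le_one (by positivity)]
      exact pow_le_pow_left₀ hR.le hRQ 2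
    have eF : Real.log F ≤ Real.log cF := by
      have := Real.log_le_log hF0 hF
      rw [hmax, mul_one] at this; exact this
    have emx : Real.log mx ≤ Real.log cmx := by
      have := Real.log_le_log hmx0 hmx
      rw [hmax, mul_one] at this; exact this
    -- far count: two sub-cases of the max
    rcases le_total (M * R ^ 2 / (N * Q ^ 2)) (R ^ 2 / Q) with hm | hm
    · have ecnt : Real.log cnt ≤ Real.log c₂ + (2 * r - κ) := by
        have := Real.log_le_log hcnt0 hcnt2
        rw [max_eq_right hm, Real.log_mul (by positivity) (by positivity), Real.log_div (by positivity) hQ.ne',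
          Real.log_pow] at this
        push_cast at this; linarith
      rcases etm with e | e | e | e <;> rw [e]
      · have := bracket_B2_t1 hL hcase; linarith
      · have := bracket_B2_t2 hL hcase; linarith
      · have := bracket_B2_t3 hL hcase; linarith
      · have := bracket_B2_t4 hL hcase; linarith
    · have ecnt : Real.log cnt ≤ Real.log c₂ + (m - n + 2 * r - 2 * κ) := by
        have := Real.log_le_log hcnt0 hcnt2
        rw [max_eq_left hm, Real.log_mul (by positivity) (by positivity), Real.log_div (by positivity) (by positivity),
          Real.log_mul hM.ne' (by positivity), Real.log_mul hN.ne' (by positivity), Real.log_pow, Real.log_pow] at this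
        push_cast at this; linarith
      rcases etm with e | e | e | e <;> rw [e]
      · have := bracket_B1_t1 hL hcase; linarith
      · have := bracket_B1_t2 hL hcase; linarith
      · have := bracket_B1_t3 hL hcase; linarith
      · have := bracket_B1_t4 hL hcase; linarith



/-! ### The parameter regime of Bourgain's §4 (for `c = 1`) and its elementary consequences -/

/-- The standing hypotheses on `(T, M, N, R)` with the block parameters `L = ⌊N/8⌋`, `ℓ = L/2`:
`N ≥ 2^20`, `T ≥ 2^70`, `M² ≤ T`, `T² N⁷ = M⁷` (i.e. `N = M T^{-2/7}`), `N < M`,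
`2M³ ≤ NTR² ≤ 8M³`, `R ≤ N ≤ R²`. [cite: BourgainJAMS2017, §4 (3.3), (3.6) and before (3.13)] -/
structure Good (T M N : ℝ) (R L ℓ : ℕ) : Prop where
  hN0 : (2 : ℝ) ^ 20 ≤ N
  hT0 : (2 : ℝ) ^ 70 ≤ T
  hMT : M ^ 2 ≤ T
  hT7 : T ^ 2 * N ^ 7 = M ^ 7
  hNM : N < M
  hrel1 : 2 * M ^ 3 ≤ N * T * R ^ 2
  hrel2 : N * T * R ^ 2 ≤ 8 * M ^ 3
  hRN : (R : ℝ) ≤ N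
  hNR : N ≤ (R : ℝ) ^ 2
  hL : L = ⌊N / 8⌋₊
  hℓ : ℓ = L / 2

namespace Good

variable {T M N : ℝ} {R L ℓ : ℕ} (h : Good T M N R L ℓ)
include h

/-- `N_pos`: an auxiliary step of the proof of Bourgain's (3.12) for `F = log`. [folklore] -/
theorem N_pos : 0 < N := lt_of_lt_of_le (by positivity) h.hN0
/-- `T_pos`: an auxiliary step of the proof of Bourgain's (3.12) for `F = log`. [folklore] -/
theorem T_pos : 0 < T := lt_of_lt_of_le (by positivity) h.hT0
/-- `M_pos`: an auxiliary step of the proof of Bourgain's (3.12) for `F = log`. [folklore] -/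
theorem M_pos : 0 < M := h.N_pos.trans h.hNM
/-- `R_pos`: an auxiliary step of the proof of Bourgain's (3.12) for `F = log`. [folklore] -/
theorem R_pos : (0 : ℝ) < R := by
  have := h.hNR; have hN := h.N_pos
  by_contra hR; rw [not_lt] at hR
  have : (R : ℝ) = 0 := le_antisymm hR (Nat.cast_nonneg _)
  rw [this] at *; nlinarith
/-- `one_le_R`: an auxiliary step of the proof of Bourgain's (3.12) for `F = log`. [folklore] -/
theorem one_le_R : 1 ≤ R := by
  have := h.R_pos; exact_mod_cast Nat.one_le_iff_ne_zero.2 (by rintro rfl; simp at this)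

/-- `T^{2/7} = M/N ≥ 2^{20}`: from `T² N⁷ = M⁷` and `T ≥ 2^70`. More usefully: `N · 2^20 ≤ M`. [folklore] -/
theorem N_mul_le_M : N * 2 ^ 20 ≤ M := by
  -- `(M/N)^7 = T^2 ≥ 2^140`, so `M/N ≥ 2^20`
  have hN := h.N_pos; have hM := h.M_pos
  have h7 : (N * 2 ^ 20) ^ 7 ≤ M ^ 7 := by
    rw [← h.hT7, mul_pow]
    have : ((2 : ℝ) ^ 20) ^ 7 = (2 ^ 70) ^ 2 := by norm_num
    rw [this, mul_comm]
    exact mul_le_mul_of_nonneg_right (pow_le_pow_left₀ (by positivity) h.hT0 2) (by positivity)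
  exact (pow_le_pow_iff_left₀ (by positivity) hM.le (by norm_num)).1 h7

/-- `L ≥ N/8 - 1` and `L ≤ N/8`. [folklore] -/
theorem L_bounds : N / 8 - 1 ≤ (L : ℝ) ∧ (L : ℝ) ≤ N / 8 := by
  rw [h.hL]
  exact ⟨by have := Nat.lt_floor_add_one (N / 8); linarith,
    Nat.floor_le (by have := h.N_pos; positivity)⟩

/-- `ℓ ≥ N/16 - 2` and `ℓ ≤ N/16`. [folklore] -/
theorem ell_bounds : N / 16 - 2 ≤ (ℓ : ℝ) ∧ (ℓ : ℝ) ≤ N / 16 := by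
  obtain ⟨h1, h2⟩ := h.L_bounds
  have h3 : (ℓ : ℝ) = ((L / 2 : ℕ) : ℝ) := by rw [h.hℓ]
  have h4 : ((L / 2 : ℕ) : ℝ) ≤ (L : ℝ) / 2 := Nat.cast_div_le
  have h5 : (L : ℝ) / 2 - 1 ≤ ((L / 2 : ℕ) : ℝ) := by
    have : (L : ℝ) ≤ 2 * ((L / 2 : ℕ) : ℝ) + 1 := by exact_mod_cast (by omega : L ≤ 2 * (L / 2) + 1)
    linarith
  rw [h3]; constructor <;> linarith

/-- `one_le_ell`: an auxiliary step of the proof of Bourgain's (3.12) for `F = log`. [folklore] -/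
theorem one_le_ell : 1 ≤ ℓ := by
  have := h.ell_bounds.1; have := h.hN0
  have : (1 : ℝ) ≤ ℓ := by linarith [show (2:ℝ) ^ 20 = 1048576 by norm_num]
  exact_mod_cast this

/-- `ell_le_L`: an auxiliary step of the proof of Bourgain's (3.12) for `F = log`. [folklore] -/
theorem ell_le_L : ℓ ≤ L := by rw [h.hℓ]; exact Nat.div_le_self L 2

/-- `L + 1 ≤ ⌈M/2⌉`. [folklore] -/
theorem L_succ_le : L + 1 ≤ ⌈M / 2⌉₊ := by
  have h1 := h.L_bounds.2; have h2 := h.N_mul_le_M; have hN := h.N_pos; have h0 := h.hN0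
  have : (L : ℝ) + 1 ≤ M / 2 := by nlinarith [show (2:ℝ) ^ 20 = 1048576 by norm_num]
  have : ((L + 1 : ℕ) : ℝ) ≤ ⌈M / 2⌉₊ := by push_cast; exact this.trans (Nat.le_ceil _)
  exact_mod_cast this

/-- `ceil_le_floor`: an auxiliary step of the proof of Bourgain's (3.12) for `F = log`. [folklore] -/
theorem ceil_le_floor : ⌈M / 2⌉₊ ≤ ⌊M⌋₊ + 1 := by
  have hM := h.M_pos
  have h1 : (⌈M / 2⌉₊ : ℝ) < M / 2 + 1 := Nat.ceil_lt_add_one (by positivity)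
  have h2 : M < (⌊M⌋₊ : ℝ) + 1 := Nat.lt_floor_add_one M
  have : (⌈M / 2⌉₊ : ℝ) < (⌊M⌋₊ : ℝ) + 1 + 1 := by linarith
  have : ⌈M / 2⌉₊ < ⌊M⌋₊ + 1 + 1 := by exact_mod_cast this
  omega

/-- The Taylor points: `m_k ∈ [0.49 M, M]` for `k < K`. [folklore] -/
theorem blockStart_bounds {k : ℕ} (hk : k < blockCount M ℓ) :
    49 / 100 * M ≤ (blockStart M ℓ L k : ℝ) ∧ (blockStart M ℓ L k : ℝ) ≤ M := by
  have hM := h.M_pos; have hN := h.N_pos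
  have hL1 := h.L_succ_le
  have hLb := h.L_bounds.2; have hNM := h.N_mul_le_M
  -- lower bound: `m_k ≥ ⌈M/2⌉ - 1 - L ≥ M/2 - 1 - N/8`
  have hlow : ((⌈M / 2⌉₊ - 1 - L : ℕ) : ℝ) ≤ (blockStart M ℓ L k : ℝ) := by
    unfold blockStart
    have : ⌈M / 2⌉₊ - 1 - L ≤ ⌈M / 2⌉₊ - 1 + k * ℓ - L := by
      generalize k * ℓ = x; omega
    exact_mod_cast this
  have hcast : ((⌈M / 2⌉₊ - 1 - L : ℕ) : ℝ) = (⌈M / 2⌉₊ : ℝ) - 1 - L := by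
    rw [Nat.cast_sub (by omega), Nat.cast_sub (by omega)]; simp
  have hceil : M / 2 ≤ (⌈M / 2⌉₊ : ℝ) := Nat.le_ceil _
  constructor
  · rw [hcast] at hlow
    have : M / 2 - 1 - N / 8 ≤ (blockStart M ℓ L k : ℝ) := by linarith
    -- `1 + N/8 ≤ 0.01 M` since `M ≥ 2^20 N` and `N ≥ 2^20`
    nlinarith [h.hN0, show (2:ℝ) ^ 20 = 1048576 by norm_num]
  · -- upper bound: `k < K = (⌊M⌋+1-⌈M/2⌉)/ℓ` gives `kℓ ≤ ⌊M⌋ + 1 - ⌈M/2⌉ - ℓ`... precisely `(k+1)ℓ ≤ ⌊M⌋+1-⌈M/2⌉`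
    have hK : (k + 1) * ℓ ≤ ⌊M⌋₊ + 1 - ⌈M / 2⌉₊ := by
      have h1 : k < (⌊M⌋₊ + 1 - ⌈M / 2⌉₊) / ℓ := hk
      exact (Nat.le_div_iff_mul_le (by have := h.one_le_ell; omega)).1 h1
    have : blockStart M ℓ L k ≤ ⌊M⌋₊ := by
      unfold blockStart
      have h3 : k * ℓ + ℓ ≤ ⌊M⌋₊ + 1 - ⌈M / 2⌉₊ := by rw [← Nat.succ_mul]; exact hK
      have h4 := h.one_le_ell
      generalize k * ℓ = x at h3 ⊢
      omega
    have h2 : (⌊M⌋₊ : ℝ) ≤ M := Nat.floor_le hM.le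
    exact le_trans (by exact_mod_cast this) h2

/-- `μ_k = T/(3m_k³) ∈ [T/(3M³), 9 T/(3M³)]`. [folklore] -/
theorem mu_bounds {k : ℕ} (hk : k < blockCount M ℓ) :
    T / (3 * M ^ 3) ≤ muOf T (blockStart M ℓ L k) ∧ muOf T (blockStart M ℓ L k) ≤ 9 * (T / (3 * M ^ 3)) := by
  obtain ⟨h1, h2⟩ := h.blockStart_bounds hk
  have hM := h.M_pos; have hT := h.T_pos
  have hm : 0 < (blockStart M ℓ L k : ℝ) := lt_of_lt_of_le (by positivity) h1
  unfold muOf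
  constructor
  · exact div_le_div_of_nonneg_left hT.le (by positivity) (by nlinarith [pow_le_pow_left₀ hm.le h2 3])
  · rw [show 9 * (T / (3 * M ^ 3)) = T / (3 * M ^ 3 / 9) by field_simp]
    apply div_le_div_of_nonneg_left hT.le (by positivity)
    have : (49 / 100 * M) ^ 3 ≤ (blockStart M ℓ L k : ℝ) ^ 3 := pow_le_pow_left₀ (by positivity) h1 3
    nlinarith [this, pow_pos hM 3]

/-- `T/M³ ≤ 8/(NR²)` and `T/M³ ≥ 2/(NR²)`. [folklore] -/
theorem T_div_M3 : 2 / (N * R ^ 2) ≤ T / M ^ 3 ∧ T / M ^ 3 ≤ 8 / (N * R ^ 2) := by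
  have hM := h.M_pos; have hN := h.N_pos; have hR := h.R_pos
  constructor
  · rw [div_le_div_iff₀ (by positivity) (by positivity)]; nlinarith [h.hrel1]
  · rw [div_le_div_iff₀ (by positivity) (by positivity)]; nlinarith [h.hrel2]

/-- `|s_k| ≤ N/40`. [folklore] -/
theorem abs_s_le {k : ℕ} (hk : k < blockCount M ℓ) : |sOf T (blockStart M ℓ L k) R| ≤ N / 40 := by
  obtain ⟨h1, h2⟩ := h.blockStart_bounds hk
  have hM := h.M_pos; have hT := h.T_pos; have hR := h.R_pos; have hN := h.N_pos
  have hm : 0 < (blockStart M ℓ L k : ℝ) := lt_of_lt_of_le (by positivity) h1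
  refine (abs_sOf_le hT hm h.one_le_R).trans ?_
  -- `m³/(20R²T) ≤ M³/(20R²T) ≤ N/40` from `2M³ ≤ NTR²`
  calc (blockStart M ℓ L k : ℝ) ^ 3 / (20 * (R : ℝ) ^ 2 * T) ≤ M ^ 3 / (20 * (R : ℝ) ^ 2 * T) := by gcongr
    _ ≤ N / 40 := by
        rw [div_le_div_iff₀ (by positivity) (by positivity)]; nlinarith [h.hrel1]

/-- `N' = L + s ∈ [0.09 N, 0.15 N]`. [folklore] -/
theorem Nprime_bounds {k : ℕ} (hk : k < blockCount M ℓ) :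
    9 / 100 * N ≤ (L : ℝ) + sOf T (blockStart M ℓ L k) R ∧ (L : ℝ) + sOf T (blockStart M ℓ L k) R ≤ 15 / 100 * N := by
  have hs := abs_le.1 (h.abs_s_le hk)
  obtain ⟨h1, h2⟩ := h.L_bounds
  have := h.hN0
  constructor <;> nlinarith [show (2:ℝ) ^ 20 = 1048576 by norm_num]

/-- `μ N'² ≤ 1` (in fact `≤ 0.51`). [folklore] -/
theorem mu_Nprime_sq_le {k : ℕ} (hk : k < blockCount M ℓ) :
    muOf T (blockStart M ℓ L k) * ((L : ℝ) + sOf T (blockStart M ℓ L k) R) ^ 2 ≤ 1 := by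
  obtain ⟨_, hμ⟩ := h.mu_bounds hk
  obtain ⟨hN1, hN2⟩ := h.Nprime_bounds hk
  obtain ⟨_, hTM⟩ := h.T_div_M3
  have hN := h.N_pos; have hR := h.R_pos; have hM := h.M_pos; have hT := h.T_pos
  have hNR := h.hNR
  have hsq : ((L : ℝ) + sOf T (blockStart M ℓ L k) R) ^ 2 ≤ (15 / 100 * N) ^ 2 :=
    pow_le_pow_left₀ (by linarith) hN2 2
  have hμ0 : 0 ≤ muOf T (blockStart M ℓ L k) := (muOf_pos hT (lt_of_lt_of_le (by positivity) (h.blockStart_bounds hk).1)).le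
  have hNR1 : N / (R : ℝ) ^ 2 ≤ 1 := (div_le_one (by positivity)).2 hNR
  calc muOf T (blockStart M ℓ L k) * ((L : ℝ) + sOf T (blockStart M ℓ L k) R) ^ 2
      ≤ 9 * (T / (3 * M ^ 3)) * (15 / 100 * N) ^ 2 := mul_le_mul hμ hsq (by positivity) (by positivity)
    _ = 9 * (15 / 100) ^ 2 / 3 * (T / M ^ 3) * N ^ 2 := by field_simp
    _ ≤ 9 * (15 / 100) ^ 2 / 3 * (8 / (N * R ^ 2)) * N ^ 2 := by gcongr
    _ = 54 / 100 * (N / R ^ 2) := by field_simp; norm_num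
    _ ≤ 1 := by linarith

/-- `1 ≤ L`, indeed `L ≥ 2^16`. [folklore] -/
theorem L_large : (2 : ℝ) ^ 16 ≤ L := by
  have := h.L_bounds.1; have := h.hN0
  nlinarith [show (2:ℝ) ^ 20 = 1048576 by norm_num, show (2:ℝ) ^ 16 = 65536 by norm_num]

/-- `ℓ ≤ L + s` (so that `n₁ + s ≤ 2(L + s)` for `n₁ ≤ L + ℓ`). [folklore] -/
theorem ell_le_Nprime {k : ℕ} (hk : k < blockCount M ℓ) : (ℓ : ℝ) ≤ (L : ℝ) + sOf T (blockStart M ℓ L k) R := by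
  have h1 := (h.Nprime_bounds hk).1; have h2 := h.ell_bounds.2; have hN := h.N_pos
  linarith

/-- The Abel factor of `block_le_cubicSum` is at most `2`. [folklore] -/
theorem abel_factor_le_two {k : ℕ} (hk : k < blockCount M ℓ) :
    1 + 2 * π * T * ((L + ℓ : ℕ) : ℝ) ^ 3 * (((L + ℓ : ℕ) : ℝ) - L) / (blockStart M ℓ L k : ℝ) ^ 4 ≤ 2 := by
  obtain ⟨hm1, hm2⟩ := h.blockStart_bounds hk
  have hM := h.M_pos; have hN := h.N_pos; have hT := h.T_pos
  have hm : 0 < (blockStart M ℓ L k : ℝ) := lt_of_lt_of_le (by positivity) hm1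
  obtain ⟨_, hL2⟩ := h.L_bounds; obtain ⟨_, hl2⟩ := h.ell_bounds
  have hLl : ((L + ℓ : ℕ) : ℝ) ≤ 3 / 16 * N := by push_cast; linarith
  have hdiff : ((L + ℓ : ℕ) : ℝ) - L ≤ N / 16 := by push_cast; linarith
  have hdiff0 : 0 ≤ ((L + ℓ : ℕ) : ℝ) - L := by push_cast; linarith [(Nat.cast_nonneg ℓ : (0:ℝ) ≤ ℓ)]
  -- `T N⁴ ≤ M⁴` from `T² N⁷ = M⁷` and `N ≤ M`
  have hTN : T * N ^ 4 ≤ M ^ 4 := by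
    have h7 := h.hT7
    have : (T * N ^ 4) ^ 2 ≤ (M ^ 4) ^ 2 := by
      have : (T * N ^ 4) ^ 2 = T ^ 2 * N ^ 7 * N := by ring
      rw [this, h7]
      have : (M ^ 4) ^ 2 = M ^ 7 * M := by ring
      rw [this]
      exact mul_le_mul_of_nonneg_left h.hNM.le (by positivity)
    exact (pow_le_pow_iff_left₀ (by positivity) (by positivity) two_ne_zero).1 this
  have key : 2 * π * T * ((L + ℓ : ℕ) : ℝ) ^ 3 * (((L + ℓ : ℕ) : ℝ) - L) / (blockStart M ℓ L k : ℝ) ^ 4 ≤ 1 := by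
    rw [div_le_one (by positivity)]
    have hpi : π ≤ 4 := by linarith [Real.pi_lt_four]
    have h3 : ((L + ℓ : ℕ) : ℝ) ^ 3 ≤ (3 / 16 * N) ^ 3 := pow_le_pow_left₀ (by positivity) hLl 3
    have h4 : (49 / 100 * M) ^ 4 ≤ (blockStart M ℓ L k : ℝ) ^ 4 := pow_le_pow_left₀ (by positivity) hm1 4
    calc 2 * π * T * ((L + ℓ : ℕ) : ℝ) ^ 3 * (((L + ℓ : ℕ) : ℝ) - L)
        ≤ 2 * 4 * T * (3 / 16 * N) ^ 3 * (N / 16) := by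
          apply mul_le_mul (mul_le_mul (by nlinarith) h3 (by positivity) (by positivity)) hdiff hdiff0 (by positivity)
      _ = (27 / 8192) * (T * N ^ 4) := by ring
      _ ≤ (27 / 8192) * M ^ 4 := by gcongr
      _ ≤ (49 / 100 * M) ^ 4 := by nlinarith [pow_pos hM 4]
      _ ≤ (blockStart M ℓ L k : ℝ) ^ 4 := h4
  linarith

/-- The range of the points: `x_k = -T/(2m_k²) ∈ [u, u + Λ]`, `u = -T/(2(0.49M)²)`, `Λ ≤ 3T/M²`. [folklore] -/
theorem xcoef_mem {k : ℕ} (hk : k < blockCount M ℓ) :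
    LogSumBlocks.xcoef T (blockStart M ℓ L k) ∈
      Set.Icc (-(T / (2 * (49 / 100 * M) ^ 2))) (-(T / (2 * (49 / 100 * M) ^ 2)) + 2 * (T / M ^ 2)) := by
  obtain ⟨hm1, hm2⟩ := h.blockStart_bounds hk
  have hM := h.M_pos; have hT := h.T_pos
  have hm : 0 < (blockStart M ℓ L k : ℝ) := lt_of_lt_of_le (by positivity) hm1
  unfold LogSumBlocks.xcoef
  constructor
  · -- `-T/(2(0.49M)²) ≤ -T/(2m²)` since `m ≥ 0.49M`
    have : T / (2 * (blockStart M ℓ L k : ℝ) ^ 2) ≤ T / (2 * (49 / 100 * M) ^ 2) := by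
      apply div_le_div_of_nonneg_left hT.le (by positivity)
      nlinarith [pow_le_pow_left₀ (by positivity : (0:ℝ) ≤ 49 / 100 * M) hm1 2]
    linarith
  · have h1 : T / (2 * M ^ 2) ≤ T / (2 * (blockStart M ℓ L k : ℝ) ^ 2) := by
      apply div_le_div_of_nonneg_left hT.le (by positivity)
      nlinarith [pow_le_pow_left₀ hm.le hm2 2]
    have h2 : T / (2 * (49 / 100 * M) ^ 2) = (10000 / 4802) * (T / M ^ 2) := by field_simp; norm_num
    have h3 : T / (2 * M ^ 2) = (1 / 2) * (T / M ^ 2) := by field_simp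
    have : 0 ≤ T / M ^ 2 := by positivity
    nlinarith

/-- `2η/δ ≤ 2` with `η = 1/(20R²)`, `δ = Tℓ/(2M³)`. [folklore] -/
theorem two_eta_div_delta_le : 2 * LogSumBlocks.eta R / (T * ℓ / (2 * M ^ 3)) ≤ 2 := by
  have hM := h.M_pos; have hT := h.T_pos; have hR := h.R_pos; have hN := h.N_pos
  obtain ⟨hl1, _⟩ := h.ell_bounds
  have hℓ : (0 : ℝ) < ℓ := by have := h.one_le_ell; exact_mod_cast this
  unfold LogSumBlocks.eta
  rw [div_le_iff₀ (by positivity)]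
  -- `2/(20R²) ≤ 2 Tℓ/(2M³)` iff `M³ ≤ 10 R² T ℓ`; from `2M³ ≤ NTR²` and `ℓ ≥ N/16 - 2 ≥ N/20`
  have hℓN : N / 20 ≤ ℓ := by have := h.hN0; nlinarith [show (2:ℝ) ^ 20 = 1048576 by norm_num]
  have : 2 * (1 / (20 * (R : ℝ) ^ 2)) = 1 / (10 * R ^ 2) := by ring
  rw [this, div_le_iff₀ (by positivity)]
  have : 2 * (T * ℓ / (2 * M ^ 3)) * (10 * R ^ 2) = 10 * (T * ℓ * R ^ 2) / M ^ 3 := by field_simp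
  rw [this, le_div_iff₀ (by positivity)]
  nlinarith [h.hrel1, mul_le_mul_of_nonneg_left hℓN (by positivity : (0:ℝ) ≤ T * R ^ 2)]

/-- `1 ≤ ⌈M/2⌉ - 1 - L` as a real number (the first Taylor point is `≥ 1`). [folklore] -/
theorem one_le_m0 : (1 : ℝ) ≤ ((⌈M / 2⌉₊ - 1 - L : ℕ) : ℝ) := by
  have hL1 := h.L_succ_le
  have h1 : 0 < blockCount M ℓ ∨ True := Or.inr trivial
  have hcast : ((⌈M / 2⌉₊ - 1 - L : ℕ) : ℝ) = (⌈M / 2⌉₊ : ℝ) - 1 - L := by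
    rw [Nat.cast_sub (by omega), Nat.cast_sub (by omega)]; simp
  rw [hcast]
  have hceil : M / 2 ≤ (⌈M / 2⌉₊ : ℝ) := Nat.le_ceil _
  have := h.L_bounds.2; have := h.N_mul_le_M; have := h.hN0; have := h.N_pos
  nlinarith [show (2:ℝ) ^ 20 = 1048576 by norm_num]

/-- Every Taylor point is positive (indeed `≥ 1`). [folklore] -/
theorem blockStart_pos (k : ℕ) : (0 : ℝ) < (blockStart M ℓ L k : ℝ) := by
  have h1 := h.one_le_m0; have hL1 := h.L_succ_le
  have : ((⌈M / 2⌉₊ - 1 - L : ℕ) : ℝ) ≤ (blockStart M ℓ L k : ℝ) := by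
    unfold blockStart
    have : ⌈M / 2⌉₊ - 1 - L ≤ ⌈M / 2⌉₊ - 1 + k * ℓ - L := by generalize k * ℓ = x; omega
    exact_mod_cast this
  linarith

/-- **Reduction of `S` to the twisted cubic sums of its blocks:** there are endpoints
`n₁(k) ∈ [L, L+ℓ]` with `‖S‖ ≤ 2 ∑_{k<K} ‖cubicSum_k(n₁ k)‖ + ℓ`. [cite: BourgainJAMS2017, §4 before (3.4)] -/
theorem norm_S_le_cubic :
    ∃ n₁ : ℕ → ℕ, (∀ k, n₁ k ∈ Finset.Icc L (L + ℓ)) ∧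
      ‖bourgainSum Real.log T M‖ ≤
        2 * ∑ k ∈ Finset.range (blockCount M ℓ),
          ‖cubicSum (qOf T (blockStart M ℓ L k) R) (aOf T (blockStart M ℓ L k) R) (bOf T (blockStart M ℓ L k) R)
            (muOf T (blockStart M ℓ L k)) (sOf T (blockStart M ℓ L k) R) (lamOf T (blockStart M ℓ L k) R) L (n₁ k)‖ + ℓ := by
  have hT := h.T_pos; have hM := h.M_pos
  have hex : ∀ k, ∃ n₁ ∈ Finset.Icc L (L + ℓ),
      ‖∑ n ∈ Finset.Ioc L (L + ℓ), Complex.exp (2 * π * Complex.I *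
        (T * Real.log (((blockStart M ℓ L k : ℝ) + n) / M) : ℝ))‖ ≤
        (1 + 2 * π * T * ((L + ℓ : ℕ) : ℝ) ^ 3 * (((L + ℓ : ℕ) : ℝ) - L) / (blockStart M ℓ L k : ℝ) ^ 4) *
          ‖cubicSum (qOf T (blockStart M ℓ L k) R) (aOf T (blockStart M ℓ L k) R) (bOf T (blockStart M ℓ L k) R)
            (muOf T (blockStart M ℓ L k)) (sOf T (blockStart M ℓ L k) R) (lamOf T (blockStart M ℓ L k) R) L n₁‖ :=
    fun k => block_le_cubicSum hT hM (h.blockStart_pos k) R L ℓ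
  choose n₁ hn₁ hle using hex
  refine ⟨n₁, hn₁, ?_⟩
  refine (norm_bourgainSum_le_blocks T M h.one_le_ell h.L_succ_le h.ceil_le_floor).trans ?_
  gcongr with k hk
  · rw [Finset.mul_sum]
    refine Finset.sum_le_sum fun k hk => ?_
    rw [Finset.mem_range] at hk
    exact (hle k).trans (mul_le_mul_of_nonneg_right (h.abel_factor_le_two hk) (norm_nonneg _))

/-! ### Integer-power consequences of `T² N⁷ = M⁷`, `N²T ≤ 8M³` -/

/-- `N² T ≤ 8 M³` (from `N ≤ R²` and `NTR² ≤ 8M³`). [folklore] -/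
theorem N2T_le : N ^ 2 * T ≤ 8 * M ^ 3 := by
  have hN := h.N_pos; have hT := h.T_pos
  calc N ^ 2 * T = N * T * N := by ring
    _ ≤ N * T * R ^ 2 := by gcongr; exact h.hNR
    _ ≤ 8 * M ^ 3 := h.hrel2

/-- `T³ ≤ 2²¹ M⁷` (i.e. `T^{3/7} ≤ 8M`). [folklore] -/
theorem T3_le : T ^ 3 ≤ 2 ^ 21 * M ^ 7 := by
  have hN := h.N_pos; have hT := h.T_pos; have hM := h.M_pos
  have h1 : (N ^ 2 * T) ^ 7 ≤ (8 * M ^ 3) ^ 7 := pow_le_pow_left₀ (by positivity) h.N2T_le 7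
  have h2 : (N ^ 2 * T) ^ 7 * T ^ 4 = M ^ 14 * T ^ 7 := by
    have := h.hT7
    calc (N ^ 2 * T) ^ 7 * T ^ 4 = (T ^ 2 * N ^ 7) ^ 2 * T ^ 7 := by ring
      _ = (M ^ 7) ^ 2 * T ^ 7 := by rw [this]
      _ = M ^ 14 * T ^ 7 := by ring
  have h3 : M ^ 14 * T ^ 7 ≤ (8 * M ^ 3) ^ 7 * T ^ 4 := by rw [← h2]; gcongr
  have h4 : (8 * M ^ 3) ^ 7 * T ^ 4 = 2 ^ 21 * M ^ 7 * (M ^ 14 * T ^ 4) := by ring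
  rw [h4] at h3
  have hpos : 0 < M ^ 14 * T ^ 4 := by positivity
  have : M ^ 14 * T ^ 7 = T ^ 3 * (M ^ 14 * T ^ 4) := by ring
  rw [this] at h3
  exact le_of_mul_le_mul_right h3 hpos

/-- `T⁸ ≤ M²¹` (uses `T ≥ 2^63`). [folklore] -/
theorem T8_le : T ^ 8 ≤ M ^ 21 := by
  have hT := h.T_pos; have hM := h.M_pos
  have h1 : (T ^ 3) ^ 3 ≤ (2 ^ 21 * M ^ 7) ^ 3 := pow_le_pow_left₀ (by positivity) h.T3_le 3
  have h2 : (2 : ℝ) ^ 63 ≤ T := le_trans (by norm_num) h.hT0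
  have h3 : T ^ 9 ≤ T * M ^ 21 := by
    calc T ^ 9 = (T ^ 3) ^ 3 := by ring
      _ ≤ (2 ^ 21 * M ^ 7) ^ 3 := h1
      _ = 2 ^ 63 * M ^ 21 := by ring
      _ ≤ T * M ^ 21 := by gcongr
  have : T ^ 9 = T ^ 8 * T := by ring
  rw [this, mul_comm T] at h3
  exact le_of_mul_le_mul_right h3 hT

/-- `M ≤ N⁴`. [folklore] -/
theorem M_le_N4 : M ≤ N ^ 4 := by
  have hT := h.T_pos; have hM := h.M_pos; have hN := h.N_pos
  have h1 : M ^ 7 * T ^ 8 ≤ M ^ 7 * M ^ 21 := by gcongr; exact h.T8_le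
  have h2 : M ^ 7 * M ^ 21 = (N ^ 4) ^ 7 * T ^ 8 := by
    have := h.hT7
    calc M ^ 7 * M ^ 21 = (M ^ 7) ^ 4 := by ring
      _ = (T ^ 2 * N ^ 7) ^ 4 := by rw [this]
      _ = (N ^ 4) ^ 7 * T ^ 8 := by ring
  rw [h2] at h1
  have h3 := le_of_mul_le_mul_right h1 (by positivity : (0:ℝ) < T ^ 8)
  exact (pow_le_pow_iff_left₀ hM.le (by positivity) (by norm_num)).1 h3

/-- `T² N³ ≤ M⁶`. [folklore] -/
theorem T2N3_le : T ^ 2 * N ^ 3 ≤ M ^ 6 := by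
  have hN := h.N_pos; have hM := h.M_pos
  have h1 := h.M_le_N4
  have e : T ^ 2 * N ^ 3 * N ^ 4 = M ^ 6 * M := by
    have := h.hT7
    calc T ^ 2 * N ^ 3 * N ^ 4 = T ^ 2 * N ^ 7 := by ring
      _ = M ^ 7 := this
      _ = M ^ 6 * M := by ring
  -- `T²N³ · N⁴ = M⁶ · M ≤ M⁶ · N⁴`
  have h2 : T ^ 2 * N ^ 3 * N ^ 4 ≤ M ^ 6 * N ^ 4 := by rw [e]; gcongr
  exact le_of_mul_le_mul_right h2 (by positivity)

/-- `T N^{3/2} ≤ M³`, i.e. `T √N · N ≤ M³`. [folklore] -/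
theorem T_mul_N_sqrtN_le : T * (N * Real.sqrt N) ≤ M ^ 3 := by
  have hN := h.N_pos; have hM := h.M_pos; have hT := h.T_pos
  have h1 : (T * (N * Real.sqrt N)) ^ 2 ≤ (M ^ 3) ^ 2 := by
    have : (T * (N * Real.sqrt N)) ^ 2 = T ^ 2 * N ^ 3 := by
      rw [mul_pow, mul_pow, Real.sq_sqrt hN.le]; ring
    rw [this]; calc T ^ 2 * N ^ 3 ≤ M ^ 6 := h.T2N3_le
      _ = (M ^ 3) ^ 2 := by ring
  exact (pow_le_pow_iff_left₀ (by positivity) (by positivity) two_ne_zero).1 h1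

/-- The number of blocks: `K ≤ 21 M/N`. [folklore] -/
theorem blockCount_le : (blockCount M ℓ : ℝ) ≤ 21 * M / N := by
  have hN := h.N_pos; have hM := h.M_pos
  obtain ⟨hl1, _⟩ := h.ell_bounds
  have hℓ : (0:ℝ) < ℓ := by have := h.one_le_ell; exact_mod_cast this
  have h1 : (blockCount M ℓ : ℝ) ≤ ((⌊M⌋₊ + 1 - ⌈M / 2⌉₊ : ℕ) : ℝ) / ℓ := by
    unfold blockCount; exact Nat.cast_div_le
  have h2 : ((⌊M⌋₊ + 1 - ⌈M / 2⌉₊ : ℕ) : ℝ) ≤ M + 1 := by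
    have : ((⌊M⌋₊ + 1 - ⌈M / 2⌉₊ : ℕ) : ℝ) ≤ ((⌊M⌋₊ + 1 : ℕ) : ℝ) := by exact_mod_cast Nat.sub_le _ _
    have h3 : (⌊M⌋₊ : ℝ) ≤ M := Nat.floor_le hM.le
    push_cast at this; linarith
  have hℓN : N / 20 ≤ ℓ := by have := h.hN0; nlinarith [show (2:ℝ) ^ 20 = 1048576 by norm_num]
  calc (blockCount M ℓ : ℝ) ≤ (M + 1) / ℓ := h1.trans (div_le_div_of_nonneg_right h2 hℓ.le)
    _ ≤ (M + 1) / (N / 20) := div_le_div_of_nonneg_left (by positivity) (by positivity) hℓN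
    _ ≤ 21 * M / N := by
        rw [div_le_div_iff₀ (by positivity) hN]
        have := h.N_mul_le_M; have := h.hN0; nlinarith [show (2:ℝ) ^ 20 = 1048576 by norm_num]

end Good



/-! ### Per-block quantities as functions of the Taylor point -/

/-- `‖cubicSum‖` of the block with Taylor point `m` and endpoint `n₁`. [folklore] -/
def cubicB (T m : ℝ) (R L n₁ : ℕ) : ℝ :=
  ‖cubicSum (qOf T m R) (aOf T m R) (bOf T m R) (muOf T m) (sOf T m R) (lamOf T m R) L n₁‖

/-- `‖mainTerm‖` of the block. [folklore] -/
def mtB (T m : ℝ) (R L n₁ : ℕ) : ℝ :=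
  ‖mainTerm (qOf T m R) (aOf T m R) (bOf T m R) (muOf T m) (sOf T m R) (lamOf T m R) L n₁‖

/-- `H₀ = μ q N'²` of the block. [folklore] -/
def H0 (T m : ℝ) (R L : ℕ) : ℝ := muOf T m * qOf T m R * ((L : ℝ) + sOf T m R) ^ 2

/-- The minor-arc error `2 + 11/(μN'²) + 90√N' + 2222√q(1+log q)`. [folklore] -/
def errMin (T m : ℝ) (R L : ℕ) : ℝ :=
  2 + 11 / (muOf T m * ((L : ℝ) + sOf T m R) ^ 2) + 90 * Real.sqrt ((L : ℝ) + sOf T m R) +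
    2222 * Real.sqrt (qOf T m R) * (1 + Real.log (qOf T m R))

/-- The major-arc bound `2 + 11/(μN'²) + 227√q(1+log q) + 37√(2q)(ℓ+1)`. [folklore] -/
def errMaj (T m : ℝ) (R L ℓ : ℕ) : ℝ :=
  2 + 11 / (muOf T m * ((L : ℝ) + sOf T m R) ^ 2) + 227 * Real.sqrt (qOf T m R) * (1 + Real.log (qOf T m R)) +
    37 * Real.sqrt (2 * qOf T m R) * ((ℓ : ℝ) + 1)

/-- The trivial bound `15 √(μq) N' √N'` for the main term. [folklore] -/
def trivB (T m : ℝ) (R L : ℕ) : ℝ :=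
  15 * Real.sqrt (muOf T m * qOf T m R) * ((L : ℝ) + sOf T m R) * Real.sqrt ((L : ℝ) + sOf T m R)

namespace Good

variable {T M N : ℝ} {R L ℓ : ℕ} (h : Good T M N R L ℓ)
include h

omit h in
/-- An empty block sum vanishes. [folklore] -/
theorem cubicB_eq_zero {k : ℕ} : cubicB T (blockStart M ℓ L k) R L L = 0 := by
  unfold cubicB cubicSum
  simp

/-- `errMin_nonneg`: an auxiliary step of the proof of Bourgain's (3.12) for `F = log`. [folklore] -/
theorem errMin_nonneg {k : ℕ} (hk : k < blockCount M ℓ) : 0 ≤ errMin T (blockStart M ℓ L k) R L := by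
  unfold errMin
  have hN' := (h.Nprime_bounds hk).1; have hN := h.N_pos
  have hμ := (muOf_pos h.T_pos (h.blockStart_pos k)).le
  have hq : (1 : ℝ) ≤ qOf T (blockStart M ℓ L k) R := by exact_mod_cast qOf_pos
  have hlog : 0 ≤ Real.log (qOf T (blockStart M ℓ L k) R) := Real.log_nonneg hq
  have : 0 ≤ (L : ℝ) + sOf T (blockStart M ℓ L k) R := by linarith
  positivity

/-- `errMaj_nonneg`: an auxiliary step of the proof of Bourgain's (3.12) for `F = log`. [folklore] -/
theorem errMaj_nonneg {k : ℕ} (hk : k < blockCount M ℓ) : 0 ≤ errMaj T (blockStart M ℓ L k) R L ℓ := by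
  unfold errMaj
  have hN' := (h.Nprime_bounds hk).1; have hN := h.N_pos
  have hμ := (muOf_pos h.T_pos (h.blockStart_pos k)).le
  have hq : (1 : ℝ) ≤ qOf T (blockStart M ℓ L k) R := by exact_mod_cast qOf_pos
  have hlog : 0 ≤ Real.log (qOf T (blockStart M ℓ L k) R) := Real.log_nonneg hq
  have : 0 ≤ (L : ℝ) + sOf T (blockStart M ℓ L k) R := by linarith
  positivity

/-- **Major-arc block.** [folklore] -/
theorem cubicB_le_major {k : ℕ} (hk : k < blockCount M ℓ) {n₁ : ℕ} (hn₁ : n₁ ∈ Finset.Icc L (L + ℓ)) :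
    cubicB T (blockStart M ℓ L k) R L n₁ ≤ errMaj T (blockStart M ℓ L k) R L ℓ := by
  rw [Finset.mem_Icc] at hn₁
  rcases Nat.eq_or_lt_of_le hn₁.1 with heq | hlt
  · rw [← heq, cubicB_eq_zero]; exact h.errMaj_nonneg hk
  have hT := h.T_pos
  have hm := h.blockStart_pos k
  obtain ⟨hN'1, hN'2⟩ := h.Nprime_bounds hk
  have hN := h.N_pos
  have hmaj := norm_cubicSum_le_major (q := qOf T (blockStart M ℓ L k) R) (isUnit_aOf h.one_le_R)
    (bOf T (blockStart M ℓ L k) R) (μ := muOf T (blockStart M ℓ L k)) (s := sOf T (blockStart M ℓ L k) R)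
    (lam := lamOf T (blockStart M ℓ L k) R) (N := (L : ℝ)) (N₁ := (n₁ : ℝ)) (muOf_pos hT hm)
    (by have := h.L_large; linarith [show (2:ℝ) ^ 16 = 65536 by norm_num])
    (by exact_mod_cast hlt) (by linarith [h.hN0, show (2:ℝ) ^ 20 = 1048576 by norm_num]) (by
      have := h.ell_le_Nprime hk
      have : (n₁ : ℝ) ≤ L + ℓ := by exact_mod_cast hn₁.2
      linarith)
    (h.mu_Nprime_sq_le hk) abs_q_mul_lamOf_le
  unfold cubicB errMaj
  refine hmaj.trans ?_
  have : (n₁ : ℝ) + 1 - L ≤ ℓ + 1 := by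
    have : (n₁ : ℝ) ≤ L + ℓ := by exact_mod_cast hn₁.2
    linarith
  have h0 : 0 ≤ 37 * Real.sqrt (2 * (qOf T (blockStart M ℓ L k) R : ℝ)) := by positivity
  nlinarith [mul_le_mul_of_nonneg_left this h0]

/-- **Minor-arc block.** [folklore] -/
theorem cubicB_le_minor {k : ℕ} (hk : k < blockCount M ℓ) {n₁ : ℕ} (hn₁ : n₁ ∈ Finset.Icc L (L + ℓ))
    (hH : 1 ≤ H0 T (blockStart M ℓ L k) R L) :
    cubicB T (blockStart M ℓ L k) R L n₁ ≤ errMin T (blockStart M ℓ L k) R L + mtB T (blockStart M ℓ L k) R L n₁ := by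
  rw [Finset.mem_Icc] at hn₁
  rcases Nat.eq_or_lt_of_le hn₁.1 with heq | hlt
  · rw [← heq, cubicB_eq_zero]
    exact add_nonneg (h.errMin_nonneg hk) (norm_nonneg _)
  have hT := h.T_pos
  have hm := h.blockStart_pos k
  obtain ⟨hN'1, hN'2⟩ := h.Nprime_bounds hk
  have hN := h.N_pos
  have hmin := norm_cubicSum_le_minor (q := qOf T (blockStart M ℓ L k) R) (isUnit_aOf h.one_le_R)
    (bOf T (blockStart M ℓ L k) R) (μ := muOf T (blockStart M ℓ L k)) (s := sOf T (blockStart M ℓ L k) R)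
    (lam := lamOf T (blockStart M ℓ L k) R) (N := (L : ℝ)) (N₁ := (n₁ : ℝ)) (muOf_pos hT hm)
    (by have := h.L_large; linarith [show (2:ℝ) ^ 16 = 65536 by norm_num])
    (by exact_mod_cast hlt) (by linarith [h.hN0, show (2:ℝ) ^ 20 = 1048576 by norm_num]) (by
      have := h.ell_le_Nprime hk
      have : (n₁ : ℝ) ≤ L + ℓ := by exact_mod_cast hn₁.2
      linarith)
    (h.mu_Nprime_sq_le hk) abs_q_mul_lamOf_le hH
  unfold cubicB errMin mtB
  exact hmin

/-- **Trivial bound for the main term of a minor block.** [folklore] -/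
theorem mtB_le_triv {k : ℕ} (hk : k < blockCount M ℓ) {n₁ : ℕ} (hn₁ : n₁ ∈ Finset.Icc L (L + ℓ))
    (hH : 1 ≤ H0 T (blockStart M ℓ L k) R L) :
    mtB T (blockStart M ℓ L k) R L n₁ ≤ trivB T (blockStart M ℓ L k) R L := by
  rw [Finset.mem_Icc] at hn₁
  have hT := h.T_pos
  have hm := h.blockStart_pos k
  obtain ⟨hN'1, hN'2⟩ := h.Nprime_bounds hk
  have hN := h.N_pos
  have := norm_mainTerm_le_triv (q := qOf T (blockStart M ℓ L k) R) (isUnit_aOf h.one_le_R)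
    (bOf T (blockStart M ℓ L k) R) (μ := muOf T (blockStart M ℓ L k)) (s := sOf T (blockStart M ℓ L k) R)
    (lam := lamOf T (blockStart M ℓ L k) R) (N := (L : ℝ)) (N₁ := (n₁ : ℝ)) (muOf_pos hT hm)
    (by linarith [h.hN0, show (2:ℝ) ^ 20 = 1048576 by norm_num]) (by exact_mod_cast hn₁.1) (by
      have := h.ell_le_Nprime hk
      have : (n₁ : ℝ) ≤ L + ℓ := by exact_mod_cast hn₁.2
      linarith) hH
  unfold mtB trivB
  exact this

end Good


namespace Good

variable {T M N : ℝ} {R L ℓ : ℕ} (h : Good T M N R L ℓ)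
include h

/-! ### Counting blocks in the regime `Good` -/

/-- `η ≤ 1/20 ≤ T/M²/2`. [folklore] -/
theorem eta_le : LogSumBlocks.eta R ≤ 1 / 20 := by
  unfold LogSumBlocks.eta
  have hR : (1 : ℝ) ≤ R := by exact_mod_cast h.one_le_R
  rw [div_le_div_iff₀ (by positivity) (by norm_num)]
  nlinarith

/-- `one_le_T_div_M2`: an auxiliary step of the proof of Bourgain's (3.12) for `F = log`. [folklore] -/
theorem one_le_T_div_M2 : 1 ≤ T / M ^ 2 := by
  rw [le_div_iff₀ (by have := h.M_pos; positivity)]; linarith [h.hMT]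

/-- **Near count:** `#{k < K : Q₁ ≤ q_k < Q₂} ≤ 3 (Q₂ - Q₁)(3 Q₂ T/M² + 1)`. [folklore] -/
theorem card_near_le {Q₁ Q₂ : ℕ} (hQ₁ : 0 < Q₁) (hQ : Q₁ ≤ Q₂) :
    (((Finset.range (blockCount M ℓ)).filter fun k =>
        Q₁ ≤ qOf T (blockStart M ℓ L k) R ∧ qOf T (blockStart M ℓ L k) R < Q₂).card : ℝ) ≤
      3 * ((Q₂ : ℝ) - Q₁) * (3 * Q₂ * (T / M ^ 2) + 1) := by
  classical
  have hT := h.T_pos; have hM := h.M_pos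
  have h1 := card_filter_le_near (Finset.range (blockCount M ℓ)) (T := T) (M := M) (Mx := M) (R := R) (ℓ := ℓ) (L := L)
    (u := -(T / (2 * (49 / 100 * M) ^ 2))) (Λ := 2 * (T / M ^ 2)) hT h.one_le_ell h.one_le_R h.L_succ_le h.one_le_m0 hM
    (by positivity) (fun k hk => (h.blockStart_bounds (Finset.mem_range.1 hk)).2)
    (fun k hk => h.xcoef_mem (Finset.mem_range.1 hk)) hQ₁ hQ
  refine h1.trans ?_
  have hη := h.eta_le; have hη0 := (eta_pos h.one_le_R).le
  have hr := h.two_eta_div_delta_le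
  have hTM := h.one_le_T_div_M2
  have hQ12 : (Q₁ : ℝ) ≤ Q₂ := by exact_mod_cast hQ
  have hQQ : (0 : ℝ) ≤ (Q₂ : ℝ) - Q₁ := by linarith
  have hQ₂ : (0 : ℝ) ≤ Q₂ := Nat.cast_nonneg _
  have hmid : (Q₂ : ℝ) * (2 * (T / M ^ 2) + 2 * LogSumBlocks.eta R) + 1 ≤ 3 * Q₂ * (T / M ^ 2) + 1 := by nlinarith
  have hmid0 : 0 ≤ (Q₂ : ℝ) * (2 * (T / M ^ 2) + 2 * LogSumBlocks.eta R) + 1 := by positivity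
  have hr0 : 0 ≤ 2 * LogSumBlocks.eta R / (T * ℓ / (2 * M ^ 3)) := by
    have : (1:ℝ) ≤ ℓ := by exact_mod_cast h.one_le_ell
    positivity
  calc ((Q₂ : ℝ) - Q₁) * (Q₂ * (2 * (T / M ^ 2) + 2 * LogSumBlocks.eta R) + 1) *
        (2 * LogSumBlocks.eta R / (T * ℓ / (2 * M ^ 3)) + 1)
      ≤ ((Q₂ : ℝ) - Q₁) * (3 * Q₂ * (T / M ^ 2) + 1) * 3 := by
        apply mul_le_mul (mul_le_mul_of_nonneg_left hmid hQQ) (by linarith) (by positivity) (by positivity)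
    _ = 3 * ((Q₂ : ℝ) - Q₁) * (3 * Q₂ * (T / M ^ 2) + 1) := by ring

/-- **Far count:** for `Q ≥ 2`, `#{k < K : Q ≤ q_k} ≤ 17640 max(MR²/(N(Q-1)²), R²/(Q-1))`. [folklore] -/
theorem card_far_le {Q : ℕ} (hQ : 2 ≤ Q) :
    (((Finset.range (blockCount M ℓ)).filter fun k => Q ≤ qOf T (blockStart M ℓ L k) R).card : ℝ) ≤
      17640 * max (M * R ^ 2 / (N * ((Q : ℝ) - 1) ^ 2)) (R ^ 2 / ((Q : ℝ) - 1)) := by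
  classical
  have hT := h.T_pos; have hM := h.M_pos; have hN := h.N_pos; have hR := h.R_pos
  have h1 := card_filter_le_far (Finset.range (blockCount M ℓ)) (T := T) (M := M) (Mx := M) (R := R) (ℓ := ℓ) (L := L)
    (u := -(T / (2 * (49 / 100 * M) ^ 2))) (Λ := 2 * (T / M ^ 2)) hT h.one_le_ell h.one_le_R h.L_succ_le h.one_le_m0 hM
    (by positivity) (fun k hk => (h.blockStart_bounds (Finset.mem_range.1 hk)).2)
    (fun k hk => h.xcoef_mem (Finset.mem_range.1 hk)) hQ
  refine h1.trans ?_
  -- `far_env` with `Q' = Q - 1 ≥ 1`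
  have hQ' : (1 : ℝ) ≤ (Q : ℝ) - 1 := by
    have : (2 : ℝ) ≤ Q := by exact_mod_cast hQ
    linarith
  have hℓN : N / 20 ≤ ℓ := by
    have := h.ell_bounds.1; have := h.hN0; nlinarith [show (2:ℝ) ^ 20 = 1048576 by norm_num]
  have henv := far_env (Q := (Q : ℝ) - 1) (Λ := 2 * (T / M ^ 2)) (T := T) (M := M) (N := N) (R := (R : ℝ)) (ℓ := (ℓ : ℝ))
    hQ' (by positivity) (by nlinarith [h.one_le_T_div_M2]) h.one_le_T_div_M2 hM hN hR hT hℓN h.hrel2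
  have e : (Q : ℝ) - 1 + 1 = Q := by ring
  rw [e] at henv
  unfold LogSumBlocks.eta at h1 ⊢
  convert henv using 2

/-! ### The sum of `√q_k` over all blocks -/

/-- `q_k ≤ 11 R²`. [folklore] -/
theorem q_le (k : ℕ) : (qOf T (blockStart M ℓ L k) R : ℝ) ≤ 11 * R ^ 2 := by
  have h1 := qOf_le (T := T) (m := (blockStart M ℓ L k : ℝ)) h.one_le_R
  have hR : (1 : ℝ) ≤ R := by exact_mod_cast h.one_le_R
  nlinarith

/-- `R³ N ≤ M²` (so that `R^{3/2} ≤ M N^{-1/2}`). [folklore] -/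
theorem R3N_le : (R : ℝ) ^ 3 * N ≤ M ^ 2 := by
  have hN := h.N_pos; have hM := h.M_pos; have hT := h.T_pos; have hR := h.R_pos
  -- `(R³N)² = R⁶ N² ≤ (8M³/(NT))³ N² = 512 M⁹/(N T³)`, and `512 M⁹ ≤ M⁴ N T³`
  have hR2 : (R : ℝ) ^ 2 * (N * T) ≤ 8 * M ^ 3 := by nlinarith [h.hrel2]
  have h1 : ((R : ℝ) ^ 3 * N) ^ 2 * (N * T ^ 3) ≤ 512 * M ^ 9 := by
    have : ((R : ℝ) ^ 3 * N) ^ 2 * (N * T ^ 3) = ((R : ℝ) ^ 2 * (N * T)) ^ 3 := by ring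
    rw [this]
    calc ((R : ℝ) ^ 2 * (N * T)) ^ 3 ≤ (8 * M ^ 3) ^ 3 := pow_le_pow_left₀ (by positivity) hR2 3
      _ = 512 * M ^ 9 := by ring
  -- `512 M⁹ ≤ M⁴ · N T³`: from `(N T³)⁷ = M⁷ T¹⁹ ≥ 2⁶³ M³⁵` using `T⁵ ≥ 2⁶³` and `M² ≤ T`
  have h2 : 512 * M ^ 5 ≤ N * T ^ 3 := by
    have h7 : (512 * M ^ 5) ^ 7 ≤ (N * T ^ 3) ^ 7 := by
      have e : (N * T ^ 3) ^ 7 = M ^ 7 * T ^ 19 := by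
        have := h.hT7
        calc (N * T ^ 3) ^ 7 = (T ^ 2 * N ^ 7) * T ^ 19 := by ring
          _ = M ^ 7 * T ^ 19 := by rw [this]
      rw [e]
      have hMT14 : M ^ 28 ≤ T ^ 14 := by
        calc M ^ 28 = (M ^ 2) ^ 14 := by ring
          _ ≤ T ^ 14 := pow_le_pow_left₀ (by positivity) h.hMT 14
      have hT5 : (2 : ℝ) ^ 63 ≤ T ^ 5 := by
        calc (2 : ℝ) ^ 63 ≤ 2 ^ 70 := by norm_num
          _ ≤ T := h.hT0
          _ ≤ T ^ 5 := le_self_pow₀ (by linarith [h.hT0, show (1:ℝ) ≤ 2 ^ 70 by norm_num]) (by norm_num)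
      calc (512 * M ^ 5 : ℝ) ^ 7 = 2 ^ 63 * M ^ 28 * M ^ 7 := by ring
        _ ≤ T ^ 5 * T ^ 14 * M ^ 7 := by gcongr
        _ = M ^ 7 * T ^ 19 := by ring
    exact (pow_le_pow_iff_left₀ (by positivity) (by positivity) (by norm_num)).1 h7
  have h3 : ((R : ℝ) ^ 3 * N) ^ 2 * (N * T ^ 3) ≤ (M ^ 2) ^ 2 * (N * T ^ 3) := by
    calc ((R : ℝ) ^ 3 * N) ^ 2 * (N * T ^ 3) ≤ 512 * M ^ 9 := h1
      _ = M ^ 4 * (512 * M ^ 5) := by ring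
      _ ≤ M ^ 4 * (N * T ^ 3) := by gcongr
      _ = (M ^ 2) ^ 2 * (N * T ^ 3) := by ring
  have h4 := le_of_mul_le_mul_right h3 (by positivity : (0:ℝ) < N * T ^ 3)
  exact (pow_le_pow_iff_left₀ (by positivity) (by positivity) two_ne_zero).1 h4

/-- `R^{3/2} ≤ M/√N` in the form `R √R ≤ M/√N`. [folklore] -/
theorem R_sqrtR_le : (R : ℝ) * Real.sqrt R ≤ M / Real.sqrt N := by
  have hN := h.N_pos; have hM := h.M_pos; have hR := h.R_pos
  have hsN : 0 < Real.sqrt N := Real.sqrt_pos.2 hN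
  rw [le_div_iff₀ hsN]
  have h1 : ((R : ℝ) * Real.sqrt R * Real.sqrt N) ^ 2 ≤ M ^ 2 := by
    have : ((R : ℝ) * Real.sqrt R * Real.sqrt N) ^ 2 = (R : ℝ) ^ 3 * N := by
      rw [mul_pow, mul_pow, Real.sq_sqrt hR.le, Real.sq_sqrt hN.le]; ring
    rw [this]; exact h.R3N_le
  exact (pow_le_pow_iff_left₀ (by positivity) hM.le two_ne_zero).1 h1

/-- `(M/N) √R ≤ M/√N`. [folklore] -/
theorem MN_sqrtR_le : M / N * Real.sqrt R ≤ M / Real.sqrt N := by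
  have hN := h.N_pos; have hM := h.M_pos; have hR := h.R_pos
  have hsN : 0 < Real.sqrt N := Real.sqrt_pos.2 hN
  have hRN : Real.sqrt R ≤ Real.sqrt N := Real.sqrt_le_sqrt h.hRN
  have hNN : Real.sqrt N * Real.sqrt N = N := Real.mul_self_sqrt hN.le
  rw [div_mul_eq_mul_div, div_le_div_iff₀ hN hsN]
  calc M * Real.sqrt R * Real.sqrt N ≤ M * Real.sqrt N * Real.sqrt N := by gcongr
    _ = M * N := by rw [mul_assoc, hNN]

end Good

namespace Good

variable {T M N : ℝ} {R L ℓ : ℕ} (h : Good T M N R L ℓ)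
include h

/-! ### Dyadic classes of denominators -/

/-- `T/M² ≤ 8 M/(N R²)`. [folklore] -/
theorem T_div_M2_le : T / M ^ 2 ≤ 8 * M / (N * R ^ 2) := by
  have hM := h.M_pos; have hN := h.N_pos; have hR := h.R_pos
  rw [div_le_div_iff₀ (by positivity) (by positivity)]; nlinarith [h.hrel2]

/-- **Dyadic class, near count:** `#{k < K : 2^i ≤ q_k < 2^{i+1}} ≤ 168 (M/N) 4^i/R²`. [folklore] -/
theorem card_class_le_near (i : ℕ) :
    (((Finset.range (blockCount M ℓ)).filter fun k =>
        2 ^ i ≤ qOf T (blockStart M ℓ L k) R ∧ qOf T (blockStart M ℓ L k) R < 2 ^ (i + 1)).card : ℝ) ≤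
      168 * (M / N) * ((2 : ℝ) ^ i) ^ 2 / R ^ 2 := by
  have hM := h.M_pos; have hN := h.N_pos; have hR := h.R_pos
  have h1 := h.card_near_le (Q₁ := 2 ^ i) (Q₂ := 2 ^ (i + 1)) (pow_pos two_pos i) (Nat.pow_le_pow_right two_pos (by omega))
  refine h1.trans ?_
  have hTM := h.one_le_T_div_M2
  have hTM' := h.T_div_M2_le
  have h2i : (1 : ℝ) ≤ (2 : ℝ) ^ i := one_le_pow₀ (by norm_num)
  push_cast
  have e : ((2 : ℝ) ^ (i + 1) - 2 ^ i) = 2 ^ i := by ring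
  rw [e, pow_succ]
  calc 3 * (2 : ℝ) ^ i * (3 * (2 ^ i * 2) * (T / M ^ 2) + 1) ≤ 3 * (2 : ℝ) ^ i * (7 * 2 ^ i * (T / M ^ 2)) := by
        apply mul_le_mul_of_nonneg_left _ (by positivity)
        nlinarith [mul_le_mul h2i hTM zero_le_one (by positivity)]
    _ = 21 * ((2 : ℝ) ^ i) ^ 2 * (T / M ^ 2) := by ring
    _ ≤ 21 * ((2 : ℝ) ^ i) ^ 2 * (8 * M / (N * R ^ 2)) := by gcongr
    _ = 168 * (M / N) * ((2 : ℝ) ^ i) ^ 2 / R ^ 2 := by field_simp; norm_num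

/-- **Dyadic class, far count:** for `2^i ≥ 2`,
`#{k < K : 2^i ≤ q_k < 2^{i+1}} ≤ 70560 max((M/N) R²/4^i, R²/2^i)`. [folklore] -/
theorem card_class_le_far {i : ℕ} (hi : 1 ≤ i) :
    (((Finset.range (blockCount M ℓ)).filter fun k =>
        2 ^ i ≤ qOf T (blockStart M ℓ L k) R ∧ qOf T (blockStart M ℓ L k) R < 2 ^ (i + 1)).card : ℝ) ≤
      70560 * max (M / N * R ^ 2 / ((2 : ℝ) ^ i) ^ 2) (R ^ 2 / (2 : ℝ) ^ i) := by
  classical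
  have hM := h.M_pos; have hN := h.N_pos; have hR := h.R_pos
  have h2 : 2 ≤ 2 ^ i := by calc 2 = 2 ^ 1 := by norm_num
                              _ ≤ 2 ^ i := Nat.pow_le_pow_right two_pos hi
  have hsub : ((Finset.range (blockCount M ℓ)).filter fun k =>
        2 ^ i ≤ qOf T (blockStart M ℓ L k) R ∧ qOf T (blockStart M ℓ L k) R < 2 ^ (i + 1)) ⊆
      ((Finset.range (blockCount M ℓ)).filter fun k => 2 ^ i ≤ qOf T (blockStart M ℓ L k) R) := by
    intro k hk; rw [Finset.mem_filter] at hk ⊢; exact ⟨hk.1, hk.2.1⟩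
  have h1 := h.card_far_le h2
  refine le_trans (by exact_mod_cast Finset.card_le_card hsub) (h1.trans ?_)
  push_cast
  -- `2^i - 1 ≥ 2^i / 2`
  have hge : (2 : ℝ) ^ i / 2 ≤ (2 : ℝ) ^ i - 1 := by
    have : (2 : ℝ) ≤ (2 : ℝ) ^ i := by exact_mod_cast h2
    linarith
  have hpos : 0 < (2 : ℝ) ^ i / 2 := by positivity
  have hm1 : M * R ^ 2 / (N * ((2 : ℝ) ^ i - 1) ^ 2) ≤ 4 * (M / N * R ^ 2 / ((2 : ℝ) ^ i) ^ 2) := by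
    have : M * R ^ 2 / (N * ((2 : ℝ) ^ i - 1) ^ 2) ≤ M * R ^ 2 / (N * ((2 : ℝ) ^ i / 2) ^ 2) := by
      apply div_le_div_of_nonneg_left (by positivity) (by positivity)
      exact mul_le_mul_of_nonneg_left (pow_le_pow_left₀ hpos.le hge 2) hN.le
    refine this.trans (le_of_eq ?_)
    field_simp; ring
  have hm2 : R ^ 2 / ((2 : ℝ) ^ i - 1) ≤ 2 * (R ^ 2 / (2 : ℝ) ^ i) := by
    have : R ^ 2 / ((2 : ℝ) ^ i - 1) ≤ R ^ 2 / ((2 : ℝ) ^ i / 2) := div_le_div_of_nonneg_left (by positivity) hpos hge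
    refine this.trans (le_of_eq ?_); field_simp
  have hmax : max (M * R ^ 2 / (N * ((2 : ℝ) ^ i - 1) ^ 2)) (R ^ 2 / ((2 : ℝ) ^ i - 1)) ≤
      4 * max (M / N * R ^ 2 / ((2 : ℝ) ^ i) ^ 2) (R ^ 2 / (2 : ℝ) ^ i) := by
    refine max_le (hm1.trans ?_) (hm2.trans ?_)
    · exact mul_le_mul_of_nonneg_left (le_max_left _ _) (by norm_num)
    · calc 2 * (R ^ 2 / (2 : ℝ) ^ i) ≤ 4 * (R ^ 2 / (2 : ℝ) ^ i) := by
            have : 0 ≤ R ^ 2 / (2 : ℝ) ^ i := by positivity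
            nlinarith
        _ ≤ 4 * max (M / N * R ^ 2 / ((2 : ℝ) ^ i) ^ 2) (R ^ 2 / (2 : ℝ) ^ i) :=
            mul_le_mul_of_nonneg_left (le_max_right _ _) (by norm_num)
  linarith

/-- **Per dyadic class:** `∑_{k : 2^i ≤ q_k < 2^{i+1}} √q_k ≤ 150000 · M/√N`. [folklore] -/
theorem sum_class_sqrt_le (i : ℕ) :
    ∑ k ∈ (Finset.range (blockCount M ℓ)).filter (fun k =>
        2 ^ i ≤ qOf T (blockStart M ℓ L k) R ∧ qOf T (blockStart M ℓ L k) R < 2 ^ (i + 1)),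
      Real.sqrt (qOf T (blockStart M ℓ L k) R) ≤ 150000 * (M / Real.sqrt N) := by
  classical
  have hM := h.M_pos; have hN := h.N_pos; have hR := h.R_pos
  set F := (Finset.range (blockCount M ℓ)).filter (fun k =>
        2 ^ i ≤ qOf T (blockStart M ℓ L k) R ∧ qOf T (blockStart M ℓ L k) R < 2 ^ (i + 1)) with hF
  -- each term `≤ √2 √(2^i)`
  have hQ : 0 < (2 : ℝ) ^ i := by positivity
  have hterm : ∀ k ∈ F, Real.sqrt (qOf T (blockStart M ℓ L k) R) ≤ Real.sqrt 2 * Real.sqrt ((2 : ℝ) ^ i) := by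
    intro k hk
    rw [hF, Finset.mem_filter] at hk
    rw [← Real.sqrt_mul (by norm_num)]
    apply Real.sqrt_le_sqrt
    have : (qOf T (blockStart M ℓ L k) R : ℝ) < (2 : ℝ) ^ (i + 1) := by exact_mod_cast hk.2.2
    rw [pow_succ] at this; linarith
  have hsum : ∑ k ∈ F, Real.sqrt (qOf T (blockStart M ℓ L k) R) ≤ F.card * (Real.sqrt 2 * Real.sqrt ((2 : ℝ) ^ i)) := by
    have := Finset.sum_le_sum hterm
    rwa [Finset.sum_const, nsmul_eq_mul] at this
  refine hsum.trans ?_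
  have hs2 : Real.sqrt 2 ≤ 3 / 2 := by rw [Real.sqrt_le_left (by norm_num)]; norm_num
  have hsQ : 0 < Real.sqrt ((2 : ℝ) ^ i) := Real.sqrt_pos.2 hQ
  have hsQ2 : Real.sqrt ((2 : ℝ) ^ i) ^ 2 = (2 : ℝ) ^ i := Real.sq_sqrt hQ.le
  have hsR : 0 < Real.sqrt R := Real.sqrt_pos.2 hR
  have hsR2 : Real.sqrt (R : ℝ) ^ 2 = R := Real.sq_sqrt hR.le
  have hMN := h.MN_sqrtR_le; have hRR := h.R_sqrtR_le
  have hMsN : 0 < M / Real.sqrt N := by have := Real.sqrt_pos.2 hN; positivity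
  rcases le_or_gt ((2 : ℝ) ^ i) R with hle | hgt
  · -- `2^i ≤ R`: near count
    have hc := h.card_class_le_near i
    rw [← hF] at hc
    -- `card ≤ 168 (M/N) 4^i / R²`, times `√2 √(2^i)`: `≤ 168 √2 (M/N) (2^i)^{5/2}/R² ≤ 168√2 (M/N)√R`
    have hsle : Real.sqrt ((2 : ℝ) ^ i) ≤ Real.sqrt R := Real.sqrt_le_sqrt hle
    calc (F.card : ℝ) * (Real.sqrt 2 * Real.sqrt ((2 : ℝ) ^ i))
        ≤ (168 * (M / N) * ((2 : ℝ) ^ i) ^ 2 / R ^ 2) * (Real.sqrt 2 * Real.sqrt ((2 : ℝ) ^ i)) :=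
          mul_le_mul_of_nonneg_right hc (by positivity)
      _ ≤ (168 * (M / N) * (R : ℝ) ^ 2 / R ^ 2) * (3 / 2 * Real.sqrt R) := by
          apply mul_le_mul _ (mul_le_mul hs2 hsle hsQ.le (by norm_num)) (by positivity) (by positivity)
          gcongr
      _ = 252 * (M / N * Real.sqrt R) := by field_simp; norm_num
      _ ≤ 252 * (M / Real.sqrt N) := by gcongr
      _ ≤ 150000 * (M / Real.sqrt N) := by nlinarith
  · -- `2^i > R ≥ 1`: far count (then `i ≥ 1`)
    have hi : 1 ≤ i := by
      by_contra h0; rw [not_le] at h0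
      have : i = 0 := by omega
      rw [this, pow_zero] at hgt
      have : (1 : ℝ) ≤ R := by exact_mod_cast h.one_le_R
      linarith
    have hc := h.card_class_le_far hi
    rw [← hF] at hc
    have hsge : Real.sqrt R ≤ Real.sqrt ((2 : ℝ) ^ i) := Real.sqrt_le_sqrt hgt.le
    -- the two branches of the max
    have hb1 : (M / N * R ^ 2 / ((2 : ℝ) ^ i) ^ 2) * (Real.sqrt 2 * Real.sqrt ((2 : ℝ) ^ i)) ≤ 3 / 2 * (M / N * Real.sqrt R) := by
      -- `R²/(2^i)^{3/2} ≤ √R` since `2^i ≥ R`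
      have key : (R : ℝ) ^ 2 * Real.sqrt ((2 : ℝ) ^ i) ≤ Real.sqrt R * ((2 : ℝ) ^ i) ^ 2 := by
        -- `R² √Q ≤ √R Q²` iff `R^{3/2} ≤ Q^{3/2}`
        have h1 : (R : ℝ) * Real.sqrt R ≤ (2 : ℝ) ^ i * Real.sqrt ((2 : ℝ) ^ i) :=
          mul_le_mul hgt.le hsge hsR.le hQ.le
        have e1 : (R : ℝ) ^ 2 * Real.sqrt ((2 : ℝ) ^ i) = (R * Real.sqrt R) * (Real.sqrt R * Real.sqrt ((2 : ℝ) ^ i)) := by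
          rw [show (R : ℝ) * Real.sqrt R * (Real.sqrt R * Real.sqrt ((2 : ℝ) ^ i)) =
            R * (Real.sqrt R * Real.sqrt R) * Real.sqrt ((2 : ℝ) ^ i) by ring, Real.mul_self_sqrt hR.le]; ring
        have e2 : Real.sqrt R * ((2 : ℝ) ^ i) ^ 2 = ((2 : ℝ) ^ i * Real.sqrt ((2 : ℝ) ^ i)) * (Real.sqrt R * Real.sqrt ((2 : ℝ) ^ i)) := by
          rw [show ((2 : ℝ) ^ i * Real.sqrt ((2 : ℝ) ^ i)) * (Real.sqrt R * Real.sqrt ((2 : ℝ) ^ i)) =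
            Real.sqrt R * (2 : ℝ) ^ i * (Real.sqrt ((2 : ℝ) ^ i) * Real.sqrt ((2 : ℝ) ^ i)) by ring, Real.mul_self_sqrt hQ.le]; ring
        rw [e1, e2]
        exact mul_le_mul_of_nonneg_right h1 (by positivity)
      have hMN0 : 0 ≤ M / N := by positivity
      calc (M / N * R ^ 2 / ((2 : ℝ) ^ i) ^ 2) * (Real.sqrt 2 * Real.sqrt ((2 : ℝ) ^ i))
          = Real.sqrt 2 * (M / N) * ((R : ℝ) ^ 2 * Real.sqrt ((2 : ℝ) ^ i) / ((2 : ℝ) ^ i) ^ 2) := by ring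
        _ ≤ 3 / 2 * (M / N) * (Real.sqrt R * ((2 : ℝ) ^ i) ^ 2 / ((2 : ℝ) ^ i) ^ 2) := by
            apply mul_le_mul (by nlinarith) (div_le_div_of_nonneg_right key (by positivity)) (by positivity) (by positivity)
        _ = 3 / 2 * (M / N * Real.sqrt R) := by field_simp
    have hb2 : (R ^ 2 / (2 : ℝ) ^ i) * (Real.sqrt 2 * Real.sqrt ((2 : ℝ) ^ i)) ≤ 3 / 2 * (R * Real.sqrt R) := by
      -- `R² √Q / Q = R²/√Q ≤ R √R` since `√Q ≥ √R`
      have key : (R : ℝ) ^ 2 * Real.sqrt ((2 : ℝ) ^ i) ≤ (R * Real.sqrt R) * (2 : ℝ) ^ i := by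
        have hRle : (R : ℝ) ≤ Real.sqrt R * Real.sqrt ((2 : ℝ) ^ i) := by
          calc (R : ℝ) = Real.sqrt R * Real.sqrt R := (Real.mul_self_sqrt hR.le).symm
            _ ≤ Real.sqrt R * Real.sqrt ((2 : ℝ) ^ i) := by gcongr
        calc (R : ℝ) ^ 2 * Real.sqrt ((2 : ℝ) ^ i) = R * R * Real.sqrt ((2 : ℝ) ^ i) := by ring
          _ ≤ R * (Real.sqrt R * Real.sqrt ((2 : ℝ) ^ i)) * Real.sqrt ((2 : ℝ) ^ i) := by gcongr
          _ = R * Real.sqrt R * (Real.sqrt ((2 : ℝ) ^ i) * Real.sqrt ((2 : ℝ) ^ i)) := by ring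
          _ = (R * Real.sqrt R) * (2 : ℝ) ^ i := by rw [Real.mul_self_sqrt hQ.le]
      calc (R ^ 2 / (2 : ℝ) ^ i) * (Real.sqrt 2 * Real.sqrt ((2 : ℝ) ^ i))
          = Real.sqrt 2 * ((R : ℝ) ^ 2 * Real.sqrt ((2 : ℝ) ^ i) / (2 : ℝ) ^ i) := by ring
        _ ≤ 3 / 2 * ((R * Real.sqrt R) * (2 : ℝ) ^ i / (2 : ℝ) ^ i) := by
            apply mul_le_mul hs2 (div_le_div_of_nonneg_right key hQ.le) (by positivity) (by norm_num)
        _ = 3 / 2 * (R * Real.sqrt R) := by field_simp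
    have hmax : max (M / N * R ^ 2 / ((2 : ℝ) ^ i) ^ 2) (R ^ 2 / (2 : ℝ) ^ i) * (Real.sqrt 2 * Real.sqrt ((2 : ℝ) ^ i)) ≤
        3 / 2 * (M / Real.sqrt N) := by
      rcases le_total (M / N * R ^ 2 / ((2 : ℝ) ^ i) ^ 2) (R ^ 2 / (2 : ℝ) ^ i) with hm | hm
      · rw [max_eq_right hm]; exact hb2.trans (by linarith)
      · rw [max_eq_left hm]; exact hb1.trans (by linarith)
    calc (F.card : ℝ) * (Real.sqrt 2 * Real.sqrt ((2 : ℝ) ^ i))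
        ≤ (70560 * max (M / N * R ^ 2 / ((2 : ℝ) ^ i) ^ 2) (R ^ 2 / (2 : ℝ) ^ i)) * (Real.sqrt 2 * Real.sqrt ((2 : ℝ) ^ i)) :=
          mul_le_mul_of_nonneg_right hc (by positivity)
      _ = 70560 * (max (M / N * R ^ 2 / ((2 : ℝ) ^ i) ^ 2) (R ^ 2 / (2 : ℝ) ^ i) * (Real.sqrt 2 * Real.sqrt ((2 : ℝ) ^ i))) := by ring
      _ ≤ 70560 * (3 / 2 * (M / Real.sqrt N)) := by gcongr
      _ ≤ 150000 * (M / Real.sqrt N) := by linarith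

/-- The number of dyadic classes: `Nat.log 2 (11R²) + 1 ≤ 4 log T`. [folklore] -/
theorem classCount_le : ((Nat.log 2 (11 * R ^ 2) + 1 : ℕ) : ℝ) ≤ 4 * Real.log T := by
  have hR := h.R_pos; have hT := h.T_pos
  have hR1 := h.one_le_R
  -- `2^{log} ≤ 11 R²`
  have h1 : ((2 ^ Nat.log 2 (11 * R ^ 2) : ℕ) : ℝ) ≤ ((11 * R ^ 2 : ℕ) : ℝ) := by
    exact_mod_cast Nat.pow_log_le_self 2 (by positivity)
  have h2 : (Nat.log 2 (11 * R ^ 2) : ℝ) * Real.log 2 ≤ Real.log ((11 * R ^ 2 : ℕ) : ℝ) := by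
    have := Real.log_le_log (by positivity) h1
    rw [Nat.cast_pow, Real.log_pow] at this; push_cast at this ⊢; exact this
  -- `11 R² ≤ 11 N² ≤ 11 T`
  have h3 : ((11 * R ^ 2 : ℕ) : ℝ) ≤ 11 * T := by
    push_cast
    have : (R : ℝ) ^ 2 ≤ N ^ 2 := pow_le_pow_left₀ hR.le h.hRN 2
    have : N ^ 2 ≤ T := by nlinarith [h.hNM, h.hMT, h.N_pos, h.M_pos]
    nlinarith
  have h4 : Real.log ((11 * R ^ 2 : ℕ) : ℝ) ≤ Real.log 11 + Real.log T := by
    rw [← Real.log_mul (by norm_num) hT.ne']; exact Real.log_le_log (by positivity) h3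
  have hl2 : (0.6931471803 : ℝ) < Real.log 2 := Real.log_two_gt_d9
  have hl11 : Real.log 11 ≤ Real.log T := Real.log_le_log (by norm_num) (le_trans (by norm_num) h.hT0)
  have hlT : (48 : ℝ) ≤ Real.log T := by
    have := Real.log_le_log (by positivity) h.hT0
    rw [Real.log_pow] at this; push_cast at this; nlinarith
  have hlog0 : 0 ≤ (Nat.log 2 (11 * R ^ 2) : ℝ) := Nat.cast_nonneg _
  push_cast
  nlinarith

end Good

namespace Good

variable {T M N : ℝ} {R L ℓ : ℕ} (h : Good T M N R L ℓ)
include h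

/-! ### Sums of the error terms over all blocks -/

/-- `log_T_ge`: an auxiliary step of the proof of Bourgain's (3.12) for `F = log`. [folklore] -/
theorem log_T_ge : (48 : ℝ) ≤ Real.log T := by
  have := Real.log_le_log (by positivity) h.hT0
  rw [Real.log_pow] at this; push_cast at this; nlinarith [Real.log_two_gt_d9]

/-- `1 + log q_k ≤ 3 log T`. [folklore] -/
theorem one_add_log_q_le (k : ℕ) : 1 + Real.log (qOf T (blockStart M ℓ L k) R) ≤ 3 * Real.log T := by
  have hR := h.R_pos; have hT := h.T_pos
  have hq := h.q_le k
  have h11 : (11 : ℝ) * R ^ 2 ≤ 11 * T := by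
    have : (R : ℝ) ^ 2 ≤ N ^ 2 := pow_le_pow_left₀ hR.le h.hRN 2
    have : N ^ 2 ≤ T := by nlinarith [h.hNM, h.hMT, h.N_pos, h.M_pos]
    nlinarith
  have hq1 : (0 : ℝ) < qOf T (blockStart M ℓ L k) R := by exact_mod_cast qOf_pos
  have : Real.log (qOf T (blockStart M ℓ L k) R) ≤ Real.log 11 + Real.log T := by
    rw [← Real.log_mul (by norm_num) hT.ne']; exact Real.log_le_log hq1 (hq.trans h11)
  have hl11 : Real.log 11 ≤ Real.log T := Real.log_le_log (by norm_num) (le_trans (by norm_num) h.hT0)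
  linarith [h.log_T_ge]

/-- **(E-a)** `∑_k √q_k ≤ 600000 log T · M/√N` (dyadic classes). [folklore] -/
theorem sum_sqrt_q_le :
    ∑ k ∈ Finset.range (blockCount M ℓ), Real.sqrt (qOf T (blockStart M ℓ L k) R) ≤
      600000 * Real.log T * (M / Real.sqrt N) := by
  classical
  have hM := h.M_pos; have hN := h.N_pos
  set imax := Nat.log 2 (11 * R ^ 2) with himax
  set g : ℕ → ℕ := fun k => Nat.log 2 (qOf T (blockStart M ℓ L k) R) with hg
  have hmaps : ∀ k ∈ Finset.range (blockCount M ℓ), g k ∈ Finset.range (imax + 1) := by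
    intro k _
    rw [Finset.mem_range, Nat.lt_succ_iff, hg, himax]
    apply Nat.log_mono_right
    have h1 := h.q_le k
    exact_mod_cast h1
  rw [← Finset.sum_fiberwise_of_maps_to hmaps]
  have hfib : ∀ i ∈ Finset.range (imax + 1),
      ∑ k ∈ (Finset.range (blockCount M ℓ)).filter (fun k => g k = i), Real.sqrt (qOf T (blockStart M ℓ L k) R) ≤
        150000 * (M / Real.sqrt N) := by
    intro i _
    refine le_trans (Finset.sum_le_sum_of_subset_of_nonneg ?_ fun _ _ _ => Real.sqrt_nonneg _) (h.sum_class_sqrt_le i)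
    intro k hk
    rw [Finset.mem_filter] at hk ⊢
    refine ⟨hk.1, ?_, ?_⟩
    · rw [← hk.2, hg]; exact Nat.pow_log_le_self 2 (Nat.pos_iff_ne_zero.1 qOf_pos)
    · rw [← hk.2, hg]; exact Nat.lt_pow_succ_log_self (by norm_num) _
  refine (Finset.sum_le_sum hfib).trans ?_
  rw [Finset.sum_const, Finset.card_range, nsmul_eq_mul]
  have hc := h.classCount_le
  rw [← himax] at hc
  have : 0 ≤ M / Real.sqrt N := by positivity
  calc ((imax + 1 : ℕ) : ℝ) * (150000 * (M / Real.sqrt N)) ≤ (4 * Real.log T) * (150000 * (M / Real.sqrt N)) := by gcongr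
    _ = 600000 * Real.log T * (M / Real.sqrt N) := by ring

/-- `N² ≤ M` (from `N⁷ ≤ M³`). [folklore] -/
theorem N2_le_M : N ^ 2 ≤ M := by
  have hN := h.N_pos; have hM := h.M_pos
  have h7 : N ^ 7 ≤ M ^ 3 := by
    -- `T² N⁷ = M⁷` and `T² ≥ M⁴`
    have h1 : M ^ 4 * N ^ 7 ≤ T ^ 2 * N ^ 7 := by
      have : M ^ 4 ≤ T ^ 2 := by nlinarith [h.hMT, pow_le_pow_left₀ (by positivity : (0:ℝ) ≤ M ^ 2) h.hMT 2]
      gcongr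
    rw [h.hT7] at h1
    have : M ^ 7 = M ^ 4 * M ^ 3 := by ring
    rw [this] at h1
    exact le_of_mul_le_mul_left h1 (by positivity)
  have hN1 : 1 ≤ N := le_trans (by norm_num) h.hN0
  -- `N⁶ ≤ N⁷ ≤ M³`, so `N² ≤ M`
  have h6 : (N ^ 2) ^ 3 ≤ M ^ 3 := by
    calc (N ^ 2) ^ 3 = N ^ 6 := by ring
      _ ≤ N ^ 7 := pow_le_pow_right₀ hN1 (by norm_num)
      _ ≤ M ^ 3 := h7
  exact (pow_le_pow_iff_left₀ (by positivity) hM.le (by norm_num)).1 h6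

/-- `R² ≤ 8 N √N`. [folklore] -/
theorem R2_le_N_sqrtN : (R : ℝ) ^ 2 ≤ 8 * (N * Real.sqrt N) := by
  have hN := h.N_pos; have hM := h.M_pos; have hT := h.T_pos; have hR := h.R_pos
  -- `R² ≤ 8M³/(NT)` and `M³ ≤ N^{5/2} T` iff `M⁶ ≤ N⁵ T² = M⁷/N²` iff `N² ≤ M`
  have h1 : (R : ℝ) ^ 2 * (N * T) ≤ 8 * M ^ 3 := by nlinarith [h.hrel2]
  have h2 : M ^ 3 ≤ N ^ 2 * Real.sqrt N * T := by
    have h3 : (M ^ 3) ^ 2 ≤ (N ^ 2 * Real.sqrt N * T) ^ 2 := by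
      have e : (N ^ 2 * Real.sqrt N * T) ^ 2 = N ^ 5 * T ^ 2 := by
        rw [mul_pow, mul_pow, Real.sq_sqrt hN.le]; ring
      rw [e]
      have e2 : N ^ 5 * T ^ 2 * N ^ 2 = M ^ 7 := by rw [← h.hT7]; ring
      have := h.N2_le_M
      nlinarith [e2, pow_pos hM 6, pow_pos hN 5, pow_pos hT 2]
    exact (pow_le_pow_iff_left₀ (by positivity) (by positivity) two_ne_zero).1 h3
  have hsN := Real.sqrt_pos.2 hN
  have : (R : ℝ) ^ 2 * (N * T) ≤ 8 * (N * Real.sqrt N) * (N * T) := by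
    calc (R : ℝ) ^ 2 * (N * T) ≤ 8 * M ^ 3 := h1
      _ ≤ 8 * (N ^ 2 * Real.sqrt N * T) := by gcongr
      _ = 8 * (N * Real.sqrt N) * (N * T) := by ring
  exact le_of_mul_le_mul_right this (by positivity)

/-- **(E-b)** per block: `11/(μ_k N'_k²) ≤ 2040 R²/N`. [folklore] -/
theorem inv_mu_Nprime_le {k : ℕ} (hk : k < blockCount M ℓ) :
    11 / (muOf T (blockStart M ℓ L k) * ((L : ℝ) + sOf T (blockStart M ℓ L k) R) ^ 2) ≤ 2040 * R ^ 2 / N := by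
  have hN := h.N_pos; have hM := h.M_pos; have hT := h.T_pos; have hR := h.R_pos
  obtain ⟨hμ, _⟩ := h.mu_bounds hk
  obtain ⟨hN1, _⟩ := h.Nprime_bounds hk
  have hμ0 : 0 < T / (3 * M ^ 3) := by positivity
  have hlow : T / (3 * M ^ 3) * (9 / 100 * N) ^ 2 ≤
      muOf T (blockStart M ℓ L k) * ((L : ℝ) + sOf T (blockStart M ℓ L k) R) ^ 2 :=
    mul_le_mul hμ (pow_le_pow_left₀ (by positivity) hN1 2) (by positivity) (muOf_pos hT (h.blockStart_pos k)).le
  calc 11 / (muOf T (blockStart M ℓ L k) * ((L : ℝ) + sOf T (blockStart M ℓ L k) R) ^ 2)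
      ≤ 11 / (T / (3 * M ^ 3) * (9 / 100 * N) ^ 2) := div_le_div_of_nonneg_left (by norm_num) (by positivity) hlow
    _ = (11 * 3 * 10000 / 81) * (M ^ 3 / (T * N ^ 2)) := by field_simp; ring
    _ ≤ (11 * 3 * 10000 / 81) * (R ^ 2 / (2 * N)) := by
        apply mul_le_mul_of_nonneg_left _ (by norm_num)
        rw [div_le_div_iff₀ (by positivity) (by positivity)]; nlinarith [h.hrel1]
    _ ≤ 2040 * R ^ 2 / N := by
        rw [mul_div_assoc']
        rw [div_le_div_iff₀ (by positivity) (by positivity)]; nlinarith [pow_pos hR 2]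

/-- **Sum of the minor-arc errors:** `∑_{k<K} errMin_k ≤ 5·10⁹ (log T)² M/√N`. [folklore] -/
theorem sum_errMin_le :
    ∑ k ∈ Finset.range (blockCount M ℓ), errMin T (blockStart M ℓ L k) R L ≤
      5000000000 * Real.log T ^ 2 * (M / Real.sqrt N) := by
  have hN := h.N_pos; have hM := h.M_pos; have hT := h.T_pos; have hR := h.R_pos
  have hsN := Real.sqrt_pos.2 hN
  have hlT := h.log_T_ge
  have hK := h.blockCount_le
  have hMsN : 0 < M / Real.sqrt N := by positivity
  -- per-block bound of the first three terms
  have hNN : Real.sqrt N * Real.sqrt N = N := Real.mul_self_sqrt hN.le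
  have h3 : ∀ k ∈ Finset.range (blockCount M ℓ),
      errMin T (blockStart M ℓ L k) R L ≤ (2 + 2040 * R ^ 2 / N + 90 * Real.sqrt N) +
        2222 * (3 * Real.log T) * Real.sqrt (qOf T (blockStart M ℓ L k) R) := by
    intro k hk
    rw [Finset.mem_range] at hk
    unfold errMin
    have h1 := h.inv_mu_Nprime_le hk
    obtain ⟨hN1, hN2⟩ := h.Nprime_bounds hk
    have h2 : Real.sqrt ((L : ℝ) + sOf T (blockStart M ℓ L k) R) ≤ Real.sqrt N := Real.sqrt_le_sqrt (by linarith)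
    have h4 := h.one_add_log_q_le k
    have hq0 : 0 ≤ Real.sqrt (qOf T (blockStart M ℓ L k) R : ℝ) := Real.sqrt_nonneg _
    have hlq : 0 ≤ 1 + Real.log (qOf T (blockStart M ℓ L k) R : ℝ) := by
      have : (1:ℝ) ≤ qOf T (blockStart M ℓ L k) R := by exact_mod_cast qOf_pos
      have := Real.log_nonneg this; linarith
    nlinarith [mul_le_mul_of_nonneg_left h4 hq0]
  refine (Finset.sum_le_sum h3).trans ?_
  rw [Finset.sum_add_distrib, Finset.sum_const, Finset.card_range, nsmul_eq_mul, ← Finset.mul_sum]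
  have hsq := h.sum_sqrt_q_le
  have hR2 := h.R2_le_N_sqrtN
  -- `K (2 + 2040 R²/N + 90 √N) ≤ (21 M/N)(2 + 16320 √N + 90 √N)`
  have hA : (blockCount M ℓ : ℝ) * (2 + 2040 * R ^ 2 / N + 90 * Real.sqrt N) ≤ 400000 * (M / Real.sqrt N) := by
    have h1 : 2040 * (R : ℝ) ^ 2 / N ≤ 16320 * Real.sqrt N := by
      rw [div_le_iff₀ hN]; nlinarith
    have h2 : (2 : ℝ) ≤ 2 * Real.sqrt N := by
      have : (1:ℝ) ≤ Real.sqrt N := by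
        rw [show (1:ℝ) = Real.sqrt 1 by simp]; exact Real.sqrt_le_sqrt (by linarith [h.hN0])
      linarith
    calc (blockCount M ℓ : ℝ) * (2 + 2040 * R ^ 2 / N + 90 * Real.sqrt N)
        ≤ (21 * M / N) * (16412 * Real.sqrt N) := by
          apply mul_le_mul hK (by linarith) (by positivity) (by positivity)
      _ = 344652 * (M / Real.sqrt N) := by
          field_simp
          nlinarith [hNN]
      _ ≤ 400000 * (M / Real.sqrt N) := by nlinarith
  have hB : 2222 * (3 * Real.log T) * ∑ k ∈ Finset.range (blockCount M ℓ), Real.sqrt (qOf T (blockStart M ℓ L k) R : ℝ) ≤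
      2222 * (3 * Real.log T) * (600000 * Real.log T * (M / Real.sqrt N)) :=
    mul_le_mul_of_nonneg_left hsq (by positivity)
  have hl1 : (1 : ℝ) ≤ Real.log T ^ 2 := by nlinarith
  nlinarith [mul_le_mul_of_nonneg_right hl1 hMsN.le]

end Good

namespace Good

variable {T M N : ℝ} {R L ℓ : ℕ} (h : Good T M N R L ℓ)
include h

/-! ### More power relations -/

/-- `R³ ≤ 23 N²`. [folklore] -/
theorem R3_le : (R : ℝ) ^ 3 ≤ 23 * N ^ 2 := by
  have hN := h.N_pos; have hM := h.M_pos; have hT := h.T_pos; have hR := h.R_pos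
  have h1 : (R : ℝ) ^ 2 * (N * T) ≤ 8 * M ^ 3 := by nlinarith [h.hrel2]
  -- `R⁶ (NT)³ ≤ 512 M⁹ ≤ 512 N⁴ (NT)³ · (M²/T) ≤ 512 N⁴ (NT)^3`? precisely `512 M⁹ ≤ 529 N⁴ (N T)³ = 529 N⁷ T³ = 529 M⁷ T`
  have h2 : ((R : ℝ) ^ 3) ^ 2 * (N * T) ^ 3 ≤ (23 * N ^ 2) ^ 2 * (N * T) ^ 3 := by
    have e : ((R : ℝ) ^ 3) ^ 2 * (N * T) ^ 3 = ((R : ℝ) ^ 2 * (N * T)) ^ 3 := by ring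
    rw [e]
    calc ((R : ℝ) ^ 2 * (N * T)) ^ 3 ≤ (8 * M ^ 3) ^ 3 := pow_le_pow_left₀ (by positivity) h1 3
      _ = 512 * M ^ 2 * M ^ 7 := by ring
      _ ≤ 529 * T * M ^ 7 := by nlinarith [h.hMT, pow_pos hM 7]
      _ = 529 * T * (T ^ 2 * N ^ 7) := by rw [h.hT7]
      _ = (23 * N ^ 2) ^ 2 * (N * T) ^ 3 := by ring
  have h3 := le_of_mul_le_mul_right h2 (by positivity : (0:ℝ) < (N * T) ^ 3)
  exact (pow_le_pow_iff_left₀ (by positivity) (by positivity) two_ne_zero).1 h3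

/-- `R⁴ ≤ 64 N³ √N`. [folklore] -/
theorem R4_le : (R : ℝ) ^ 4 ≤ 64 * (N ^ 3 * Real.sqrt N) := by
  have hN := h.N_pos; have hM := h.M_pos; have hT := h.T_pos; have hR := h.R_pos
  have h1 : (R : ℝ) ^ 2 * (N * T) ≤ 8 * M ^ 3 := by nlinarith [h.hrel2]
  -- `R⁸ (NT)⁴ ≤ 4096 M¹² ≤ 4096 N⁷ (NT)⁴` iff `M¹² ≤ N¹¹ T⁴ = N⁴ M⁷ T²` iff `M⁵ ≤ N⁴ T²`
  have hM5 : M ^ 5 ≤ N ^ 4 * T ^ 2 := by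
    have := h.M_le_N4
    have hT2 : M ^ 4 ≤ T ^ 2 := by nlinarith [h.hMT, pow_le_pow_left₀ (by positivity : (0:ℝ) ≤ M ^ 2) h.hMT 2]
    calc M ^ 5 = M * M ^ 4 := by ring
      _ ≤ N ^ 4 * T ^ 2 := by gcongr
  have h2 : ((R : ℝ) ^ 4) ^ 2 * (N * T) ^ 4 ≤ (64 * (N ^ 3 * Real.sqrt N)) ^ 2 * (N * T) ^ 4 := by
    have e : ((R : ℝ) ^ 4) ^ 2 * (N * T) ^ 4 = ((R : ℝ) ^ 2 * (N * T)) ^ 4 := by ring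
    have e2 : (64 * (N ^ 3 * Real.sqrt N)) ^ 2 = 4096 * N ^ 7 := by
      rw [mul_pow, mul_pow, Real.sq_sqrt hN.le]; ring
    rw [e, e2]
    calc ((R : ℝ) ^ 2 * (N * T)) ^ 4 ≤ (8 * M ^ 3) ^ 4 := pow_le_pow_left₀ (by positivity) h1 4
      _ = 4096 * M ^ 7 * M ^ 5 := by ring
      _ ≤ 4096 * M ^ 7 * (N ^ 4 * T ^ 2) := by gcongr
      _ = 4096 * (T ^ 2 * N ^ 7) * (N ^ 4 * T ^ 2) := by rw [h.hT7]
      _ = 4096 * N ^ 7 * (N * T) ^ 4 := by ring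
  have h3 := le_of_mul_le_mul_right h2 (by positivity : (0:ℝ) < (N * T) ^ 4)
  exact (pow_le_pow_iff_left₀ (by positivity) (by positivity) two_ne_zero).1 h3

/-! ### The major-arc blocks -/

/-- A major block has small denominator: `H₀ < 1 ⟹ q_k < (2040/11) R²/N`. [folklore] -/
theorem q_lt_of_major {k : ℕ} (hk : k < blockCount M ℓ) (hH : H0 T (blockStart M ℓ L k) R L < 1) :
    (qOf T (blockStart M ℓ L k) R : ℝ) < 2040 / 11 * R ^ 2 / N := by
  have hT := h.T_pos; have hN := h.N_pos
  have h1 := h.inv_mu_Nprime_le hk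
  unfold H0 at hH
  have hμ := muOf_pos hT (h.blockStart_pos k)
  obtain ⟨hN1, _⟩ := h.Nprime_bounds hk
  have hN' : 0 < (L : ℝ) + sOf T (blockStart M ℓ L k) R := by linarith
  set μ := muOf T (blockStart M ℓ L k)
  set Np := (L : ℝ) + sOf T (blockStart M ℓ L k) R
  have hpos : 0 < μ * Np ^ 2 := by positivity
  have hq : (qOf T (blockStart M ℓ L k) R : ℝ) < 1 / (μ * Np ^ 2) := by
    rw [lt_div_iff₀ hpos]; nlinarith
  have : 1 / (μ * Np ^ 2) ≤ 2040 / 11 * R ^ 2 / N := by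
    have e : 1 / (μ * Np ^ 2) = (11 / (μ * Np ^ 2)) / 11 := by ring
    rw [e, div_le_iff₀ (by norm_num)]
    calc 11 / (μ * Np ^ 2) ≤ 2040 * R ^ 2 / N := h1
      _ = 2040 / 11 * R ^ 2 / N * 11 := by ring
  linarith

set_option maxHeartbeats 1000000 in
/-- **Sum over the major blocks:** `∑_{k : H₀ < 1} errMaj_k ≤ 2·10¹² log T · M/√N`. [folklore] -/
theorem sum_major_le :
    ∑ k ∈ (Finset.range (blockCount M ℓ)).filter (fun k => H0 T (blockStart M ℓ L k) R L < 1),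
        errMaj T (blockStart M ℓ L k) R L ℓ ≤ 2000000000000 * Real.log T * (M / Real.sqrt N) := by
  classical
  have hN := h.N_pos; have hM := h.M_pos; have hT := h.T_pos; have hR := h.R_pos
  have hsN := Real.sqrt_pos.2 hN
  have hNN : Real.sqrt N * Real.sqrt N = N := Real.mul_self_sqrt hN.le
  have hlT := h.log_T_ge
  set qM : ℝ := 2040 / 11 * R ^ 2 / N with hqM
  have hqM0 : 0 < qM := by positivity
  have hqMge : (185 : ℝ) ≤ qM := by
    rw [hqM, le_div_iff₀ hN]; nlinarith [h.hNR]
  have hsqM : Real.sqrt qM = Real.sqrt (2040 / 11) * R / Real.sqrt N := by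
    rw [hqM, show (2040 : ℝ) / 11 * R ^ 2 / N = (2040 / 11) * (R ^ 2 / N) by ring, Real.sqrt_mul (by norm_num),
      Real.sqrt_div (pow_nonneg hR.le 2) N, Real.sqrt_sq hR.le]; ring
  have hs2040 : Real.sqrt (2040 / 11) ≤ 14 := by rw [Real.sqrt_le_left (by norm_num)]; norm_num
  set F := (Finset.range (blockCount M ℓ)).filter (fun k => H0 T (blockStart M ℓ L k) R L < 1) with hF
  -- count
  have hsub : F ⊆ (Finset.range (blockCount M ℓ)).filter (fun k =>
      1 ≤ qOf T (blockStart M ℓ L k) R ∧ qOf T (blockStart M ℓ L k) R < ⌊qM⌋₊ + 1) := by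
    intro k hk
    rw [hF, Finset.mem_filter] at hk
    rw [Finset.mem_filter]
    refine ⟨hk.1, qOf_pos, ?_⟩
    have := h.q_lt_of_major (Finset.mem_range.1 hk.1) hk.2
    rw [← hqM] at this
    have : qOf T (blockStart M ℓ L k) R ≤ ⌊qM⌋₊ := Nat.le_floor this.le
    omega
  have hcnt : (F.card : ℝ) ≤ 168 * qM ^ 2 * M / (N * R ^ 2) := by
    have h1 := h.card_near_le (Q₁ := 1) (Q₂ := ⌊qM⌋₊ + 1) one_pos (by omega)
    refine le_trans (by exact_mod_cast Finset.card_le_card hsub) (h1.trans ?_)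
    have hfl : (⌊qM⌋₊ : ℝ) ≤ qM := Nat.floor_le hqM0.le
    have hTM := h.one_le_T_div_M2; have hTM' := h.T_div_M2_le
    push_cast
    calc 3 * ((⌊qM⌋₊ : ℝ) + 1 - 1) * (3 * ((⌊qM⌋₊ : ℝ) + 1) * (T / M ^ 2) + 1)
        ≤ 3 * qM * (7 * qM * (T / M ^ 2)) := by
          apply mul_le_mul (by linarith) _ (by positivity) (by positivity)
          nlinarith [mul_le_mul hqMge hTM zero_le_one hqM0.le]
      _ = 21 * qM ^ 2 * (T / M ^ 2) := by ring
      _ ≤ 21 * qM ^ 2 * (8 * M / (N * R ^ 2)) := by gcongr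
      _ = 168 * qM ^ 2 * M / (N * R ^ 2) := by field_simp; norm_num
  -- uniform bound of `errMaj` on `F`
  obtain ⟨_, hl2⟩ := h.ell_bounds
  have hterm : ∀ k ∈ F, errMaj T (blockStart M ℓ L k) R L ℓ ≤
      2 + 2040 * R ^ 2 / N + 227 * Real.sqrt qM * (3 * Real.log T) + 37 * (Real.sqrt 2 * Real.sqrt qM) * (N / 15) := by
    intro k hk
    rw [hF, Finset.mem_filter, Finset.mem_range] at hk
    have hq := (h.q_lt_of_major hk.1 hk.2).le
    rw [← hqM] at hq
    unfold errMaj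
    have h1 := h.inv_mu_Nprime_le hk.1
    have h2 : Real.sqrt (qOf T (blockStart M ℓ L k) R : ℝ) ≤ Real.sqrt qM := Real.sqrt_le_sqrt hq
    have h3 : Real.sqrt (2 * (qOf T (blockStart M ℓ L k) R : ℝ)) ≤ Real.sqrt 2 * Real.sqrt qM := by
      rw [← Real.sqrt_mul (by norm_num)]; exact Real.sqrt_le_sqrt (by linarith)
    have h4 := h.one_add_log_q_le k
    have hlq : 0 ≤ 1 + Real.log (qOf T (blockStart M ℓ L k) R : ℝ) := by
      have : (1:ℝ) ≤ qOf T (blockStart M ℓ L k) R := by exact_mod_cast qOf_pos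
      have := Real.log_nonneg this; linarith
    have hl : (ℓ : ℝ) + 1 ≤ N / 15 := by have := h.hN0; nlinarith [show (2:ℝ) ^ 20 = 1048576 by norm_num]
    have hq0 : 0 ≤ Real.sqrt (qOf T (blockStart M ℓ L k) R : ℝ) := Real.sqrt_nonneg _
    have := mul_le_mul h2 h4 hlq (Real.sqrt_nonneg _)
    have := mul_le_mul h3 hl (by positivity) (by positivity)
    nlinarith
  have hsum := Finset.sum_le_sum hterm
  rw [Finset.sum_const, nsmul_eq_mul] at hsum
  refine hsum.trans ?_
  -- now pure algebra: `cnt · B ≤ 2e12 log T M/√N`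
  have hR3 := h.R3_le; have hR4 := h.R4_le
  have hB0 : 0 ≤ 2 + 2040 * R ^ 2 / N + 227 * Real.sqrt qM * (3 * Real.log T) + 37 * (Real.sqrt 2 * Real.sqrt qM) * (N / 15) := by
    positivity
  refine (mul_le_mul_of_nonneg_right hcnt hB0).trans ?_
  rw [hsqM]
  have hs2 : Real.sqrt 2 ≤ 3 / 2 := by rw [Real.sqrt_le_left (by norm_num)]; norm_num
  -- replace `√(2040/11)` by `14` and `√2` by `3/2`
  have hmono : 168 * qM ^ 2 * M / (N * R ^ 2) *
      (2 + 2040 * R ^ 2 / N + 227 * (Real.sqrt (2040 / 11) * R / Real.sqrt N) * (3 * Real.log T) +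
        37 * (Real.sqrt 2 * (Real.sqrt (2040 / 11) * R / Real.sqrt N)) * (N / 15)) ≤
      168 * qM ^ 2 * M / (N * R ^ 2) *
      (2 + 2040 * R ^ 2 / N + 227 * (14 * R / Real.sqrt N) * (3 * Real.log T) +
        37 * (3 / 2 * (14 * R / Real.sqrt N)) * (N / 15)) := by
    have : 0 ≤ Real.log T := by linarith
    gcongr
  refine hmono.trans ?_
  rw [hqM]
  -- expand: four terms
  have hRN := h.hRN
  have t1 : 168 * (2040 / 11 * (R : ℝ) ^ 2 / N) ^ 2 * M / (N * R ^ 2) * 2 ≤ 20000000 * (M / Real.sqrt N) := by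
    -- `= 336 c₀² M R²/N³ ≤ 1.2e7 M/N ≤ 1.2e7 M/√N`
    have e : 168 * (2040 / 11 * (R : ℝ) ^ 2 / N) ^ 2 * M / (N * R ^ 2) * 2 = 336 * (2040 / 11) ^ 2 * (M * R ^ 2 / N ^ 3) := by
      field_simp; ring
    rw [e]
    have h1 : M * (R : ℝ) ^ 2 / N ^ 3 ≤ M / Real.sqrt N := by
      rw [div_le_div_iff₀ (by positivity) hsN]
      have : (R : ℝ) ^ 2 * Real.sqrt N ≤ N ^ 3 := by
        have h2 : Real.sqrt N ≤ N := by
          rw [Real.sqrt_le_left hN.le]; nlinarith [h.hN0]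
        calc (R : ℝ) ^ 2 * Real.sqrt N ≤ N ^ 2 * N := mul_le_mul (pow_le_pow_left₀ hR.le hRN 2) h2 (Real.sqrt_nonneg _) (by positivity)
          _ = N ^ 3 := by ring
      have := mul_le_mul_of_nonneg_left this hM.le
      linarith
    have hY : 0 ≤ M / Real.sqrt N := by positivity
    linarith
  have t2 : 168 * (2040 / 11 * (R : ℝ) ^ 2 / N) ^ 2 * M / (N * R ^ 2) * (2040 * R ^ 2 / N) ≤ 800000000000 * (M / Real.sqrt N) := by
    have e : 168 * (2040 / 11 * (R : ℝ) ^ 2 / N) ^ 2 * M / (N * R ^ 2) * (2040 * R ^ 2 / N) =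
        168 * (2040 / 11) ^ 2 * 2040 * (M * R ^ 4 / N ^ 4) := by field_simp
    rw [e]
    have h1 : M * (R : ℝ) ^ 4 / N ^ 4 ≤ 64 * (M / Real.sqrt N) := by
      rw [div_le_iff₀ (by positivity), mul_comm (64 : ℝ), mul_assoc, div_mul_eq_mul_div, le_div_iff₀ hsN]
      calc M * (R : ℝ) ^ 4 * Real.sqrt N ≤ M * (64 * (N ^ 3 * Real.sqrt N)) * Real.sqrt N := by gcongr
        _ = M * (64 * N ^ 4) := by rw [show N ^ 4 = N ^ 3 * (Real.sqrt N * Real.sqrt N) by rw [hNN]; ring]; ring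
    have hY : 0 ≤ M / Real.sqrt N := by positivity
    linarith
  have t3 : 168 * (2040 / 11 * (R : ℝ) ^ 2 / N) ^ 2 * M / (N * R ^ 2) * (227 * (14 * R / Real.sqrt N) * (3 * Real.log T)) ≤
      1400000000000 * Real.log T * (M / Real.sqrt N) := by
    have e : 168 * (2040 / 11 * (R : ℝ) ^ 2 / N) ^ 2 * M / (N * R ^ 2) * (227 * (14 * R / Real.sqrt N) * (3 * Real.log T)) =
        168 * (2040 / 11) ^ 2 * 227 * 14 * 3 * Real.log T * (M * R ^ 3 / (N ^ 3 * Real.sqrt N)) := by field_simp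
    rw [e]
    have h1 : M * (R : ℝ) ^ 3 / (N ^ 3 * Real.sqrt N) ≤ 23 * (M / Real.sqrt N) := by
      rw [div_le_iff₀ (by positivity), mul_comm (23 : ℝ), mul_assoc, div_mul_eq_mul_div, le_div_iff₀ hsN]
      have hN1 : 1 ≤ N := le_trans (by norm_num) h.hN0
      calc M * (R : ℝ) ^ 3 * Real.sqrt N ≤ M * (23 * N ^ 2) * Real.sqrt N := by gcongr
        _ ≤ M * (23 * N ^ 3) * Real.sqrt N :=
            mul_le_mul_of_nonneg_right (mul_le_mul_of_nonneg_left
              (mul_le_mul_of_nonneg_left (pow_le_pow_right₀ hN1 (by norm_num)) (by norm_num)) hM.le) (Real.sqrt_nonneg _)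
        _ = M * (23 * (N ^ 3 * Real.sqrt N)) := by ring
    have : 0 ≤ Real.log T := by linarith
    have := mul_le_mul_of_nonneg_left h1 this
    have hY : 0 ≤ Real.log T * (M / Real.sqrt N) := by positivity
    nlinarith
  have t4 : 168 * (2040 / 11 * (R : ℝ) ^ 2 / N) ^ 2 * M / (N * R ^ 2) * (37 * (3 / 2 * (14 * R / Real.sqrt N)) * (N / 15)) ≤
      7000000000 * (M / Real.sqrt N) := by
    have e : 168 * (2040 / 11 * (R : ℝ) ^ 2 / N) ^ 2 * M / (N * R ^ 2) * (37 * (3 / 2 * (14 * R / Real.sqrt N)) * (N / 15)) =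
        168 * (2040 / 11) ^ 2 * 37 * 21 / 15 * (M * R ^ 3 / (N ^ 2 * Real.sqrt N)) := by field_simp; ring
    rw [e]
    have h1 : M * (R : ℝ) ^ 3 / (N ^ 2 * Real.sqrt N) ≤ 23 * (M / Real.sqrt N) := by
      rw [div_le_iff₀ (by positivity), mul_comm (23 : ℝ), mul_assoc, div_mul_eq_mul_div, le_div_iff₀ hsN]
      calc M * (R : ℝ) ^ 3 * Real.sqrt N ≤ M * (23 * N ^ 2) * Real.sqrt N := by gcongr
        _ = M * (23 * (N ^ 2 * Real.sqrt N)) := by ring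
    have hY : 0 ≤ M / Real.sqrt N := by positivity
    linarith
  have hMsN : 0 ≤ M / Real.sqrt N := by positivity
  linarith [mul_le_mul_of_nonneg_right hlT hMsN]

/-! ### Minor blocks with a small denominator class (trivial treatment) -/

/-- **Trivial minor class:** if `(2^i)^{5/2} √N ≤ R³` then
`∑_{k ∈ class i, H₀ ≥ 1} mtB_k ≤ 1100 M/√N`. [folklore] -/
theorem sum_triv_class_le {i : ℕ} (hi : ((2 : ℝ) ^ i) ^ 2 * Real.sqrt ((2 : ℝ) ^ i) * Real.sqrt N ≤ R ^ 3)
    (n₁ : ℕ → ℕ) (hn₁ : ∀ k, n₁ k ∈ Finset.Icc L (L + ℓ)) :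
    ∑ k ∈ (Finset.range (blockCount M ℓ)).filter (fun k =>
        (2 ^ i ≤ qOf T (blockStart M ℓ L k) R ∧ qOf T (blockStart M ℓ L k) R < 2 ^ (i + 1)) ∧
          1 ≤ H0 T (blockStart M ℓ L k) R L),
      mtB T (blockStart M ℓ L k) R L (n₁ k) ≤ 1100 * (M / Real.sqrt N) := by
  classical
  have hN := h.N_pos; have hM := h.M_pos; have hT := h.T_pos; have hR := h.R_pos
  have hsN := Real.sqrt_pos.2 hN
  have hNN : Real.sqrt N * Real.sqrt N = N := Real.mul_self_sqrt hN.le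
  have hQ : 0 < (2 : ℝ) ^ i := by positivity
  have hsQ := Real.sqrt_pos.2 hQ
  set F := (Finset.range (blockCount M ℓ)).filter (fun k =>
        (2 ^ i ≤ qOf T (blockStart M ℓ L k) R ∧ qOf T (blockStart M ℓ L k) R < 2 ^ (i + 1)) ∧
          1 ≤ H0 T (blockStart M ℓ L k) R L) with hF
  -- uniform bound `trivB ≤ 15 √(3T/M³ · 2·2^i) (0.15 N) √(0.15 N)`
  set B : ℝ := 15 * Real.sqrt (3 * (T / M ^ 3) * (2 * (2 : ℝ) ^ i)) * (15 / 100 * N) * Real.sqrt (15 / 100 * N) with hB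
  have hterm : ∀ k ∈ F, mtB T (blockStart M ℓ L k) R L (n₁ k) ≤ B := by
    intro k hk
    rw [hF, Finset.mem_filter, Finset.mem_range] at hk
    refine (h.mtB_le_triv hk.1 (hn₁ k) hk.2.2).trans ?_
    unfold trivB
    obtain ⟨_, hμ⟩ := h.mu_bounds hk.1
    obtain ⟨hN1, hN2⟩ := h.Nprime_bounds hk.1
    have hq : (qOf T (blockStart M ℓ L k) R : ℝ) ≤ 2 * (2 : ℝ) ^ i := by
      have : (qOf T (blockStart M ℓ L k) R : ℝ) < (2 : ℝ) ^ (i + 1) := by exact_mod_cast hk.2.1.2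
      rw [pow_succ] at this; linarith
    have hμ0 := (muOf_pos hT (h.blockStart_pos k)).le
    have h1 : Real.sqrt (muOf T (blockStart M ℓ L k) * qOf T (blockStart M ℓ L k) R) ≤
        Real.sqrt (3 * (T / M ^ 3) * (2 * (2 : ℝ) ^ i)) := by
      apply Real.sqrt_le_sqrt
      have : muOf T (blockStart M ℓ L k) ≤ 3 * (T / M ^ 3) := by
        calc muOf T (blockStart M ℓ L k) ≤ 9 * (T / (3 * M ^ 3)) := hμ
          _ = 3 * (T / M ^ 3) := by ring
      exact mul_le_mul this hq (by positivity) (by positivity)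
    have h2 : Real.sqrt ((L : ℝ) + sOf T (blockStart M ℓ L k) R) ≤ Real.sqrt (15 / 100 * N) := Real.sqrt_le_sqrt hN2
    have hN'0 : 0 ≤ (L : ℝ) + sOf T (blockStart M ℓ L k) R := by linarith
    rw [hB]
    apply mul_le_mul (mul_le_mul (mul_le_mul_of_nonneg_left h1 (by norm_num)) hN2 hN'0 (by positivity)) h2
      (Real.sqrt_nonneg _) (by positivity)
  have hsum := Finset.sum_le_sum hterm
  rw [Finset.sum_const, nsmul_eq_mul] at hsum
  refine hsum.trans ?_
  have hsub : F ⊆ (Finset.range (blockCount M ℓ)).filter (fun k =>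
        2 ^ i ≤ qOf T (blockStart M ℓ L k) R ∧ qOf T (blockStart M ℓ L k) R < 2 ^ (i + 1)) := by
    intro k hk; rw [hF, Finset.mem_filter] at hk; rw [Finset.mem_filter]; exact ⟨hk.1, hk.2.1⟩
  have hcnt : (F.card : ℝ) ≤ 168 * (M / N) * ((2 : ℝ) ^ i) ^ 2 / R ^ 2 :=
    le_trans (by exact_mod_cast Finset.card_le_card hsub) (h.card_class_le_near i)
  have hB0 : 0 ≤ B := by positivity
  refine (mul_le_mul_of_nonneg_right hcnt hB0).trans ?_
  -- simplify `B`: `√(3 T/M³ · 2 Q) ≤ √(48/(N R²)) √Q = √48 √Q/(√N R)`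
  have hTM := h.T_div_M3.2
  have hB1 : B ≤ 15 * (7 * Real.sqrt ((2 : ℝ) ^ i) / (Real.sqrt N * R)) * (15 / 100 * N) * (2 / 5 * Real.sqrt N) := by
    rw [hB]
    have h1 : Real.sqrt (3 * (T / M ^ 3) * (2 * (2 : ℝ) ^ i)) ≤ 7 * Real.sqrt ((2 : ℝ) ^ i) / (Real.sqrt N * R) := by
      rw [Real.sqrt_le_left (by positivity), div_pow, mul_pow, mul_pow, Real.sq_sqrt hQ.le, Real.sq_sqrt hN.le]
      rw [le_div_iff₀ (by positivity)]
      calc 3 * (T / M ^ 3) * (2 * (2 : ℝ) ^ i) * (N * R ^ 2) = 6 * (2 : ℝ) ^ i * (T / M ^ 3 * (N * R ^ 2)) := by ring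
        _ ≤ 6 * (2 : ℝ) ^ i * 8 := by
            gcongr
            rw [div_mul_eq_mul_div, div_le_iff₀ (by positivity)]; nlinarith [h.hrel2]
        _ ≤ 7 ^ 2 * (2 : ℝ) ^ i := by nlinarith
    have h2 : Real.sqrt (15 / 100 * N) ≤ 2 / 5 * Real.sqrt N := by
      rw [Real.sqrt_le_left (by positivity), mul_pow, Real.sq_sqrt hN.le]; nlinarith
    apply mul_le_mul (mul_le_mul_of_nonneg_right (mul_le_mul_of_nonneg_left h1 (by norm_num)) (by positivity)) h2
      (Real.sqrt_nonneg _) (by positivity)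
  refine (mul_le_mul_of_nonneg_left hB1 (by positivity)).trans ?_
  -- `168 (M/N) Q²/R² · 15·7·0.15·0.4 · √Q N √N/(√N R) = 1058.4 M Q^{5/2}/R³ ≤ 1058.4 M/√N`
  have e : 168 * (M / N) * ((2 : ℝ) ^ i) ^ 2 / R ^ 2 *
      (15 * (7 * Real.sqrt ((2 : ℝ) ^ i) / (Real.sqrt N * R)) * (15 / 100 * N) * (2 / 5 * Real.sqrt N)) =
      (168 * 15 * 7 * 15 / 100 * 2 / 5) * (M * (((2 : ℝ) ^ i) ^ 2 * Real.sqrt ((2 : ℝ) ^ i)) / R ^ 3) := by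
    field_simp
  rw [e]
  have h1 : M * (((2 : ℝ) ^ i) ^ 2 * Real.sqrt ((2 : ℝ) ^ i)) / R ^ 3 ≤ M / Real.sqrt N := by
    rw [div_le_div_iff₀ (by positivity) hsN]
    calc M * (((2 : ℝ) ^ i) ^ 2 * Real.sqrt ((2 : ℝ) ^ i)) * Real.sqrt N
        = M * (((2 : ℝ) ^ i) ^ 2 * Real.sqrt ((2 : ℝ) ^ i) * Real.sqrt N) := by ring
      _ ≤ M * R ^ 3 := by gcongr
  have : 0 ≤ M / Real.sqrt N := by positivity
  nlinarith

end Good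


/-! ### Parameters of a sieve family (class `i`, i.e. `2^i ≤ q < 2^{i+1}`) -/

/-- `H = ⌈1/2 + (81/50) 2^i T N²/M³⌉`. [folklore] -/
def Hf (T M N : ℝ) (i : ℕ) : ℕ := ⌈1 / 2 + 81 / 50 * (2 : ℝ) ^ i * T * N ^ 2 / M ^ 3⌉₊

/-- `M₀ = ⌊3 max(1, (27/10000) 2^i T N²/M³) - 3/2⌋`. [folklore] -/
def M0f (T M N : ℝ) (i : ℕ) : ℕ := ⌊3 * max 1 (27 / 10000 * (2 : ℝ) ^ i * T * N ^ 2 / M ^ 3) - 3 / 2⌋₊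

/-- `μ_lo = T/(3M³)`. [folklore] -/
def muLo (T M : ℝ) : ℝ := T / (3 * M ^ 3)

/-- `kappa` is antitone in both arguments. [folklore] -/
theorem kappa_anti {μ μ' q q' : ℝ} (hμ : 0 < μ) (hq : 0 < q) (hμ' : μ ≤ μ') (hq' : q ≤ q') :
    kappa μ' q' ≤ kappa μ q := by
  have hμ'0 : 0 < μ' := hμ.trans_le hμ'
  have hq'0 : 0 < q' := hq.trans_le hq'
  rw [kappa_eq_div hμ.ne' hq.ne', kappa_eq_div hμ'0.ne' hq'0.ne']
  have h1 : Real.sqrt (3 * μ * q) ≤ Real.sqrt (3 * μ' * q') :=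
    Real.sqrt_le_sqrt (by nlinarith [mul_le_mul hμ' hq' hq.le hμ'0.le])
  have hs : 0 < Real.sqrt (3 * μ * q) := Real.sqrt_pos.2 (by positivity)
  calc 2 / (3 * q') / Real.sqrt (3 * μ' * q') ≤ 2 / (3 * q) / Real.sqrt (3 * μ' * q') := by
        gcongr
    _ ≤ 2 / (3 * q) / Real.sqrt (3 * μ * q) := by
        apply div_le_div_of_nonneg_left (by positivity) hs h1

namespace Good

variable {T M N : ℝ} {R L ℓ : ℕ} (h : Good T M N R L ℓ)
include h

/-- `muLo_pos`: an auxiliary step of the proof of Bourgain's (3.12) for `F = log`. [folklore] -/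
theorem muLo_pos : 0 < muLo T M := by unfold muLo; have := h.T_pos; have := h.M_pos; positivity

/-- `muLo_ge`: an auxiliary step of the proof of Bourgain's (3.12) for `F = log`. [folklore] -/
theorem muLo_ge : 2 / (3 * N * R ^ 2) ≤ muLo T M := by
  have := h.T_div_M3.1; have hN := h.N_pos; have hR := h.R_pos; have hM := h.M_pos
  unfold muLo
  calc 2 / (3 * N * R ^ 2) = (2 / (N * R ^ 2)) / 3 := by field_simp
    _ ≤ (T / M ^ 3) / 3 := by gcongr
    _ = T / (3 * M ^ 3) := by field_simp

/-- `muLo_le_mu`: an auxiliary step of the proof of Bourgain's (3.12) for `F = log`. [folklore] -/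
theorem muLo_le_mu (k : ℕ) (hk : k < blockCount M ℓ) : muLo T M ≤ muOf T (blockStart M ℓ L k) := (h.mu_bounds hk).1

/-- `T N²/M³ ≥ 2 N/R²` and `≤ 8 N/R²`. [folklore] -/
theorem TN2_div_M3 : 2 * N / R ^ 2 ≤ T * N ^ 2 / M ^ 3 ∧ T * N ^ 2 / M ^ 3 ≤ 8 * N / R ^ 2 := by
  obtain ⟨h1, h2⟩ := h.T_div_M3
  have hN := h.N_pos; have hR := h.R_pos; have hM := h.M_pos
  constructor
  · calc 2 * N / R ^ 2 = 2 / (N * R ^ 2) * N ^ 2 := by field_simp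
      _ ≤ T / M ^ 3 * N ^ 2 := by gcongr
      _ = T * N ^ 2 / M ^ 3 := by ring
  · calc T * N ^ 2 / M ^ 3 = T / M ^ 3 * N ^ 2 := by ring
      _ ≤ 8 / (N * R ^ 2) * N ^ 2 := by gcongr
      _ = 8 * N / R ^ 2 := by field_simp

/-! #### `H` -/

/-- `one_le_Hf`: an auxiliary step of the proof of Bourgain's (3.12) for `F = log`. [folklore] -/
theorem one_le_Hf (i : ℕ) : 1 ≤ Hf T M N i := by
  unfold Hf
  have hT := h.T_pos; have hM := h.M_pos; have hN := h.N_pos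
  have : (0 : ℝ) < 1 / 2 + 81 / 50 * (2 : ℝ) ^ i * T * N ^ 2 / M ^ 3 := by positivity
  exact Nat.one_le_iff_ne_zero.2 (Nat.pos_iff_ne_zero.1 (Nat.ceil_pos.2 this))

omit h in
/-- `Hf_ge`: an auxiliary step of the proof of Bourgain's (3.12) for `F = log`. [folklore] -/
theorem Hf_ge (i : ℕ) : 1 / 2 + 81 / 50 * (2 : ℝ) ^ i * (T * N ^ 2 / M ^ 3) ≤ (Hf T M N i : ℝ) := by
  unfold Hf
  refine le_trans ?_ (Nat.le_ceil _)
  have : 81 / 50 * (2 : ℝ) ^ i * T * N ^ 2 / M ^ 3 = 81 / 50 * (2 : ℝ) ^ i * (T * N ^ 2 / M ^ 3) := by ring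
  rw [this]

/-- `Hf_ge'`: an auxiliary step of the proof of Bourgain's (3.12) for `F = log`. [folklore] -/
theorem Hf_ge' (i : ℕ) : 81 / 25 * ((2 : ℝ) ^ i * N / R ^ 2) ≤ (Hf T M N i : ℝ) := by
  have h1 := Hf_ge (T := T) (M := M) (N := N) i; have h2 := h.TN2_div_M3.1
  have hQ : 0 < (2 : ℝ) ^ i := by positivity
  calc 81 / 25 * ((2 : ℝ) ^ i * N / R ^ 2) = 81 / 50 * (2 : ℝ) ^ i * (2 * N / R ^ 2) := by ring
    _ ≤ 81 / 50 * (2 : ℝ) ^ i * (T * N ^ 2 / M ^ 3) := by gcongr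
    _ ≤ _ := by linarith

/-- `Hf_le`: an auxiliary step of the proof of Bourgain's (3.12) for `F = log`. [folklore] -/
theorem Hf_le (i : ℕ) : (Hf T M N i : ℝ) ≤ 3 / 2 + 324 / 25 * ((2 : ℝ) ^ i * N / R ^ 2) := by
  unfold Hf
  have hT := h.T_pos; have hM := h.M_pos; have hN := h.N_pos
  have h0 : (0 : ℝ) ≤ 1 / 2 + 81 / 50 * (2 : ℝ) ^ i * T * N ^ 2 / M ^ 3 := by positivity
  have h1 := (Nat.ceil_lt_add_one h0).le
  have h2 := h.TN2_div_M3.2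
  have hQ : 0 < (2 : ℝ) ^ i := by positivity
  calc (⌈1 / 2 + 81 / 50 * (2 : ℝ) ^ i * T * N ^ 2 / M ^ 3⌉₊ : ℝ) ≤ 1 / 2 + 81 / 50 * (2 : ℝ) ^ i * T * N ^ 2 / M ^ 3 + 1 := h1
    _ = 3 / 2 + 81 / 50 * (2 : ℝ) ^ i * (T * N ^ 2 / M ^ 3) := by ring
    _ ≤ 3 / 2 + 81 / 50 * (2 : ℝ) ^ i * (8 * N / R ^ 2) := by gcongr
    _ = 3 / 2 + 324 / 25 * ((2 : ℝ) ^ i * N / R ^ 2) := by ring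

/-- The cap hypothesis: `q λ + 3 μ q (n₁ + s)² ≤ H` for blocks of class `i`. [folklore] -/
theorem Hcap {k : ℕ} (hk : k < blockCount M ℓ) {i : ℕ} (hq : qOf T (blockStart M ℓ L k) R < 2 ^ (i + 1))
    {n₁ : ℕ} (hn₁ : n₁ ∈ Finset.Icc L (L + ℓ)) :
    qOf T (blockStart M ℓ L k) R * lamOf T (blockStart M ℓ L k) R +
        3 * muOf T (blockStart M ℓ L k) * qOf T (blockStart M ℓ L k) R * ((n₁ : ℝ) + sOf T (blockStart M ℓ L k) R) ^ 2 ≤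
      (Hf T M N i : ℝ) := by
  refine le_trans ?_ (Hf_ge i)
  have hT := h.T_pos; have hM := h.M_pos; have hN := h.N_pos
  obtain ⟨_, hμ⟩ := h.mu_bounds hk
  obtain ⟨hN1, hN2⟩ := h.Nprime_bounds hk
  have hlam := abs_le.1 (abs_q_mul_lamOf_le (T := T) (m := (blockStart M ℓ L k : ℝ)) (R := R))
  have hq' : (qOf T (blockStart M ℓ L k) R : ℝ) ≤ 2 * (2 : ℝ) ^ i := by
    have : (qOf T (blockStart M ℓ L k) R : ℝ) < (2 : ℝ) ^ (i + 1) := by exact_mod_cast hq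
    rw [pow_succ] at this; linarith
  rw [Finset.mem_Icc] at hn₁
  have hn : (n₁ : ℝ) ≤ L + ℓ := by exact_mod_cast hn₁.2
  have hell := h.ell_le_Nprime hk
  have hns : (n₁ : ℝ) + sOf T (blockStart M ℓ L k) R ≤ 2 * (15 / 100 * N) := by linarith
  have hns0 : 0 ≤ (n₁ : ℝ) + sOf T (blockStart M ℓ L k) R := by
    have : (L : ℝ) ≤ n₁ := by exact_mod_cast hn₁.1
    linarith
  have hsq : ((n₁ : ℝ) + sOf T (blockStart M ℓ L k) R) ^ 2 ≤ (2 * (15 / 100 * N)) ^ 2 := pow_le_pow_left₀ hns0 hns 2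
  have hμ0 := (muOf_pos hT (h.blockStart_pos k)).le
  have hμ' : muOf T (blockStart M ℓ L k) ≤ 3 * (T / M ^ 3) := by
    calc muOf T (blockStart M ℓ L k) ≤ 9 * (T / (3 * M ^ 3)) := hμ
      _ = 3 * (T / M ^ 3) := by ring
  have h3 : 3 * muOf T (blockStart M ℓ L k) * qOf T (blockStart M ℓ L k) R * ((n₁ : ℝ) + sOf T (blockStart M ℓ L k) R) ^ 2 ≤
      3 * (3 * (T / M ^ 3)) * (2 * (2 : ℝ) ^ i) * (2 * (15 / 100 * N)) ^ 2 := by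
    apply mul_le_mul (mul_le_mul (mul_le_mul_of_nonneg_left hμ' (by norm_num)) hq' (by positivity) (by positivity)) hsq
      (by positivity) (by positivity)
  have e : 3 * (3 * (T / M ^ 3)) * (2 * (2 : ℝ) ^ i) * (2 * (15 / 100 * N)) ^ 2 = 81 / 50 * (2 : ℝ) ^ i * (T * N ^ 2 / M ^ 3) := by
    ring
  linarith [hlam.2]

/-! #### `M₀` -/

omit h in
/-- `M0f_add_one_ge`: an auxiliary step of the proof of Bourgain's (3.12) for `F = log`. [folklore] -/
theorem M0f_add_one_ge (i : ℕ) :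
    3 / 2 * max 1 (27 / 10000 * (2 : ℝ) ^ i * T * N ^ 2 / M ^ 3) ≤ (M0f T M N i : ℝ) + 1 := by
  unfold M0f
  set y := max 1 (27 / 10000 * (2 : ℝ) ^ i * T * N ^ 2 / M ^ 3)
  have hy : 1 ≤ y := le_max_left _ _
  have h0 : 0 ≤ 3 * y - 3 / 2 := by linarith
  have := (Nat.lt_floor_add_one (3 * y - 3 / 2)).le
  linarith

/-- `M0f_add_one_le`: an auxiliary step of the proof of Bourgain's (3.12) for `F = log`. [folklore] -/
theorem M0f_add_one_le {k : ℕ} (hk : k < blockCount M ℓ) {i : ℕ} (hq : 2 ^ i ≤ qOf T (blockStart M ℓ L k) R)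
    (hH : 1 ≤ H0 T (blockStart M ℓ L k) R L) :
    (M0f T M N i : ℝ) + 1 ≤ qOf T (blockStart M ℓ L k) R * lamOf T (blockStart M ℓ L k) R +
      3 * muOf T (blockStart M ℓ L k) * qOf T (blockStart M ℓ L k) R * ((L : ℝ) + sOf T (blockStart M ℓ L k) R) ^ 2 := by
  unfold M0f
  have hT := h.T_pos; have hM := h.M_pos; have hN := h.N_pos
  set y := max 1 (27 / 10000 * (2 : ℝ) ^ i * T * N ^ 2 / M ^ 3) with hy'
  have hy : 1 ≤ y := le_max_left _ _
  have h0 : 0 ≤ 3 * y - 3 / 2 := by linarith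
  have h1 : (⌊3 * y - 3 / 2⌋₊ : ℝ) ≤ 3 * y - 3 / 2 := Nat.floor_le h0
  have hlam := abs_le.1 (abs_q_mul_lamOf_le (T := T) (m := (blockStart M ℓ L k : ℝ)) (R := R))
  -- `y ≤ H₀`
  unfold H0 at hH
  obtain ⟨hμ, _⟩ := h.mu_bounds hk
  obtain ⟨hN1, _⟩ := h.Nprime_bounds hk
  have hq' : (2 : ℝ) ^ i ≤ qOf T (blockStart M ℓ L k) R := by exact_mod_cast hq
  have hμ0 := (muOf_pos hT (h.blockStart_pos k)).le
  have hlo : 27 / 10000 * (2 : ℝ) ^ i * T * N ^ 2 / M ^ 3 ≤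
      muOf T (blockStart M ℓ L k) * qOf T (blockStart M ℓ L k) R * ((L : ℝ) + sOf T (blockStart M ℓ L k) R) ^ 2 := by
    have e : 27 / 10000 * (2 : ℝ) ^ i * T * N ^ 2 / M ^ 3 = T / (3 * M ^ 3) * (2 : ℝ) ^ i * (9 / 100 * N) ^ 2 := by
      field_simp; ring
    rw [e]
    apply mul_le_mul (mul_le_mul hμ hq' (by positivity) hμ0) (pow_le_pow_left₀ (by positivity) hN1 2) (by positivity)
      (by positivity)
  have hyle : y ≤ muOf T (blockStart M ℓ L k) * qOf T (blockStart M ℓ L k) R * ((L : ℝ) + sOf T (blockStart M ℓ L k) R) ^ 2 :=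
    max_le hH hlo
  nlinarith [hlam.1]

/-- `M0f_box`: an auxiliary step of the proof of Bourgain's (3.12) for `F = log`. [folklore] -/
theorem M0f_box (i : ℕ) : 27 / 5000 * ((2 : ℝ) ^ i * N / R ^ 2) ≤ (M0f T M N i : ℝ) + 1 := by
  refine le_trans ?_ (M0f_add_one_ge i)
  have h2 := h.TN2_div_M3.1
  have hQ : 0 < (2 : ℝ) ^ i := by positivity
  have hm : 27 / 10000 * (2 : ℝ) ^ i * T * N ^ 2 / M ^ 3 ≤ max 1 (27 / 10000 * (2 : ℝ) ^ i * T * N ^ 2 / M ^ 3) :=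
    le_max_right _ _
  have hm1 : 1 ≤ max 1 (27 / 10000 * (2 : ℝ) ^ i * T * N ^ 2 / M ^ 3) := le_max_left _ _
  calc 27 / 5000 * ((2 : ℝ) ^ i * N / R ^ 2) = 27 / 10000 * (2 : ℝ) ^ i * (2 * N / R ^ 2) := by ring
    _ ≤ 27 / 10000 * (2 : ℝ) ^ i * (T * N ^ 2 / M ^ 3) := by gcongr
    _ = 27 / 10000 * (2 : ℝ) ^ i * T * N ^ 2 / M ^ 3 := by ring
    _ ≤ max 1 (27 / 10000 * (2 : ℝ) ^ i * T * N ^ 2 / M ^ 3) := hm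
    _ ≤ 3 / 2 * max 1 (27 / 10000 * (2 : ℝ) ^ i * T * N ^ 2 / M ^ 3) := by linarith

/-! #### `κ`, `X₃`, `X₅`, the prefactor -/

/-- `kappa_block_le`: an auxiliary step of the proof of Bourgain's (3.12) for `F = log`. [folklore] -/
theorem kappa_block_le {k : ℕ} (hk : k < blockCount M ℓ) {i : ℕ} (hq : 2 ^ i ≤ qOf T (blockStart M ℓ L k) R) :
    kappa (muOf T (blockStart M ℓ L k)) (qOf T (blockStart M ℓ L k) R) ≤ kappa (muLo T M) ((2 : ℝ) ^ i) :=
  kappa_anti h.muLo_pos (by positivity) (h.muLo_le_mu k hk) (by exact_mod_cast hq)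

/-- `kappa_muLo_le`: an auxiliary step of the proof of Bourgain's (3.12) for `F = log`. [folklore] -/
theorem kappa_muLo_le (i : ℕ) :
    kappa (muLo T M) ((2 : ℝ) ^ i) ≤ 1 / 2 * R * Real.sqrt N / ((2 : ℝ) ^ i * Real.sqrt ((2 : ℝ) ^ i)) :=
  kappa_le h.N_pos h.R_pos (by positivity) h.muLo_ge le_rfl

/-- `R⁴ ≤ (2^i)³ N` on a sieve class `R⁶ < (2^i)⁵ N`. [folklore] -/
theorem R4_le_of_sieve {i : ℕ} (hs : (R : ℝ) ^ 6 < ((2 : ℝ) ^ i) ^ 5 * N) : (R : ℝ) ^ 4 ≤ ((2 : ℝ) ^ i) ^ 3 * N := by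
  have hN := h.N_pos; have hR := h.R_pos; have hRN := h.hRN
  set Q := (2 : ℝ) ^ i with hQ'
  have hQ : 0 < Q := by positivity
  rcases le_or_gt (R : ℝ) Q with hle | hgt
  · calc (R : ℝ) ^ 4 = R ^ 3 * R := by ring
      _ ≤ Q ^ 3 * N := by gcongr
  · -- `Q < R`: `Q³ N = Q⁵N/Q² > R⁶/Q² > R⁶/R² = R⁴`
    have h1 : (R : ℝ) ^ 6 < Q ^ 5 * N := hs
    have h2 : (R : ℝ) ^ 4 * Q ^ 2 < Q ^ 5 * N := by
      calc (R : ℝ) ^ 4 * Q ^ 2 < (R : ℝ) ^ 4 * (R : ℝ) ^ 2 := by gcongr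
        _ = (R : ℝ) ^ 6 := by ring
        _ < Q ^ 5 * N := h1
    have h3 : (R : ℝ) ^ 4 * Q ^ 2 ≤ Q ^ 3 * N * Q ^ 2 := by nlinarith
    exact le_of_mul_le_mul_right h3 (by positivity)

/-- The prefactor hypothesis of `sum_norm_mainTerm_le` on a sieve class. [folklore] -/
theorem prefactor_block_le {k : ℕ} (hk : k < blockCount M ℓ) {i : ℕ} (hq : 2 ^ i ≤ qOf T (blockStart M ℓ L k) R)
    (hH : 1 ≤ H0 T (blockStart M ℓ L k) R L) (hs : (R : ℝ) ^ 6 < ((2 : ℝ) ^ i) ^ 5 * N) :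
    2 * (1 + 5 * kappa (muOf T (blockStart M ℓ L k)) (qOf T (blockStart M ℓ L k) R) /
        (muOf T (blockStart M ℓ L k) * qOf T (blockStart M ℓ L k) R * ((L : ℝ) + sOf T (blockStart M ℓ L k) R) ^ 2 *
          Real.sqrt (muOf T (blockStart M ℓ L k) * qOf T (blockStart M ℓ L k) R * ((L : ℝ) + sOf T (blockStart M ℓ L k) R) ^ 2))) /
      Real.sqrt (muOf T (blockStart M ℓ L k) * qOf T (blockStart M ℓ L k) R * ((L : ℝ) + sOf T (blockStart M ℓ L k) R)) ≤
      66000 * R / Real.sqrt ((2 : ℝ) ^ i) := by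
  unfold H0 at hH
  exact prefactor_le h.N_pos h.R_pos (by positivity) (h.muLo_ge.trans (h.muLo_le_mu k hk)) (by exact_mod_cast hq)
    (h.Nprime_bounds hk).1 hH (h.R4_le_of_sieve hs)

/-! #### The `r`-`q` relation inside a block: `r/q ∈ [0.45 T/M², 2.14 T/M²]` -/

/-- `r_div_q_bounds`: an auxiliary step of the proof of Bourgain's (3.12) for `F = log`. [folklore] -/
theorem r_div_q_bounds (k : ℕ) (hk : k < blockCount M ℓ) :
    45 / 100 * (T / M ^ 2) ≤ (rOf T (blockStart M ℓ L k) R : ℝ) / qOf T (blockStart M ℓ L k) R ∧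
      (rOf T (blockStart M ℓ L k) R : ℝ) / qOf T (blockStart M ℓ L k) R ≤ 214 / 100 * (T / M ^ 2) := by
  have h1 := abs_le.1 (abs_xpt_sub_le (T := T) (m := (blockStart M ℓ L k : ℝ)) h.one_le_R)
  obtain ⟨hm1, hm2⟩ := h.blockStart_bounds hk
  have hη := h.eta_le
  have hTM := h.one_le_T_div_M2
  have hM := h.M_pos; have hT := h.T_pos
  have hm : 0 < (blockStart M ℓ L k : ℝ) := lt_of_lt_of_le (by positivity) hm1
  -- `xpt = T/(2m²) ∈ [T/(2M²), T/(2 (0.49M)²)]`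
  have hx1 : T / M ^ 2 / 2 ≤ xpt T (blockStart M ℓ L k) := by
    unfold xpt
    rw [div_div, div_le_div_iff₀ (by positivity) (by positivity)]
    nlinarith [pow_le_pow_left₀ hm.le hm2 2]
  have hx2 : xpt T (blockStart M ℓ L k) ≤ (10000 / 4802) * (T / M ^ 2) := by
    unfold xpt
    rw [show (10000 : ℝ) / 4802 * (T / M ^ 2) = T / (2 * (49 / 100 * M) ^ 2) by field_simp; norm_num]
    apply div_le_div_of_nonneg_left hT.le (by positivity)
    nlinarith [pow_le_pow_left₀ (by positivity : (0:ℝ) ≤ 49 / 100 * M) hm1 2]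
  constructor <;> nlinarith [h1.1, h1.2]

end Good


/-- The family `fam i j`: blocks of class `i` (`2^i ≤ q < 2^{i+1}`), minor (`H₀ ≥ 1`), with numerator
`2^j ≤ r < 2^{j+1}`. [folklore] -/
def fam (T M : ℝ) (R L ℓ i j : ℕ) : Finset ℕ :=
  (Finset.range (blockCount M ℓ)).filter fun k =>
    (2 ^ i ≤ qOf T (blockStart M ℓ L k) R ∧ qOf T (blockStart M ℓ L k) R < 2 ^ (i + 1)) ∧
      1 ≤ H0 T (blockStart M ℓ L k) R L ∧
      ((2 : ℤ) ^ j ≤ rOf T (blockStart M ℓ L k) R ∧ rOf T (blockStart M ℓ L k) R < (2 : ℤ) ^ (j + 1))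

/-- `mem_fam`: an auxiliary step of the proof of Bourgain's (3.12) for `F = log`. [folklore] -/
theorem mem_fam {T M : ℝ} {R L ℓ i j k : ℕ} :
    k ∈ fam T M R L ℓ i j ↔ k < blockCount M ℓ ∧
      (2 ^ i ≤ qOf T (blockStart M ℓ L k) R ∧ qOf T (blockStart M ℓ L k) R < 2 ^ (i + 1)) ∧
      1 ≤ H0 T (blockStart M ℓ L k) R L ∧
      ((2 : ℤ) ^ j ≤ rOf T (blockStart M ℓ L k) R ∧ rOf T (blockStart M ℓ L k) R < (2 : ℤ) ^ (j + 1)) := by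
  unfold fam; rw [Finset.mem_filter, Finset.mem_range]

/-- The conclusion of `SecondSpacingLog.secondSpacingCount_le` for a fixed `K` (a one-field structure,
inhabited by `secondSpacingCount_le`). [folklore] -/
structure SpacingBound (K : ℝ) : Prop where
  bound : ∀ {T A C η : ℝ}, 0 < T → 1 ≤ A → 1 ≤ C → η ≤ A / (4 * C) →
      ∀ (𝓕 : Finset ℕ) (x : ℕ → Fin 4 → ℝ) (r : ℕ → ℤ) (q : ℕ → ℕ) (xpt : ℕ → ℝ) (abar n : ℕ → ℤ) (m₀ H : ℕ),
      1 ≤ H → ∀ {V : ℝ}, 1 ≤ V → 0 ≤ delta2 T A C η H →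
      (∀ k ∈ 𝓕, A < r k ∧ (r k : ℝ) ≤ 2 * A) → (∀ k ∈ 𝓕, C < q k ∧ (q k : ℝ) ≤ 2 * C) →
      (∀ k ∈ 𝓕, IsCoprime (r k) (q k)) → (∀ k ∈ 𝓕, -(r k) * abar k ≡ 1 [ZMOD q k]) →
      (∀ k ∈ 𝓕, |xpt k - r k / q k| ≤ η) →
      (∀ k ∈ 𝓕, x k 1 = -(abar k : ℝ) / (4 * q k) - n k) →
      (∀ k ∈ 𝓕, x k 2 = -kap T (q k * Real.sqrt (2 * xpt k))) →
      (∀ pt : ℤ × ℤ, (𝓕.filter (fun k => ((r k, (q k : ℤ)) : ℤ × ℤ) = pt)).card ≤ m₀) →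
      (bourgainSecondSpacingCount 𝓕 x H V : ℝ) ≤
        m₀ ^ 2 * (K * ((1 / (3 * (H : ℝ) ^ 2 * V) * delta2 T A C η H + (1 / (3 * (H : ℝ) ^ 2 * V)) ^ 2)
          * (A * C ^ 2 * (A + C)) + A * C + delta2 T A C η H * A ^ 2 + delta2 T A C η H * C ^ 2))

/-- `delta2_nonneg`: an auxiliary step of the proof of Bourgain's (3.12) for `F = log`. [folklore] -/
theorem delta2_nonneg {T A C η : ℝ} {H : ℕ} (hT : 0 < T) (hA : 0 < A) (hC : 0 < C) (hη : 0 ≤ η) (hH : 1 ≤ H) :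
    0 ≤ delta2 T A C η H := by
  unfold delta2
  have hAC : 0 < Real.sqrt (A * C) := Real.sqrt_pos.2 (by positivity)
  have hk : 0 < kap T (Real.sqrt (A * C) / 2) := kap_pos hT (by positivity)
  have hH0 : (0 : ℝ) < H := by exact_mod_cast (show 0 < H by omega)
  positivity

namespace Good

variable {T M N : ℝ} {R L ℓ : ℕ} (h : Good T M N R L ℓ)
include h

/-- **Second spacing of a family.** With `A = 2^j - 1/2`, `C = 2^i - 1/2` (`i ≥ 1`, `j ≥ 1`):
`B(fam i j) ≤ 9 K · (GK bracket)`. [folklore] -/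
theorem family_spacing_le {K : ℝ} (hK0 : 0 ≤ K) (hK : SpacingBound K) {i j : ℕ} (hi : 1 ≤ i) (hj : 1 ≤ j) :
    (bourgainSecondSpacingCount (fam T M R L ℓ i j)
        (fun k => xvec (qOf T (blockStart M ℓ L k) R) (abarOf T (blockStart M ℓ L k) R) (bOf T (blockStart M ℓ L k) R)
          (muOf T (blockStart M ℓ L k)) (sOf T (blockStart M ℓ L k) R) (lamOf T (blockStart M ℓ L k) R))
        (Hf T M N i) 1 : ℝ) ≤
      9 * (K * ((1 / (3 * (Hf T M N i : ℝ) ^ 2) * delta2 T ((2 : ℝ) ^ j - 1 / 2) ((2 : ℝ) ^ i - 1 / 2) (LogSumBlocks.eta R) (Hf T M N i)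
          + (1 / (3 * (Hf T M N i : ℝ) ^ 2)) ^ 2) * (((2 : ℝ) ^ j - 1 / 2) * ((2 : ℝ) ^ i - 1 / 2) ^ 2 * (((2 : ℝ) ^ j - 1 / 2) + ((2 : ℝ) ^ i - 1 / 2)))
          + ((2 : ℝ) ^ j - 1 / 2) * ((2 : ℝ) ^ i - 1 / 2)
          + delta2 T ((2 : ℝ) ^ j - 1 / 2) ((2 : ℝ) ^ i - 1 / 2) (LogSumBlocks.eta R) (Hf T M N i) * ((2 : ℝ) ^ j - 1 / 2) ^ 2
          + delta2 T ((2 : ℝ) ^ j - 1 / 2) ((2 : ℝ) ^ i - 1 / 2) (LogSumBlocks.eta R) (Hf T M N i) * ((2 : ℝ) ^ i - 1 / 2) ^ 2)) := by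
  classical
  have hT := h.T_pos; have hM := h.M_pos
  set F := fam T M R L ℓ i j with hF
  set A : ℝ := (2 : ℝ) ^ j - 1 / 2 with hA
  set C : ℝ := (2 : ℝ) ^ i - 1 / 2 with hC
  have h2j : (2 : ℝ) ≤ (2 : ℝ) ^ j := by
    calc (2 : ℝ) = 2 ^ 1 := by norm_num
      _ ≤ 2 ^ j := pow_le_pow_right₀ (by norm_num) hj
  have h2i : (2 : ℝ) ≤ (2 : ℝ) ^ i := by
    calc (2 : ℝ) = 2 ^ 1 := by norm_num
      _ ≤ 2 ^ i := pow_le_pow_right₀ (by norm_num) hi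
  have hA1 : 1 ≤ A := by rw [hA]; linarith
  have hC1 : 1 ≤ C := by rw [hC]; linarith
  have hη0 := (eta_pos h.one_le_R).le
  have hHf := h.one_le_Hf i
  -- empty family: trivial
  rcases F.eq_empty_or_nonempty with hFe | ⟨k₀, hk₀⟩
  · rw [hFe]
    have : bourgainSecondSpacingCount ∅ (fun k => xvec (qOf T (blockStart M ℓ L k) R) (abarOf T (blockStart M ℓ L k) R)
        (bOf T (blockStart M ℓ L k) R) (muOf T (blockStart M ℓ L k)) (sOf T (blockStart M ℓ L k) R)
        (lamOf T (blockStart M ℓ L k) R)) (Hf T M N i) 1 = 0 := by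
      unfold bourgainSecondSpacingCount; simp
    rw [this, Nat.cast_zero]
    have hΔ := delta2_nonneg (H := Hf T M N i) hT (by linarith : (0:ℝ) < A) (by linarith : (0:ℝ) < C) hη0 hHf
    have hA0 : (0:ℝ) < A := by linarith
    have hC0 : (0:ℝ) < C := by linarith
    positivity
  -- nonempty: the witness gives `η ≤ A/(4C)`
  have hk₀' := (mem_fam.1 (by rw [hF] at hk₀; exact hk₀))
  obtain ⟨hk₀K, ⟨hq₀1, hq₀2⟩, _, ⟨hr₀1, hr₀2⟩⟩ := hk₀'
  obtain ⟨hrq1, _⟩ := h.r_div_q_bounds k₀ hk₀K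
  have hTM := h.one_le_T_div_M2
  have hq₀pos : (0 : ℝ) < qOf T (blockStart M ℓ L k₀) R := by exact_mod_cast qOf_pos
  have hr₀le : (rOf T (blockStart M ℓ L k₀) R : ℝ) ≤ 2 * A := by
    have : rOf T (blockStart M ℓ L k₀) R ≤ 2 ^ (j + 1) - 1 := by omega
    have : (rOf T (blockStart M ℓ L k₀) R : ℝ) ≤ (2 : ℝ) ^ (j + 1) - 1 := by exact_mod_cast this
    rw [hA, pow_succ] at *; linarith
  have hq₀ge : C ≤ qOf T (blockStart M ℓ L k₀) R := by
    have : ((2 : ℕ) ^ i : ℝ) ≤ qOf T (blockStart M ℓ L k₀) R := by exact_mod_cast hq₀1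
    push_cast at this; rw [hC]; linarith
  have hAC : 45 / 100 * C ≤ 2 * A := by
    -- `0.45 ≤ 0.45 T/M² ≤ r/q`, so `0.45 q ≤ r ≤ 2A` and `q ≥ C`
    have h1 : 45 / 100 ≤ (rOf T (blockStart M ℓ L k₀) R : ℝ) / qOf T (blockStart M ℓ L k₀) R := by nlinarith
    rw [le_div_iff₀ hq₀pos] at h1
    nlinarith
  have hηAC : LogSumBlocks.eta R ≤ A / (4 * C) := by
    have hC0 : (0 : ℝ) < C := by linarith
    rw [le_div_iff₀ (by positivity)]
    have := h.eta_le; nlinarith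
  have hΔ := delta2_nonneg (H := Hf T M N i) hT (by linarith : (0:ℝ) < A) (by linarith : (0:ℝ) < C) hη0 hHf
  have hmain := hK.bound hT hA1 hC1 hηAC F
    (fun k => xvec (qOf T (blockStart M ℓ L k) R) (abarOf T (blockStart M ℓ L k) R) (bOf T (blockStart M ℓ L k) R)
          (muOf T (blockStart M ℓ L k)) (sOf T (blockStart M ℓ L k) R) (lamOf T (blockStart M ℓ L k) R))
    (fun k => rOf T (blockStart M ℓ L k) R) (fun k => qOf T (blockStart M ℓ L k) R) (fun k => xpt T (blockStart M ℓ L k))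
    (fun k => abarOf T (blockStart M ℓ L k) R)
    (fun k => round (-(abarOf T (blockStart M ℓ L k) R : ℝ) / (4 * qOf T (blockStart M ℓ L k) R))) 3 (Hf T M N i) hHf
    (V := 1) le_rfl hΔ ?_ ?_ ?_ ?_ ?_ ?_ ?_ ?_
  · refine hmain.trans (le_of_eq ?_); norm_num
  · -- `A < r ≤ 2A`
    intro k hk
    obtain ⟨_, _, _, ⟨hr1, hr2⟩⟩ := mem_fam.1 (by rw [hF] at hk; exact hk)
    constructor
    · have : ((2 : ℤ) ^ j : ℝ) ≤ rOf T (blockStart M ℓ L k) R := by exact_mod_cast hr1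
      push_cast at this
      show (2 : ℝ) ^ j - 1 / 2 < _
      linarith
    · have : rOf T (blockStart M ℓ L k) R ≤ 2 ^ (j + 1) - 1 := by omega
      have : (rOf T (blockStart M ℓ L k) R : ℝ) ≤ (2 : ℝ) ^ (j + 1) - 1 := by exact_mod_cast this
      show _ ≤ 2 * ((2 : ℝ) ^ j - 1 / 2)
      rw [pow_succ] at this; linarith
  · -- `C < q ≤ 2C`
    intro k hk
    obtain ⟨_, ⟨hq1, hq2⟩, _, _⟩ := mem_fam.1 (by rw [hF] at hk; exact hk)
    constructor
    · have : ((2 : ℕ) ^ i : ℝ) ≤ qOf T (blockStart M ℓ L k) R := by exact_mod_cast hq1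
      push_cast at this
      show (2 : ℝ) ^ i - 1 / 2 < _
      linarith
    · have : qOf T (blockStart M ℓ L k) R ≤ 2 ^ (i + 1) - 1 := by omega
      have : (qOf T (blockStart M ℓ L k) R : ℝ) ≤ (((2 : ℕ) ^ (i + 1) - 1 : ℕ) : ℝ) := by exact_mod_cast this
      rw [Nat.cast_sub (Nat.one_le_two_pow), Nat.cast_pow] at this
      push_cast at this
      show _ ≤ 2 * ((2 : ℝ) ^ i - 1 / 2)
      rw [pow_succ] at this; linarith
  · intro k _; exact isCoprime_r_q h.one_le_R
  · intro k _; exact neg_r_mul_abar h.one_le_R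
  · intro k _; exact abs_xpt_sub_le h.one_le_R
  · intro k _; exact xvec_one _ _ _ _ _ _
  · intro k _
    show xvec _ _ _ _ _ _ 2 = _
    rw [xvec_two, kappa_muOf_eq hT (h.blockStart_pos k) (by exact_mod_cast qOf_pos)]
  · -- fibres `≤ 3`
    intro pt
    have hsub : F.filter (fun k => ((rOf T (blockStart M ℓ L k) R, (qOf T (blockStart M ℓ L k) R : ℤ)) : ℤ × ℤ) = pt) ⊆
        F.filter (fun k => ((-(aOf T (blockStart M ℓ L k) R), (qOf T (blockStart M ℓ L k) R : ℤ)) : ℤ × ℤ) = pt) := by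
      intro k hk; simpa [rOf] using hk
    have h1 := card_filter_rational_le (T := T) (M := M) (Mx := M) (R := R) (ℓ := ℓ) (L := L) hT h.one_le_ell h.one_le_R
      h.L_succ_le h.one_le_m0 hM F (fun k hk => by
        have := (mem_fam.1 (by rw [hF] at hk; exact hk)).1
        exact (h.blockStart_bounds this).2) pt
    have h2 := h.two_eta_div_delta_le
    have h3 : ((F.filter (fun k => ((-(aOf T (blockStart M ℓ L k) R), (qOf T (blockStart M ℓ L k) R : ℤ)) : ℤ × ℤ) = pt)).card
        : ℝ) ≤ 3 := by linarith
    have h4 : (F.filter (fun k => ((-(aOf T (blockStart M ℓ L k) R), (qOf T (blockStart M ℓ L k) R : ℤ)) : ℤ × ℤ) = pt)).card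
        ≤ 3 := by exact_mod_cast h3
    exact (Finset.card_le_card hsub).trans h4

/-- **The Graham–Kolesnik bracket of a nonempty family** is bounded by the four monomials (in `Q = 2^i`).
[folklore] -/
theorem family_bracket_le {i j : ℕ} (hi : 1 ≤ i) (hj : 1 ≤ j) (hne : (fam T M R L ℓ i j).Nonempty) :
    (1 / (3 * (Hf T M N i : ℝ) ^ 2) * delta2 T ((2 : ℝ) ^ j - 1 / 2) ((2 : ℝ) ^ i - 1 / 2) (LogSumBlocks.eta R) (Hf T M N i)
          + (1 / (3 * (Hf T M N i : ℝ) ^ 2)) ^ 2) * (((2 : ℝ) ^ j - 1 / 2) * ((2 : ℝ) ^ i - 1 / 2) ^ 2 * (((2 : ℝ) ^ j - 1 / 2) + ((2 : ℝ) ^ i - 1 / 2)))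
          + ((2 : ℝ) ^ j - 1 / 2) * ((2 : ℝ) ^ i - 1 / 2)
          + delta2 T ((2 : ℝ) ^ j - 1 / 2) ((2 : ℝ) ^ i - 1 / 2) (LogSumBlocks.eta R) (Hf T M N i) * ((2 : ℝ) ^ j - 1 / 2) ^ 2
          + delta2 T ((2 : ℝ) ^ j - 1 / 2) ((2 : ℝ) ^ i - 1 / 2) (LogSumBlocks.eta R) (Hf T M N i) * ((2 : ℝ) ^ i - 1 / 2) ^ 2 ≤
      (20000 * 6000000) * ((T / M ^ 2) ^ 2 * ((2 : ℝ) ^ i) ^ 2 * R ^ 6 / N ^ 4)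
        + 4000000 * ((T / M ^ 2) ^ 2 * R ^ 8 / N ^ 4)
        + 5 * ((T / M ^ 2) * ((2 : ℝ) ^ i) ^ 2)
        + (600 * 6000000) * ((T / M ^ 2) ^ 2 * ((2 : ℝ) ^ i) ^ 2 * R ^ 2 / N ^ 2) := by
  have hT := h.T_pos; have hM := h.M_pos; have hN := h.N_pos; have hR := h.R_pos
  set A : ℝ := (2 : ℝ) ^ j - 1 / 2 with hA
  set C : ℝ := (2 : ℝ) ^ i - 1 / 2 with hC
  have h2j : (2 : ℝ) ≤ (2 : ℝ) ^ j := by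
    calc (2 : ℝ) = 2 ^ 1 := by norm_num
      _ ≤ 2 ^ j := pow_le_pow_right₀ (by norm_num) hj
  have h2i : (2 : ℝ) ≤ (2 : ℝ) ^ i := by
    calc (2 : ℝ) = 2 ^ 1 := by norm_num
      _ ≤ 2 ^ i := pow_le_pow_right₀ (by norm_num) hi
  have hA0 : 0 < A := by rw [hA]; linarith
  have hC0 : 0 < C := by rw [hC]; linarith
  have hCQ : C ≤ (2 : ℝ) ^ i := by rw [hC]; linarith
  obtain ⟨k₀, hk₀⟩ := hne
  obtain ⟨hk₀K, ⟨hq₀1, hq₀2⟩, _, ⟨hr₀1, hr₀2⟩⟩ := mem_fam.1 hk₀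
  obtain ⟨hrq1, hrq2⟩ := h.r_div_q_bounds k₀ hk₀K
  have hTM := h.one_le_T_div_M2
  have hq₀pos : (0 : ℝ) < qOf T (blockStart M ℓ L k₀) R := by exact_mod_cast qOf_pos
  have hr₀le : (rOf T (blockStart M ℓ L k₀) R : ℝ) ≤ 2 * A := by
    have : rOf T (blockStart M ℓ L k₀) R ≤ 2 ^ (j + 1) - 1 := by omega
    have : (rOf T (blockStart M ℓ L k₀) R : ℝ) ≤ (2 : ℝ) ^ (j + 1) - 1 := by exact_mod_cast this
    rw [hA]; rw [pow_succ] at this; linarith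
  have hr₀ge : A < (rOf T (blockStart M ℓ L k₀) R : ℝ) := by
    have : ((2 : ℤ) ^ j : ℝ) ≤ rOf T (blockStart M ℓ L k₀) R := by exact_mod_cast hr₀1
    push_cast at this; rw [hA]; linarith
  have hq₀ge : C ≤ qOf T (blockStart M ℓ L k₀) R := by
    have : ((2 : ℕ) ^ i : ℝ) ≤ qOf T (blockStart M ℓ L k₀) R := by exact_mod_cast hq₀1
    push_cast at this; linarith
  have hq₀le : (qOf T (blockStart M ℓ L k₀) R : ℝ) ≤ 2 * C := by
    have : qOf T (blockStart M ℓ L k₀) R ≤ 2 ^ (i + 1) - 1 := by omega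
    have : (qOf T (blockStart M ℓ L k₀) R : ℝ) ≤ (((2 : ℕ) ^ (i + 1) - 1 : ℕ) : ℝ) := by exact_mod_cast this
    rw [Nat.cast_sub (Nat.one_le_two_pow), Nat.cast_pow] at this
    push_cast at this
    rw [hC]; rw [pow_succ] at this; linarith
  -- `C/5 ≤ A` and `A ≤ (9/2) X C`
  have hAlo : C / 5 ≤ A := by
    have h1 : 45 / 100 ≤ (rOf T (blockStart M ℓ L k₀) R : ℝ) / qOf T (blockStart M ℓ L k₀) R := by nlinarith
    rw [le_div_iff₀ hq₀pos] at h1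
    nlinarith
  have hAhi : A ≤ 9 / 2 * (T / M ^ 2) * C := by
    rw [div_le_iff₀ hq₀pos] at hrq2
    nlinarith
  -- `H` lower bound `(81/1250) C N/R² ≤ H`
  have hHlo : 81 / 1250 * (C * N / R ^ 2) ≤ (Hf T M N i : ℝ) := by
    refine le_trans ?_ (h.Hf_ge' i)
    have : C * N / R ^ 2 ≤ (2 : ℝ) ^ i * N / R ^ 2 := by gcongr
    nlinarith [show 0 ≤ C * N / R ^ 2 by positivity]
  have hHf0 : (0 : ℝ) < Hf T M N i := by exact_mod_cast (show 0 < Hf T M N i by have := h.one_le_Hf i; omega)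
  -- `Δ₂ ≤ 6e6 R²/N²`
  have hΔ₂ : delta2 T A C (LogSumBlocks.eta R) (Hf T M N i) ≤ 6000000 * (R ^ 2 / N ^ 2) := by
    have := delta2_le (H := Hf T M N i) hT hA0 hC0 hHf0 hM hN hR hAhi hAlo h.hrel2 hHlo h.hNR
    unfold LogSumBlocks.eta; exact this
  have hΔ₂0 := delta2_nonneg (H := Hf T M N i) hT hA0 hC0 (eta_pos h.one_le_R).le (h.one_le_Hf i)
  have hgk := gk_terms_le (H := (Hf T M N i : ℝ)) (D := 6000000) hC0 hA0 hAlo hAhi hHf0 hHlo hN hR hM hT hΔ₂0 hΔ₂ (by norm_num)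
  refine hgk.trans ?_
  -- monomials in `C` are at most the monomials in `2^i`
  have hX : 0 < T / M ^ 2 := by positivity
  have hC2 : C ^ 2 ≤ ((2 : ℝ) ^ i) ^ 2 := pow_le_pow_left₀ hC0.le hCQ 2
  gcongr

end Good


/-- The conclusion of `sum_norm_mainTerm_le` for fixed `ε, C` (a one-field structure, inhabited by
`sum_norm_mainTerm_le`). [folklore] -/
structure MainBound (ε C : ℝ) : Prop where
  bound : ∀ (𝓕 : Finset ℕ) (q : ℕ → ℕ) [∀ k, NeZero (q k)] (a b abar : ℕ → ℤ) (μ s lam : ℕ → ℝ)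
      (L : ℕ) (n₁ : ℕ → ℕ) (M₀ H : ℕ) (X₃ X₅ P : ℝ),
      1 ≤ H → (H : ℝ) ^ (-(1 / 2 : ℝ)) ≤ X₃ → 0 < X₅ → 0 ≤ P →
      (∀ k ∈ 𝓕, ((a k : ℤ) : ZMod (q k)) * ((abar k : ℤ) : ZMod (q k)) = 1) →
      (∀ k ∈ 𝓕, 0 < μ k) → (∀ k ∈ 𝓕, |q k * lam k| ≤ 1 / 2) → (∀ k ∈ 𝓕, 1 ≤ (L : ℝ) + s k) →
      (∀ k ∈ 𝓕, L ≤ n₁ k) → (∀ k ∈ 𝓕, (n₁ k : ℝ) + s k ≤ 2 * (L + s k)) →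
      (∀ k ∈ 𝓕, 1 ≤ μ k * q k * (L + s k) ^ 2) →
      (∀ k ∈ 𝓕, q k * lam k + 3 * μ k * q k * (n₁ k + s k) ^ 2 ≤ H) →
      (∀ k ∈ 𝓕, (M₀ : ℝ) + 1 ≤ q k * lam k + 3 * μ k * q k * (L + s k) ^ 2) →
      (∀ k ∈ 𝓕, kappa (μ k) (q k) ≤ X₃) → (∀ k ∈ 𝓕, 3 / 32 * kappa (μ k) (q k) ≤ X₅) →
      (∀ k ∈ 𝓕, 2 * (1 + 5 * kappa (μ k) (q k) / (μ k * q k * (L + s k) ^ 2 * Real.sqrt (μ k * q k * (L + s k) ^ 2)))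
        / Real.sqrt (μ k * q k * (L + s k)) ≤ P) →
      ∑ k ∈ 𝓕, ‖mainTerm (q k) (a k) (b k) (μ k) (s k) (lam k) L (n₁ k)‖ ≤
        P * (2 * (2 + Real.log H) * ((𝓕.card : ℝ) ^ (5 / 6 : ℝ) *
          (C * Real.sqrt (1 + 24 * X₅ / Real.sqrt ((M₀ : ℝ) + 1)) * max 1 (X₃ / (H : ℝ) ^ (1 / 2 : ℝ)) *
            (H : ℝ) ^ (6 + ε) *
            Real.sqrt (bourgainSecondSpacingCount 𝓕
              (fun k => xvec (q k) (abar k) (b k) (μ k) (s k) (lam k)) H 1)) ^ (1 / 6 : ℝ)))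

/-- The absolute constant of the monomial inequality with the constants of this file. [folklore] -/
def cstMono : ℝ := (66000 : ℝ) ^ 12 * 168 ^ 10 * 70560 ^ 10 * 19 * 9 ^ 2 * 15 ^ 12 * 8 ^ 40 * 11 ^ 40

/-- The sum of the coefficients of the four Graham–Kolesnik monomials. [folklore] -/
def cstGK : ℝ := 20000 * 6000000 + 4000000 + 5 + 600 * 6000000

namespace Good

variable {T M N : ℝ} {R L ℓ : ℕ} (h : Good T M N R L ℓ)
include h

/-- `Q N/R² ≥ 25/27` as soon as class `i` contains a minor block. [folklore] -/
theorem QN_div_R2_ge {k : ℕ} (hk : k < blockCount M ℓ) {i : ℕ} (hq : qOf T (blockStart M ℓ L k) R < 2 ^ (i + 1))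
    (hH : 1 ≤ H0 T (blockStart M ℓ L k) R L) : 25 / 27 ≤ (2 : ℝ) ^ i * N / R ^ 2 := by
  unfold H0 at hH
  have hT := h.T_pos; have hM := h.M_pos; have hN := h.N_pos; have hR := h.R_pos
  obtain ⟨_, hμ⟩ := h.mu_bounds hk
  obtain ⟨hN1, hN2⟩ := h.Nprime_bounds hk
  have hq' : (qOf T (blockStart M ℓ L k) R : ℝ) ≤ 2 * (2 : ℝ) ^ i := by
    have : (qOf T (blockStart M ℓ L k) R : ℝ) < (2 : ℝ) ^ (i + 1) := by exact_mod_cast hq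
    rw [pow_succ] at this; linarith
  have hμ0 := (muOf_pos hT (h.blockStart_pos k)).le
  have hsq : ((L : ℝ) + sOf T (blockStart M ℓ L k) R) ^ 2 ≤ (15 / 100 * N) ^ 2 := pow_le_pow_left₀ (by linarith) hN2 2
  have h1 : muOf T (blockStart M ℓ L k) * qOf T (blockStart M ℓ L k) R * ((L : ℝ) + sOf T (blockStart M ℓ L k) R) ^ 2 ≤
      9 * (T / (3 * M ^ 3)) * (2 * (2 : ℝ) ^ i) * (15 / 100 * N) ^ 2 :=
    mul_le_mul (mul_le_mul hμ hq' (by positivity) (by positivity)) hsq (by positivity) (by positivity)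
  have h2 := h.TN2_div_M3.2
  have e : 9 * (T / (3 * M ^ 3)) * (2 * (2 : ℝ) ^ i) * (15 / 100 * N) ^ 2 = 27 / 200 * (2 : ℝ) ^ i * (T * N ^ 2 / M ^ 3) := by
    field_simp; ring
  have h3 : 27 / 200 * (2 : ℝ) ^ i * (T * N ^ 2 / M ^ 3) ≤ 27 / 200 * (2 : ℝ) ^ i * (8 * N / R ^ 2) := by
    have : 0 < (2 : ℝ) ^ i := by positivity
    gcongr
  have e2 : 27 / 200 * (2 : ℝ) ^ i * (8 * N / R ^ 2) = 27 / 25 * ((2 : ℝ) ^ i * N / R ^ 2) := by ring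
  linarith

/-- `H ≤ 15 QN/R²` on a class with a minor block. [folklore] -/
theorem Hf_le' {k : ℕ} (hk : k < blockCount M ℓ) {i : ℕ} (hq : qOf T (blockStart M ℓ L k) R < 2 ^ (i + 1))
    (hH : 1 ≤ H0 T (blockStart M ℓ L k) R L) : (Hf T M N i : ℝ) ≤ 15 * ((2 : ℝ) ^ i * N / R ^ 2) := by
  have h1 := h.Hf_le i; have h2 := h.QN_div_R2_ge hk hq hH; linarith

/-- `H ≤ T`. [folklore] -/
theorem Hf_le_T {k : ℕ} (hk : k < blockCount M ℓ) {i : ℕ} (hq1 : 2 ^ i ≤ qOf T (blockStart M ℓ L k) R)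
    (hq : qOf T (blockStart M ℓ L k) R < 2 ^ (i + 1))
    (hH : 1 ≤ H0 T (blockStart M ℓ L k) R L) : (Hf T M N i : ℝ) ≤ T := by
  have h1 := h.Hf_le' hk hq hH
  have hQ : (2 : ℝ) ^ i ≤ 11 * R ^ 2 := by
    have : ((2 : ℕ) ^ i : ℝ) ≤ qOf T (blockStart M ℓ L k) R := by exact_mod_cast hq1
    push_cast at this; linarith [h.q_le k]
  have hR := h.R_pos; have hN := h.N_pos; have hM := h.M_pos
  have h2 : (2 : ℝ) ^ i * N / R ^ 2 ≤ 11 * N := by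
    rw [div_le_iff₀ (by positivity)]; nlinarith
  -- `165 N ≤ T` since `N ≤ M`, `M² ≤ T`, `M ≥ 2^20`
  have h3 : 165 * N ≤ T := by
    have := h.N_mul_le_M; have := h.hN0; nlinarith [h.hMT, h.hNM]
  linarith

/-- **The product `W = P¹² #F¹⁰ F₅ mx² H¹² B` of a sieve family** is `≤ 9K · cstGK · cstMono · (M⁶/(N²R))²`.
[folklore] -/
theorem family_W_le {K : ℝ} (hK0 : 0 ≤ K) (hK : SpacingBound K) {i j : ℕ} (hi : 2 ≤ i) (hj : 1 ≤ j)
    (hs : (R : ℝ) ^ 6 < ((2 : ℝ) ^ i) ^ 5 * N) (hne : (fam T M R L ℓ i j).Nonempty) :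
    (66000 * R / Real.sqrt ((2 : ℝ) ^ i)) ^ 12 * ((fam T M R L ℓ i j).card : ℝ) ^ 10 *
        (1 + 24 * (3 / 32 * kappa (muLo T M) ((2 : ℝ) ^ i)) / Real.sqrt ((M0f T M N i : ℝ) + 1)) *
        (max 1 (max (kappa (muLo T M) ((2 : ℝ) ^ i)) ((Hf T M N i : ℝ) ^ (-(1 / 2 : ℝ))) / (Hf T M N i : ℝ) ^ (1 / 2 : ℝ))) ^ 2 *
        (Hf T M N i : ℝ) ^ 12 *
        (bourgainSecondSpacingCount (fam T M R L ℓ i j)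
          (fun k => xvec (qOf T (blockStart M ℓ L k) R) (abarOf T (blockStart M ℓ L k) R) (bOf T (blockStart M ℓ L k) R)
            (muOf T (blockStart M ℓ L k)) (sOf T (blockStart M ℓ L k) R) (lamOf T (blockStart M ℓ L k) R))
          (Hf T M N i) 1 : ℝ) ≤
      9 * K * cstGK * cstMono * (M ^ 6 / (N ^ 2 * R)) ^ 2 := by
  classical
  have hT := h.T_pos; have hM := h.M_pos; have hN := h.N_pos; have hR := h.R_pos
  have hi1 : 1 ≤ i := by omega
  set Q : ℝ := (2 : ℝ) ^ i with hQ'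
  have hQ : 0 < Q := by positivity
  have hQ1 : 1 ≤ Q := one_le_pow₀ (by norm_num)
  set F := fam T M R L ℓ i j with hF
  obtain ⟨k₀, hk₀⟩ := hne
  obtain ⟨hk₀K, ⟨hq₀1, hq₀2⟩, hH₀, _⟩ := mem_fam.1 hk₀
  -- the factors
  set P : ℝ := 66000 * R / Real.sqrt Q with hP
  set κ : ℝ := kappa (muLo T M) Q with hκ
  set Hr : ℝ := (Hf T M N i : ℝ) with hHr
  set F₅ : ℝ := 1 + 24 * (3 / 32 * κ) / Real.sqrt ((M0f T M N i : ℝ) + 1) with hF₅def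
  set mx : ℝ := max 1 (max κ (Hr ^ (-(1 / 2 : ℝ))) / Hr ^ (1 / 2 : ℝ)) with hmx
  set B : ℝ := (bourgainSecondSpacingCount F
          (fun k => xvec (qOf T (blockStart M ℓ L k) R) (abarOf T (blockStart M ℓ L k) R) (bOf T (blockStart M ℓ L k) R)
            (muOf T (blockStart M ℓ L k)) (sOf T (blockStart M ℓ L k) R) (lamOf T (blockStart M ℓ L k) R))
          (Hf T M N i) 1 : ℝ) with hB
  have hκ0 : 0 < κ := kappa_pos h.muLo_pos hQ
  have hκle : κ ≤ 1 / 2 * R * Real.sqrt N / (Q * Real.sqrt Q) := h.kappa_muLo_le i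
  have hHr1 : (1 : ℝ) ≤ Hr := by rw [hHr]; exact_mod_cast h.one_le_Hf i
  have hHr0 : 0 < Hr := by linarith
  -- bounds on the factors
  have hP0 : 0 ≤ P := by positivity
  have hcnt1 : (F.card : ℝ) ≤ 168 * (M / N) * (Q / R) ^ 2 := by
    have hsub : F ⊆ (Finset.range (blockCount M ℓ)).filter (fun k =>
        2 ^ i ≤ qOf T (blockStart M ℓ L k) R ∧ qOf T (blockStart M ℓ L k) R < 2 ^ (i + 1)) := by
      intro k hk; rw [Finset.mem_filter, Finset.mem_range]; have := mem_fam.1 hk; exact ⟨this.1, this.2.1⟩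
    refine le_trans (by exact_mod_cast Finset.card_le_card hsub) ((h.card_class_le_near i).trans (le_of_eq ?_))
    rw [hQ']; field_simp
  have hcnt2 : (F.card : ℝ) ≤ 70560 * max (M * R ^ 2 / (N * Q ^ 2)) (R ^ 2 / Q) := by
    have hsub : F ⊆ (Finset.range (blockCount M ℓ)).filter (fun k =>
        2 ^ i ≤ qOf T (blockStart M ℓ L k) R ∧ qOf T (blockStart M ℓ L k) R < 2 ^ (i + 1)) := by
      intro k hk; rw [Finset.mem_filter, Finset.mem_range]; have := mem_fam.1 hk; exact ⟨this.1, this.2.1⟩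
    refine le_trans (by exact_mod_cast Finset.card_le_card hsub) ((h.card_class_le_far hi1).trans (le_of_eq ?_))
    rw [hQ']; congr 2; field_simp
  have hF₅ : F₅ ≤ 19 * max 1 (R ^ 2 / Q ^ 2) := by
    rw [hF₅def]; exact box5_le hN hR hQ hκle (h.M0f_box i)
  have hF₅0 : 0 ≤ F₅ := by
    rw [hF₅def]; have : 0 ≤ Real.sqrt ((M0f T M N i : ℝ) + 1) := Real.sqrt_nonneg _; positivity
  have hmxle : mx ≤ 9 * max 1 (R ^ 2 / Q ^ 2) := by
    have hQN : 27 / 5000 * (Q * N / R ^ 2) ≤ Hr := by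
      have := h.Hf_ge' i; rw [hHr]
      have e : Q * N / R ^ 2 = (2 : ℝ) ^ i * N / R ^ 2 := by rw [hQ']
      rw [e]; nlinarith [show 0 ≤ (2 : ℝ) ^ i * N / R ^ 2 by positivity]
    have h1 := mx_le hN hR hQ hκle hHr1 hQN
    have e1 : Hr ^ (-(1 / 2 : ℝ)) = 1 / Real.sqrt Hr := by
      rw [Real.rpow_neg hHr0.le, Real.sqrt_eq_rpow, inv_eq_one_div]
    have e2 : Hr ^ (1 / 2 : ℝ) = Real.sqrt Hr := by rw [Real.sqrt_eq_rpow]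
    rw [hmx, e1, e2]; exact h1
  have hmx0 : 0 ≤ mx := le_trans zero_le_one (le_max_left _ _)
  have hHle : Hr ≤ 15 * (Q * N / R ^ 2) := by
    have := h.Hf_le' hk₀K hq₀2 hH₀; rw [hHr, hQ']; simpa [mul_div_assoc] using this
  have hQR : Q ≤ 11 * R ^ 2 := by
    have : ((2 : ℕ) ^ i : ℝ) ≤ qOf T (blockStart M ℓ L k₀) R := by exact_mod_cast hq₀1
    push_cast at this; linarith [h.q_le k₀]
  -- `B ≤ 9 K · (four monomials)`
  have hBle : B ≤ 9 * (K * ((20000 * 6000000) * ((T / M ^ 2) ^ 2 * Q ^ 2 * R ^ 6 / N ^ 4)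
        + 4000000 * ((T / M ^ 2) ^ 2 * R ^ 8 / N ^ 4) + 5 * ((T / M ^ 2) * Q ^ 2)
        + (600 * 6000000) * ((T / M ^ 2) ^ 2 * Q ^ 2 * R ^ 2 / N ^ 2))) := by
    have h1 := h.family_spacing_le hK0 hK hi1 hj
    have h2 := h.family_bracket_le hi1 hj ⟨k₀, hk₀⟩
    rw [hB, hF]
    refine h1.trans ?_
    rw [hQ'] at *
    exact mul_le_mul_of_nonneg_left (mul_le_mul_of_nonneg_left h2 hK0) (by norm_num)
  have hB0 : 0 ≤ B := by rw [hB]; exact Nat.cast_nonneg _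
  -- the common factor
  set Wc : ℝ := P ^ 12 * (F.card : ℝ) ^ 10 * F₅ * mx ^ 2 * Hr ^ 12 with hWc
  have hWc0 : 0 ≤ Wc := by positivity
  have hmono : ∀ tm : ℝ, (tm = (T / M ^ 2) ^ 2 * Q ^ 2 * R ^ 6 / N ^ 4 ∨ tm = (T / M ^ 2) ^ 2 * R ^ 8 / N ^ 4 ∨
      tm = (T / M ^ 2) * Q ^ 2 ∨ tm = (T / M ^ 2) ^ 2 * Q ^ 2 * R ^ 2 / N ^ 2) →
      Wc * tm ≤ cstMono * (M ^ 12 / (N ^ 4 * R ^ 2)) := by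
    intro tm htm
    have := family_monomial_le (cP := 66000) (c₁ := 168) (c₂ := 70560) (cF := 19) (cmx := 9) (cH := 15)
      hM hN hR hQ hT h.hrel1 h.hrel2 h.hRN h.hNR h.hT7 hs.le hQR hQ1 h.hMT
      (by norm_num) (by norm_num) (by norm_num) (by norm_num) (by norm_num) (by norm_num)
      hP0 (le_of_eq hP) (Nat.cast_nonneg _) hcnt1 hcnt2 hF₅0 hF₅ hmx0 hmxle hHr0.le hHle tm htm
    rw [hWc]; unfold cstMono; exact this
  have hX : 0 < T / M ^ 2 := by positivity
  calc P ^ 12 * (F.card : ℝ) ^ 10 * F₅ * mx ^ 2 * Hr ^ 12 * B = Wc * B := by rw [hWc]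
    _ ≤ Wc * (9 * (K * ((20000 * 6000000) * ((T / M ^ 2) ^ 2 * Q ^ 2 * R ^ 6 / N ^ 4)
        + 4000000 * ((T / M ^ 2) ^ 2 * R ^ 8 / N ^ 4) + 5 * ((T / M ^ 2) * Q ^ 2)
        + (600 * 6000000) * ((T / M ^ 2) ^ 2 * Q ^ 2 * R ^ 2 / N ^ 2)))) := mul_le_mul_of_nonneg_left hBle hWc0
    _ = 9 * K * ((20000 * 6000000) * (Wc * ((T / M ^ 2) ^ 2 * Q ^ 2 * R ^ 6 / N ^ 4))
        + 4000000 * (Wc * ((T / M ^ 2) ^ 2 * R ^ 8 / N ^ 4)) + 5 * (Wc * ((T / M ^ 2) * Q ^ 2))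
        + (600 * 6000000) * (Wc * ((T / M ^ 2) ^ 2 * Q ^ 2 * R ^ 2 / N ^ 2))) := by ring
    _ ≤ 9 * K * ((20000 * 6000000) * (cstMono * (M ^ 12 / (N ^ 4 * R ^ 2)))
        + 4000000 * (cstMono * (M ^ 12 / (N ^ 4 * R ^ 2))) + 5 * (cstMono * (M ^ 12 / (N ^ 4 * R ^ 2)))
        + (600 * 6000000) * (cstMono * (M ^ 12 / (N ^ 4 * R ^ 2)))) := by
        have h1 := hmono _ (Or.inl rfl)
        have h2 := hmono _ (Or.inr (Or.inl rfl))
        have h3 := hmono _ (Or.inr (Or.inr (Or.inl rfl)))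
        have h4 := hmono _ (Or.inr (Or.inr (Or.inr rfl)))
        have hK9 : 0 ≤ 9 * K := by positivity
        apply mul_le_mul_of_nonneg_left _ hK9
        linarith
    _ = 9 * K * cstGK * cstMono * (M ^ 6 / (N ^ 2 * R)) ^ 2 := by
        unfold cstGK; field_simp

/-! #### `rpow` helpers -/

omit h in
/-- `rpow_five_sixths_pow_twelve`: an auxiliary step of the proof of Bourgain's (3.12) for `F = log`. [folklore] -/
theorem rpow_five_sixths_pow_twelve {x : ℝ} (hx : 0 ≤ x) : (x ^ (5 / 6 : ℝ)) ^ 12 = x ^ 10 := by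
  rw [← Real.rpow_natCast _ 12, ← Real.rpow_mul hx, show ((5 : ℝ) / 6 * ((12 : ℕ) : ℝ)) = ((10 : ℕ) : ℝ) by norm_num,
    Real.rpow_natCast]

omit h in
/-- `rpow_sixth_pow_twelve`: an auxiliary step of the proof of Bourgain's (3.12) for `F = log`. [folklore] -/
theorem rpow_sixth_pow_twelve {x : ℝ} (hx : 0 ≤ x) : (x ^ (1 / 6 : ℝ)) ^ 12 = x ^ 2 := by
  rw [← Real.rpow_natCast _ 12, ← Real.rpow_mul hx, show ((1 : ℝ) / 6 * ((12 : ℕ) : ℝ)) = ((2 : ℕ) : ℝ) by norm_num,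
    Real.rpow_natCast]

omit h in
/-- `rpow_add_sq`: an auxiliary step of the proof of Bourgain's (3.12) for `F = log`. [folklore] -/
theorem rpow_add_sq {x e : ℝ} (hx : 0 < x) : (x ^ (6 + e)) ^ 2 = x ^ 12 * x ^ (2 * e) := by
  rw [← Real.rpow_natCast _ 2, ← Real.rpow_mul hx.le, show ((6 + e) * ((2 : ℕ) : ℝ)) = ((12 : ℕ) : ℝ) + 2 * e by push_cast; ring,
    Real.rpow_add hx, Real.rpow_natCast]

omit h in
/-- `rpow_sq_twelfth`: an auxiliary step of the proof of Bourgain's (3.12) for `F = log`. [folklore] -/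
theorem rpow_sq_twelfth {x : ℝ} (hx : 0 ≤ x) : (x ^ 2) ^ (1 / 12 : ℝ) = x ^ (1 / 6 : ℝ) := by
  rw [← Real.rpow_natCast _ 2, ← Real.rpow_mul hx]; norm_num

omit h in
/-- `le_rpow_twelfth_of_pow_le`: an auxiliary step of the proof of Bourgain's (3.12) for `F = log`. [folklore] -/
theorem le_rpow_twelfth_of_pow_le {a y : ℝ} (ha : 0 ≤ a) (hay : a ^ 12 ≤ y) : a ≤ y ^ (1 / 12 : ℝ) := by
  have hy : 0 ≤ y := le_trans (by positivity) hay
  have h1 : a = (a ^ 12) ^ (1 / 12 : ℝ) := by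
    rw [one_div, show (12 : ℝ) = ((12 : ℕ) : ℝ) by norm_num, Real.pow_rpow_inv_natCast ha (by norm_num)]
  rw [h1]
  exact Real.rpow_le_rpow (by positivity) hay (by norm_num)

/-- **Main terms of a sieve family.** [cite: BourgainJAMS2017, §4 (3.4)–(3.12)] -/
theorem family_main_le {ε C6 K : ℝ} (hε : 0 < ε) (hC60 : 0 ≤ C6) (hC6 : MainBound ε C6) (hK0 : 0 ≤ K)
    (hK : SpacingBound K) (n₁ : ℕ → ℕ) (hn₁ : ∀ k, n₁ k ∈ Finset.Icc L (L + ℓ)) {i j : ℕ} (hi : 2 ≤ i) (hj : 1 ≤ j)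
    (hs : (R : ℝ) ^ 6 < ((2 : ℝ) ^ i) ^ 5 * N) :
    ∑ k ∈ fam T M R L ℓ i j, mtB T (blockStart M ℓ L k) R L (n₁ k) ≤
      6 * (C6 ^ 2 * (9 * K * cstGK * cstMono)) ^ (1 / 12 : ℝ) * Real.log T * T ^ (ε / 6) *
        (M ^ 6 / (N ^ 2 * R)) ^ (1 / 6 : ℝ) := by
  classical
  have hT := h.T_pos; have hM := h.M_pos; have hN := h.N_pos; have hR := h.R_pos
  have hlT := h.log_T_ge
  have hGK : 0 < cstGK := by unfold cstGK; norm_num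
  have hMono : 0 < cstMono := by unfold cstMono; positivity
  set F := fam T M R L ℓ i j with hF
  have hRHS0 : 0 ≤ 6 * (C6 ^ 2 * (9 * K * cstGK * cstMono)) ^ (1 / 12 : ℝ) * Real.log T * T ^ (ε / 6) *
      (M ^ 6 / (N ^ 2 * R)) ^ (1 / 6 : ℝ) := by
    have : 0 ≤ Real.log T := by linarith
    positivity
  rcases F.eq_empty_or_nonempty with hFe | hne
  · rw [hFe, Finset.sum_empty]; exact hRHS0
  obtain ⟨k₀, hk₀⟩ := hne
  obtain ⟨hk₀K, ⟨hq₀1, hq₀2⟩, hH₀, _⟩ := mem_fam.1 hk₀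
  set Q : ℝ := (2 : ℝ) ^ i with hQ'
  have hQ : 0 < Q := by positivity
  set H := Hf T M N i with hH'
  set Hr : ℝ := (H : ℝ) with hHr
  have hH1 := h.one_le_Hf i
  have hHr1 : (1 : ℝ) ≤ Hr := by rw [hHr]; exact_mod_cast hH1
  have hHr0 : 0 < Hr := by linarith
  set κ : ℝ := kappa (muLo T M) Q with hκ
  have hκ0 : 0 < κ := kappa_pos h.muLo_pos hQ
  set X₃ : ℝ := max κ (Hr ^ (-(1 / 2 : ℝ))) with hX₃
  set X₅ : ℝ := 3 / 32 * κ with hX₅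
  set P : ℝ := 66000 * R / Real.sqrt Q with hP
  have hP0 : 0 ≤ P := by positivity
  haveI : ∀ k, NeZero (qOf T (blockStart M ℓ L k) R) := fun k => ⟨(qOf_pos).ne'⟩
  -- Step 1: the family theorem
  have hmain := hC6.bound F (fun k => qOf T (blockStart M ℓ L k) R) (fun k => aOf T (blockStart M ℓ L k) R)
    (fun k => bOf T (blockStart M ℓ L k) R) (fun k => abarOf T (blockStart M ℓ L k) R)
    (fun k => muOf T (blockStart M ℓ L k)) (fun k => sOf T (blockStart M ℓ L k) R) (fun k => lamOf T (blockStart M ℓ L k) R)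
    L n₁ (M0f T M N i) H X₃ X₅ P hH1 (le_max_right _ _) (by positivity) hP0
    (fun k _ => a_mul_abar h.one_le_R)
    (fun k _ => muOf_pos hT (h.blockStart_pos k))
    (fun k _ => abs_q_mul_lamOf_le)
    (fun k hk => by
      have := (h.Nprime_bounds (mem_fam.1 hk).1).1
      linarith [h.hN0, show (2:ℝ) ^ 20 = 1048576 by norm_num])
    (fun k _ => (Finset.mem_Icc.1 (hn₁ k)).1)
    (fun k hk => by
      have hkK := (mem_fam.1 hk).1
      have h1 := h.ell_le_Nprime hkK
      have h2 : (n₁ k : ℝ) ≤ L + ℓ := by exact_mod_cast (Finset.mem_Icc.1 (hn₁ k)).2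
      linarith)
    (fun k hk => (mem_fam.1 hk).2.2.1)
    (fun k hk => h.Hcap (mem_fam.1 hk).1 (mem_fam.1 hk).2.1.2 (hn₁ k))
    (fun k hk => h.M0f_add_one_le (mem_fam.1 hk).1 (mem_fam.1 hk).2.1.1 (mem_fam.1 hk).2.2.1)
    (fun k hk => (h.kappa_block_le (mem_fam.1 hk).1 (mem_fam.1 hk).2.1.1).trans (le_max_left _ _))
    (fun k hk => by
      have := h.kappa_block_le (mem_fam.1 hk).1 (mem_fam.1 hk).2.1.1
      show 3 / 32 * _ ≤ 3 / 32 * κ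
      linarith)
    (fun k hk => h.prefactor_block_le (mem_fam.1 hk).1 (mem_fam.1 hk).2.1.1 (mem_fam.1 hk).2.2.1 hs)
  -- the left-hand sides agree
  have hLHS : ∑ k ∈ F, mtB T (blockStart M ℓ L k) R L (n₁ k) =
      ∑ k ∈ F, ‖mainTerm (qOf T (blockStart M ℓ L k) R) (aOf T (blockStart M ℓ L k) R) (bOf T (blockStart M ℓ L k) R)
        (muOf T (blockStart M ℓ L k)) (sOf T (blockStart M ℓ L k) R) (lamOf T (blockStart M ℓ L k) R) L (n₁ k)‖ := rfl
  rw [hLHS]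
  refine hmain.trans ?_
  -- Step 2: name the factors
  set B : ℝ := (bourgainSecondSpacingCount F
      (fun k => xvec (qOf T (blockStart M ℓ L k) R) (abarOf T (blockStart M ℓ L k) R) (bOf T (blockStart M ℓ L k) R)
        (muOf T (blockStart M ℓ L k)) (sOf T (blockStart M ℓ L k) R) (lamOf T (blockStart M ℓ L k) R)) H 1 : ℝ) with hB
  have hB0 : 0 ≤ B := Nat.cast_nonneg _
  set F₅ : ℝ := 1 + 24 * X₅ / Real.sqrt ((M0f T M N i : ℝ) + 1) with hF₅
  have hF₅0 : 0 ≤ F₅ := by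
    rw [hF₅]; have : 0 ≤ Real.sqrt ((M0f T M N i : ℝ) + 1) := Real.sqrt_nonneg _; positivity
  set mx : ℝ := max 1 (X₃ / Hr ^ (1 / 2 : ℝ)) with hmx
  have hmx0 : 0 ≤ mx := le_trans zero_le_one (le_max_left _ _)
  set stuff : ℝ := C6 * Real.sqrt F₅ * mx * Hr ^ (6 + ε) * Real.sqrt B with hstuff
  have hstuff0 : 0 ≤ stuff := by positivity
  set core : ℝ := (F.card : ℝ) ^ (5 / 6 : ℝ) * stuff ^ (1 / 6 : ℝ) with hcore
  have hcore0 : 0 ≤ core := by positivity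
  -- Step 3: `(P core)¹² = C6² H^{2ε} W`, `W ≤ 9K cstGK cstMono (M⁶/(N²R))²`
  set W : ℝ := P ^ 12 * (F.card : ℝ) ^ 10 * F₅ * mx ^ 2 * Hr ^ 12 * B with hW
  have hWfam := h.family_W_le hK0 hK hi hj hs ⟨k₀, hk₀⟩
  have hWle : W ≤ 9 * K * cstGK * cstMono * (M ^ 6 / (N ^ 2 * R)) ^ 2 := by
    rw [hW]; convert hWfam using 2
  have hpow : (P * core) ^ 12 = C6 ^ 2 * Hr ^ (2 * ε) * W := by
    rw [hW, hcore, mul_pow, mul_pow, rpow_five_sixths_pow_twelve (Nat.cast_nonneg _), rpow_sixth_pow_twelve hstuff0, hstuff]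
    rw [mul_pow, mul_pow, mul_pow, mul_pow, Real.sq_sqrt hF₅0, Real.sq_sqrt hB0, rpow_add_sq hHr0]
    ring
  have hY : (P * core) ^ 12 ≤ C6 ^ 2 * Hr ^ (2 * ε) * (9 * K * cstGK * cstMono * (M ^ 6 / (N ^ 2 * R)) ^ 2) := by
    rw [hpow]; exact mul_le_mul_of_nonneg_left hWle (by positivity)
  have hPc : P * core ≤ (C6 ^ 2 * (9 * K * cstGK * cstMono)) ^ (1 / 12 : ℝ) * Hr ^ (ε / 6) *
      (M ^ 6 / (N ^ 2 * R)) ^ (1 / 6 : ℝ) := by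
    refine (le_rpow_twelfth_of_pow_le (by positivity) hY).trans (le_of_eq ?_)
    have hcst : 0 ≤ 9 * K * cstGK * cstMono := by positivity
    rw [show C6 ^ 2 * Hr ^ (2 * ε) * (9 * K * cstGK * cstMono * (M ^ 6 / (N ^ 2 * R)) ^ 2) =
        (C6 ^ 2 * (9 * K * cstGK * cstMono)) * Hr ^ (2 * ε) * (M ^ 6 / (N ^ 2 * R)) ^ 2 by ring]
    rw [Real.mul_rpow (by positivity) (by positivity), Real.mul_rpow (by positivity) (by positivity),
      rpow_sq_twelfth (by positivity), ← Real.rpow_mul hHr0.le]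
    congr 2; ring
  -- Step 4: logs and `H ≤ T`
  have hHT : Hr ≤ T := h.Hf_le_T hk₀K hq₀1 hq₀2 hH₀
  have hHε : Hr ^ (ε / 6) ≤ T ^ (ε / 6) := Real.rpow_le_rpow hHr0.le hHT (by positivity)
  have hlogH : 2 * (2 + Real.log Hr) ≤ 6 * Real.log T := by
    have := Real.log_le_log hHr0 hHT
    linarith
  have hlogH0 : 0 ≤ 2 * (2 + Real.log Hr) := by
    have := Real.log_nonneg hHr1; linarith
  set Cc : ℝ := (C6 ^ 2 * (9 * K * cstGK * cstMono)) ^ (1 / 12 : ℝ) with hCc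
  have hCc0 : 0 ≤ Cc := by positivity
  have h𝒯 : 0 ≤ (M ^ 6 / (N ^ 2 * R)) ^ (1 / 6 : ℝ) := by positivity
  calc P * (2 * (2 + Real.log Hr) * core) = 2 * (2 + Real.log Hr) * (P * core) := by ring
    _ ≤ 6 * Real.log T * (Cc * Hr ^ (ε / 6) * (M ^ 6 / (N ^ 2 * R)) ^ (1 / 6 : ℝ)) :=
        mul_le_mul hlogH hPc (by positivity) (by positivity)
    _ ≤ 6 * Real.log T * (Cc * T ^ (ε / 6) * (M ^ 6 / (N ^ 2 * R)) ^ (1 / 6 : ℝ)) := by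
        have : 0 ≤ Real.log T := by linarith
        gcongr
    _ = 6 * Cc * Real.log T * T ^ (ε / 6) * (M ^ 6 / (N ^ 2 * R)) ^ (1 / 6 : ℝ) := by ring

end Good


/-- The constant of a family: `6 (C6² · 9K · cstGK · cstMono)^{1/12}`. [folklore] -/
def famConst (C6 K : ℝ) : ℝ := 6 * (C6 ^ 2 * (9 * K * cstGK * cstMono)) ^ (1 / 12 : ℝ)

/-- `famConst_nonneg`: an auxiliary step of the proof of Bourgain's (3.12) for `F = log`. [folklore] -/
theorem famConst_nonneg (C6 : ℝ) {K : ℝ} (hK : 0 ≤ K) : 0 ≤ famConst C6 K := by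
  unfold famConst cstGK cstMono; positivity

namespace Good

variable {T M N : ℝ} {R L ℓ : ℕ} (h : Good T M N R L ℓ)
include h

/-- `r_k ≥ 1` for every block. [folklore] -/
theorem one_le_rOf {k : ℕ} (hk : k < blockCount M ℓ) : 1 ≤ rOf T (blockStart M ℓ L k) R := by
  apply one_le_r h.one_le_R
  have h1 := h.eta_le
  obtain ⟨hm1, hm2⟩ := h.blockStart_bounds hk
  have hM := h.M_pos; have hT := h.T_pos
  have hm : 0 < (blockStart M ℓ L k : ℝ) := lt_of_lt_of_le (by positivity) hm1
  have hx : T / M ^ 2 / 2 ≤ xpt T (blockStart M ℓ L k) := by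
    unfold xpt
    rw [div_div, div_le_div_iff₀ (by positivity) (by positivity)]
    nlinarith [pow_le_pow_left₀ hm.le hm2 2]
  have := h.one_le_T_div_M2
  linarith

/-- `r_k ≤ 24 T²`. [folklore] -/
theorem rOf_le {k : ℕ} (hk : k < blockCount M ℓ) : (rOf T (blockStart M ℓ L k) R : ℝ) ≤ 24 * T ^ 2 := by
  obtain ⟨_, h2⟩ := h.r_div_q_bounds k hk
  have hq := h.q_le k
  have hq0 : (0 : ℝ) < qOf T (blockStart M ℓ L k) R := by exact_mod_cast qOf_pos
  have hR := h.R_pos; have hN := h.N_pos; have hM := h.M_pos; have hT := h.T_pos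
  rw [div_le_iff₀ hq0] at h2
  -- `q ≤ 11 R² ≤ 11 N² ≤ 11 T` and `T/M² ≤ T`
  have hR2 : (R : ℝ) ^ 2 ≤ T := by
    have : (R : ℝ) ^ 2 ≤ N ^ 2 := pow_le_pow_left₀ hR.le h.hRN 2
    nlinarith [h.hNM, h.hMT]
  have hTM : T / M ^ 2 ≤ T := by
    rw [div_le_iff₀ (by positivity)]
    have : (1 : ℝ) ≤ M ^ 2 := by nlinarith [h.N_mul_le_M, h.hN0]
    nlinarith
  have : 214 / 100 * (T / M ^ 2) * (qOf T (blockStart M ℓ L k) R : ℝ) ≤ 214 / 100 * T * (11 * T) := by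
    apply mul_le_mul (by nlinarith) (hq.trans (by nlinarith)) hq0.le (by positivity)
  nlinarith

/-- The number of `r`-classes: `Nat.log 2 ⌊24T²⌋ + 1 ≤ 4 log T`. [folklore] -/
theorem rClassCount_le : ((Nat.log 2 ⌊24 * T ^ 2⌋₊ + 1 : ℕ) : ℝ) ≤ 4 * Real.log T := by
  have hT := h.T_pos; have hlT := h.log_T_ge
  have h24 : (1 : ℝ) ≤ 24 * T ^ 2 := by nlinarith [h.hT0]
  have hfl : (1 : ℝ) ≤ ⌊24 * T ^ 2⌋₊ := by exact_mod_cast Nat.le_floor (by exact_mod_cast h24 : ((1:ℕ):ℝ) ≤ 24 * T ^ 2)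
  have h1 : ((2 ^ Nat.log 2 ⌊24 * T ^ 2⌋₊ : ℕ) : ℝ) ≤ ((⌊24 * T ^ 2⌋₊ : ℕ) : ℝ) := by
    exact_mod_cast Nat.pow_log_le_self 2 (by
      have : 0 < ⌊24 * T ^ 2⌋₊ := by exact_mod_cast (show (0:ℝ) < ⌊24 * T ^ 2⌋₊ by linarith)
      omega)
  have h2 : (Nat.log 2 ⌊24 * T ^ 2⌋₊ : ℝ) * Real.log 2 ≤ Real.log (⌊24 * T ^ 2⌋₊ : ℕ) := by
    have := Real.log_le_log (by positivity) h1
    rw [Nat.cast_pow, Real.log_pow] at this; push_cast at this ⊢; exact this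
  have h3 : Real.log ((⌊24 * T ^ 2⌋₊ : ℕ) : ℝ) ≤ Real.log 24 + 2 * Real.log T := by
    have hle : ((⌊24 * T ^ 2⌋₊ : ℕ) : ℝ) ≤ 24 * T ^ 2 := Nat.floor_le (by positivity)
    have := Real.log_le_log (by linarith) hle
    rw [Real.log_mul (by norm_num) (by positivity), Real.log_pow] at this; push_cast at this; linarith
  have hl2 : (0.6931471803 : ℝ) < Real.log 2 := Real.log_two_gt_d9
  have hl24 : Real.log 24 ≤ 4 := by
    have he : (24 : ℝ) ≤ Real.exp 4 := by
      have h1 := Real.exp_one_gt_d9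
      have h4 : Real.exp 4 = (Real.exp 1) ^ 4 := by rw [← Real.exp_nat_mul]; norm_num
      rw [h4]
      have := pow_le_pow_left₀ (by norm_num) h1.le 4
      nlinarith
    calc Real.log 24 ≤ Real.log (Real.exp 4) := Real.log_le_log (by norm_num) he
      _ = 4 := Real.log_exp 4
  have hlog0 : 0 ≤ (Nat.log 2 ⌊24 * T ^ 2⌋₊ : ℝ) := Nat.cast_nonneg _
  have hx : (Nat.log 2 ⌊24 * T ^ 2⌋₊ : ℝ) * Real.log 2 ≤ 4 + 2 * Real.log T := by linarith
  have hx2 : (Nat.log 2 ⌊24 * T ^ 2⌋₊ : ℝ) * 0.6931471803 ≤ 4 + 2 * Real.log T :=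
    le_trans (mul_le_mul_of_nonneg_left hl2.le hlog0) hx
  push_cast
  nlinarith

/-- For `i ≥ 2` the family with `j = 0` is empty (`r ≥ 2` when `q ≥ 4`). [folklore] -/
theorem fam_zero_eq_empty {i : ℕ} (hi : 2 ≤ i) : fam T M R L ℓ i 0 = ∅ := by
  rw [Finset.eq_empty_iff_forall_notMem]
  intro k hk
  obtain ⟨hkK, ⟨hq1, _⟩, _, ⟨_, hr2⟩⟩ := mem_fam.1 hk
  obtain ⟨h1, _⟩ := h.r_div_q_bounds k hkK
  have hTM := h.one_le_T_div_M2
  have hq4 : (4 : ℝ) ≤ qOf T (blockStart M ℓ L k) R := by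
    have : 2 ^ 2 ≤ qOf T (blockStart M ℓ L k) R := le_trans (Nat.pow_le_pow_right two_pos hi) hq1
    exact_mod_cast this
  have hq0 : (0 : ℝ) < qOf T (blockStart M ℓ L k) R := by linarith
  rw [le_div_iff₀ hq0] at h1
  have hr : (rOf T (blockStart M ℓ L k) R : ℝ) ≤ 1 := by
    have : rOf T (blockStart M ℓ L k) R < 2 := by simpa using hr2
    have : rOf T (blockStart M ℓ L k) R ≤ 1 := by omega
    exact_mod_cast this
  nlinarith

/-- **Main terms of the minor blocks of one class `i`.** [folklore] -/
theorem sum_class_mtB_le {ε C6 K : ℝ} (hε : 0 < ε) (hC60 : 0 ≤ C6) (hC6 : MainBound ε C6) (hK0 : 0 ≤ K)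
    (hK : SpacingBound K) (n₁ : ℕ → ℕ) (hn₁ : ∀ k, n₁ k ∈ Finset.Icc L (L + ℓ)) (i : ℕ) :
    ∑ k ∈ (Finset.range (blockCount M ℓ)).filter (fun k =>
        (2 ^ i ≤ qOf T (blockStart M ℓ L k) R ∧ qOf T (blockStart M ℓ L k) R < 2 ^ (i + 1)) ∧
          1 ≤ H0 T (blockStart M ℓ L k) R L),
      mtB T (blockStart M ℓ L k) R L (n₁ k) ≤
      1100 * (M / Real.sqrt N) + 4 * Real.log T * (famConst C6 K * Real.log T * T ^ (ε / 6) * (M ^ 6 / (N ^ 2 * R)) ^ (1 / 6 : ℝ)) := by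
  classical
  have hT := h.T_pos; have hM := h.M_pos; have hN := h.N_pos; have hR := h.R_pos
  have hlT := h.log_T_ge
  set Φ : ℝ := famConst C6 K * Real.log T * T ^ (ε / 6) * (M ^ 6 / (N ^ 2 * R)) ^ (1 / 6 : ℝ) with hΦ
  have hΦ0 : 0 ≤ Φ := by
    have := famConst_nonneg C6 hK0; have : 0 ≤ Real.log T := by linarith
    positivity
  have hA0 : 0 ≤ 1100 * (M / Real.sqrt N) := by positivity
  have hlT0 : 0 ≤ Real.log T := by linarith
  have hB0 : 0 ≤ 4 * Real.log T * Φ := by positivity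
  set S := (Finset.range (blockCount M ℓ)).filter (fun k =>
        (2 ^ i ≤ qOf T (blockStart M ℓ L k) R ∧ qOf T (blockStart M ℓ L k) R < 2 ^ (i + 1)) ∧
          1 ≤ H0 T (blockStart M ℓ L k) R L) with hS
  rcases le_or_gt (((2 : ℝ) ^ i) ^ 2 * Real.sqrt ((2 : ℝ) ^ i) * Real.sqrt N) ((R : ℝ) ^ 3) with htriv | hsieve
  · -- trivial class
    have := h.sum_triv_class_le htriv n₁ hn₁
    rw [← hS] at this
    linarith
  · -- sieve class: `R⁶ < Q⁵ N` and `i ≥ 2`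
    have hQ : 0 < (2 : ℝ) ^ i := by positivity
    have hs : (R : ℝ) ^ 6 < ((2 : ℝ) ^ i) ^ 5 * N := by
      have h1 : ((R : ℝ) ^ 3) ^ 2 < (((2 : ℝ) ^ i) ^ 2 * Real.sqrt ((2 : ℝ) ^ i) * Real.sqrt N) ^ 2 :=
        pow_lt_pow_left₀ hsieve (by positivity) two_ne_zero
      have e : (((2 : ℝ) ^ i) ^ 2 * Real.sqrt ((2 : ℝ) ^ i) * Real.sqrt N) ^ 2 = ((2 : ℝ) ^ i) ^ 5 * N := by
        rw [mul_pow, mul_pow, Real.sq_sqrt hQ.le, Real.sq_sqrt hN.le]; ring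
      nlinarith
    have hi : 2 ≤ i := by
      by_contra hlt
      have hi1 : i ≤ 1 := by omega
      -- `(2^i)^{5/2} √N ≤ 4 √2 √N ≤ R³` since `R³ ≥ N √N` and `N ≥ 32`
      have hQle : (2 : ℝ) ^ i ≤ 2 := by
        calc (2 : ℝ) ^ i ≤ 2 ^ 1 := pow_le_pow_right₀ (by norm_num) hi1
          _ = 2 := by norm_num
      have hsQ : Real.sqrt ((2 : ℝ) ^ i) ≤ 2 := by
        rw [Real.sqrt_le_left (by norm_num)]; nlinarith
      have hsN := Real.sqrt_nonneg N
      have h1 : ((2 : ℝ) ^ i) ^ 2 * Real.sqrt ((2 : ℝ) ^ i) * Real.sqrt N ≤ 8 * Real.sqrt N := by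
        have : ((2 : ℝ) ^ i) ^ 2 ≤ 4 := by nlinarith
        calc ((2 : ℝ) ^ i) ^ 2 * Real.sqrt ((2 : ℝ) ^ i) * Real.sqrt N ≤ 4 * 2 * Real.sqrt N := by
              gcongr
          _ = 8 * Real.sqrt N := by ring
      -- `R³ ≥ R² √(R²)... ≥ N √N ≥ 8 √N`
      have hR2 : N ≤ (R : ℝ) ^ 2 := h.hNR
      have hRs : Real.sqrt N ≤ R := by
        rw [Real.sqrt_le_left hR.le]; exact hR2
      have h2 : 8 * Real.sqrt N ≤ (R : ℝ) ^ 3 := by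
        have h8 : (8 : ℝ) ≤ N := le_trans (by norm_num) h.hN0
        calc 8 * Real.sqrt N ≤ N * Real.sqrt N := by gcongr
          _ ≤ (R : ℝ) ^ 2 * R := mul_le_mul hR2 hRs hsN (by positivity)
          _ = (R : ℝ) ^ 3 := by ring
      linarith
    -- fiberwise over `j = log₂ r`
    set jmax := Nat.log 2 ⌊24 * T ^ 2⌋₊ with hjmax
    set g : ℕ → ℕ := fun k => Nat.log 2 (rOf T (blockStart M ℓ L k) R).toNat with hg
    have hmaps : ∀ k ∈ S, g k ∈ Finset.range (jmax + 1) := by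
      intro k hk
      rw [hS, Finset.mem_filter, Finset.mem_range] at hk
      rw [Finset.mem_range, Nat.lt_succ_iff, hg, hjmax]
      apply Nat.log_mono_right
      have h1 := h.rOf_le hk.1
      have h2 : ((rOf T (blockStart M ℓ L k) R).toNat : ℝ) ≤ 24 * T ^ 2 := by
        have h0 := h.one_le_rOf hk.1
        have : ((rOf T (blockStart M ℓ L k) R).toNat : ℤ) = rOf T (blockStart M ℓ L k) R := Int.toNat_of_nonneg (by omega)
        have : ((rOf T (blockStart M ℓ L k) R).toNat : ℝ) = (rOf T (blockStart M ℓ L k) R : ℝ) := by exact_mod_cast this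
        rw [this]; exact h1
      exact Nat.le_floor h2
    rw [← Finset.sum_fiberwise_of_maps_to hmaps]
    have hfib : ∀ j ∈ Finset.range (jmax + 1),
        ∑ k ∈ S.filter (fun k => g k = j), mtB T (blockStart M ℓ L k) R L (n₁ k) ≤ Φ := by
      intro j _
      have hsub : S.filter (fun k => g k = j) ⊆ fam T M R L ℓ i j := by
        intro k hk
        rw [Finset.mem_filter, hS, Finset.mem_filter, Finset.mem_range] at hk
        obtain ⟨⟨hkK, hcl, hH⟩, hgk⟩ := hk
        rw [mem_fam]
        refine ⟨hkK, hcl, hH, ?_⟩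
        have h0 := h.one_le_rOf hkK
        have ht : ((rOf T (blockStart M ℓ L k) R).toNat : ℤ) = rOf T (blockStart M ℓ L k) R := Int.toNat_of_nonneg (by omega)
        have hpos : (rOf T (blockStart M ℓ L k) R).toNat ≠ 0 := by omega
        have h1 := Nat.pow_log_le_self 2 hpos
        have h2 := Nat.lt_pow_succ_log_self (b := 2) (by norm_num) (rOf T (blockStart M ℓ L k) R).toNat
        rw [hg] at hgk; simp only at hgk; rw [hgk] at h1 h2
        constructor
        · have : ((2 ^ j : ℕ) : ℤ) ≤ (rOf T (blockStart M ℓ L k) R).toNat := by exact_mod_cast h1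
          push_cast at this; omega
        · have : ((rOf T (blockStart M ℓ L k) R).toNat : ℤ) < ((2 ^ (j + 1) : ℕ) : ℤ) := by exact_mod_cast h2
          push_cast at this; omega
      refine le_trans (Finset.sum_le_sum_of_subset_of_nonneg hsub fun _ _ _ => norm_nonneg _) ?_
      rcases Nat.eq_zero_or_pos j with hj | hj
      · rw [hj, h.fam_zero_eq_empty hi, Finset.sum_empty]; exact hΦ0
      · have := h.family_main_le hε hC60 hC6 hK0 hK n₁ hn₁ hi hj hs
        rw [hΦ]; unfold famConst; linarith
    refine le_trans (Finset.sum_le_sum hfib) ?_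
    rw [Finset.sum_const, Finset.card_range, nsmul_eq_mul]
    have hc := h.rClassCount_le
    rw [← hjmax] at hc
    nlinarith [mul_le_mul_of_nonneg_right hc hΦ0]

/-- **Main terms of all minor blocks.** [folklore] -/
theorem sum_minor_mtB_le {ε C6 K : ℝ} (hε : 0 < ε) (hC60 : 0 ≤ C6) (hC6 : MainBound ε C6) (hK0 : 0 ≤ K)
    (hK : SpacingBound K) (n₁ : ℕ → ℕ) (hn₁ : ∀ k, n₁ k ∈ Finset.Icc L (L + ℓ)) :
    ∑ k ∈ (Finset.range (blockCount M ℓ)).filter (fun k => 1 ≤ H0 T (blockStart M ℓ L k) R L),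
      mtB T (blockStart M ℓ L k) R L (n₁ k) ≤
      4 * Real.log T * (1100 * (M / Real.sqrt N) +
        4 * Real.log T * (famConst C6 K * Real.log T * T ^ (ε / 6) * (M ^ 6 / (N ^ 2 * R)) ^ (1 / 6 : ℝ))) := by
  classical
  have hT := h.T_pos; have hM := h.M_pos; have hN := h.N_pos; have hR := h.R_pos
  have hlT := h.log_T_ge
  set Ψ : ℝ := 1100 * (M / Real.sqrt N) +
        4 * Real.log T * (famConst C6 K * Real.log T * T ^ (ε / 6) * (M ^ 6 / (N ^ 2 * R)) ^ (1 / 6 : ℝ)) with hΨ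
  have hΨ0 : 0 ≤ Ψ := by
    have := famConst_nonneg C6 hK0; have : 0 ≤ Real.log T := by linarith
    positivity
  set S := (Finset.range (blockCount M ℓ)).filter (fun k => 1 ≤ H0 T (blockStart M ℓ L k) R L) with hS
  set imax := Nat.log 2 (11 * R ^ 2) with himax
  set g : ℕ → ℕ := fun k => Nat.log 2 (qOf T (blockStart M ℓ L k) R) with hg
  have hmaps : ∀ k ∈ S, g k ∈ Finset.range (imax + 1) := by
    intro k _
    rw [Finset.mem_range, Nat.lt_succ_iff, hg, himax]
    apply Nat.log_mono_right
    have h1 := h.q_le k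
    exact_mod_cast h1
  rw [← Finset.sum_fiberwise_of_maps_to hmaps]
  have hfib : ∀ i ∈ Finset.range (imax + 1),
      ∑ k ∈ S.filter (fun k => g k = i), mtB T (blockStart M ℓ L k) R L (n₁ k) ≤ Ψ := by
    intro i _
    have hsub : S.filter (fun k => g k = i) ⊆ (Finset.range (blockCount M ℓ)).filter (fun k =>
        (2 ^ i ≤ qOf T (blockStart M ℓ L k) R ∧ qOf T (blockStart M ℓ L k) R < 2 ^ (i + 1)) ∧
          1 ≤ H0 T (blockStart M ℓ L k) R L) := by
      intro k hk
      rw [Finset.mem_filter, hS, Finset.mem_filter] at hk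
      rw [Finset.mem_filter]
      refine ⟨hk.1.1, ⟨?_, ?_⟩, hk.1.2⟩
      · rw [← hk.2, hg]; exact Nat.pow_log_le_self 2 (Nat.pos_iff_ne_zero.1 qOf_pos)
      · rw [← hk.2, hg]; exact Nat.lt_pow_succ_log_self (by norm_num) _
    refine le_trans (Finset.sum_le_sum_of_subset_of_nonneg hsub fun _ _ _ => norm_nonneg _) ?_
    exact h.sum_class_mtB_le hε hC60 hC6 hK0 hK n₁ hn₁ i
  refine le_trans (Finset.sum_le_sum hfib) ?_
  rw [Finset.sum_const, Finset.card_range, nsmul_eq_mul]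
  have hc := h.classCount_le
  rw [← himax] at hc
  nlinarith [mul_le_mul_of_nonneg_right hc hΨ0]

end Good


/-! ### The main terms of a family of minor blocks through the sixth moment -/

/-- The first four coordinates of `x₅` form `xvec`. [folklore] -/
theorem proj4_xvec5 (q : ℕ) (abar b : ℤ) (μ s lam : ℝ) : proj4 (xvec5 q abar b μ s lam) = xvec q abar b μ s lam := by
  funext k; exact xvec5_castSucc q abar b μ s lam k

/-- The coordinates of `x₅` lie in the box `(1/2, 1/2, X₃, X₃, X₅)` as soon as `κ ≤ X₃`, `(3/32)κ ≤ X₅`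
(`|qλ| ≤ 1/2`). [folklore] -/
theorem abs_xvec5_le {q : ℕ} {abar b : ℤ} {μ s lam X₃ X₅ : ℝ} (hμ : 0 < μ) (hq : 0 < q) (hlam : |q * lam| ≤ 1 / 2)
    (hX₃ : kappa μ q ≤ X₃) (hX₅ : 3 / 32 * kappa μ q ≤ X₅) (k : Fin 5) :
    |xvec5 q abar b μ s lam k| ≤ xbound5 X₃ X₅ k := by
  have hκ := (kappa_pos hμ (by exact_mod_cast hq : (0 : ℝ) < q)).le
  have hτ := abs_le.1 hlam
  have hτ2 : (q * lam) ^ 2 ≤ 1 / 4 := by nlinarith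
  fin_cases k
  · exact abs_fr_le _
  · exact abs_fr_le _
  · show |-kappa μ q| ≤ X₃
    rw [abs_neg, abs_of_nonneg hκ]; exact hX₃
  · show |3 / 2 * kappa μ q * (q * lam)| ≤ X₃
    rw [abs_mul, abs_of_nonneg (by positivity)]
    calc 3 / 2 * kappa μ q * |q * lam| ≤ 3 / 2 * kappa μ q * (1 / 2) := by gcongr
      _ ≤ kappa μ q := by linarith
      _ ≤ X₃ := hX₃
  · show |-(3 / 8 * kappa μ q * (q * lam) ^ 2)| ≤ X₅
    rw [abs_neg, abs_of_nonneg (by positivity)]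
    calc 3 / 8 * kappa μ q * (q * lam) ^ 2 ≤ 3 / 8 * kappa μ q * (1 / 4) := by gcongr
      _ = 3 / 32 * kappa μ q := by ring
      _ ≤ X₅ := hX₅

/-- Power-mean / Hölder: `∑_k a_k ≤ (#s)^{5/6} (∑_k a_k⁶)^{1/6}` for `a_k ≥ 0`. [folklore] -/
theorem sum_le_card_rpow_mul_rpow {ι : Type*} (s : Finset ι) {a : ι → ℝ} (ha : ∀ i ∈ s, 0 ≤ a i) :
    ∑ i ∈ s, a i ≤ ((s.card : ℝ)) ^ (5 / 6 : ℝ) * (∑ i ∈ s, a i ^ 6) ^ (1 / 6 : ℝ) := by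
  have hsum0 : 0 ≤ ∑ i ∈ s, a i := Finset.sum_nonneg ha
  have h6 : 0 ≤ ∑ i ∈ s, a i ^ 6 := Finset.sum_nonneg fun i hi => by positivity
  rcases s.eq_empty_or_nonempty with hs | hs
  · simp [hs]
  have hcard : (0 : ℝ) < s.card := by exact_mod_cast hs.card_pos
  have hpm := pow_sum_div_card_le_sum_pow (f := a) (s := s) ha 5
  have hpow : (∑ i ∈ s, a i) ^ 6 ≤ (s.card : ℝ) ^ 5 * ∑ i ∈ s, a i ^ 6 := by
    rw [div_le_iff₀ (by positivity)] at hpm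
    simpa [mul_comm] using hpm
  have hroot : ∑ i ∈ s, a i = (((∑ i ∈ s, a i) ^ 6) : ℝ) ^ (1 / 6 : ℝ) := by
    rw [← Real.rpow_natCast, ← Real.rpow_mul hsum0]; norm_num
  rw [hroot]
  calc (((∑ i ∈ s, a i) ^ 6 : ℝ)) ^ (1 / 6 : ℝ) ≤ ((s.card : ℝ) ^ 5 * ∑ i ∈ s, a i ^ 6) ^ (1 / 6 : ℝ) :=
        Real.rpow_le_rpow (by positivity) hpow (by norm_num)
    _ = ((s.card : ℝ)) ^ (5 / 6 : ℝ) * (∑ i ∈ s, a i ^ 6) ^ (1 / 6 : ℝ) := by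
        have e : ((s.card : ℝ) ^ 5) ^ (1 / 6 : ℝ) = (s.card : ℝ) ^ (5 / 6 : ℝ) := by
          rw [← Real.rpow_natCast _ 5, ← Real.rpow_mul hcard.le]; norm_num
        rw [Real.mul_rpow (pow_nonneg hcard.le 5) h6, e]

/-- **The `θ`-average of a family through a uniform sixth-moment bound.** If `g_k : ℝ → ℝ` are
continuous and nonnegative with `∑_{k∈𝓕} g_k(θ)⁶ ≤ S` for all `θ ∈ [0, 1]`, then
`∑_{k∈𝓕} ∫₀¹ K_L(θ) g_k(θ) dθ ≤ (2 + log L) (#𝓕)^{5/6} S^{1/6}`. [folklore] -/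
theorem sum_integral_cutoff_le {𝓕 : Finset ℕ} {g : ℕ → ℝ → ℝ} (hg : ∀ k, Continuous (g k))
    (hg0 : ∀ k θ, 0 ≤ g k θ) {S : ℝ} (hS : ∀ θ ∈ Set.Icc (0 : ℝ) 1, ∑ k ∈ 𝓕, g k θ ^ 6 ≤ S)
    {L : ℝ} (hL : 1 ≤ L) :
    ∑ k ∈ 𝓕, ∫ θ in (0 : ℝ)..1, cutoffKernel L θ * g k θ ≤
      (2 + Real.log L) * ((𝓕.card : ℝ) ^ (5 / 6 : ℝ) * S ^ (1 / 6 : ℝ)) := by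
  have hL0 : 0 ≤ L := by linarith
  have hiK : IntervalIntegrable (fun θ => cutoffKernel L θ) volume 0 1 := by
    have hi1 : IntervalIntegrable (fun θ : ℝ => min L (1 / (2 * θ))) volume 0 1 :=
      PartialSums.intervalIntegrable_min_inv hL0 le_rfl zero_le_one
    have hi2 : IntervalIntegrable (fun θ : ℝ => min L (1 / (2 * (1 - θ)))) volume 0 1 := by
      have := hi1.comp_sub_left 1
      simp only [sub_zero, sub_self] at this
      exact this.symm
    exact hi1.add hi2
  have hint : ∀ k, IntervalIntegrable (fun θ => cutoffKernel L θ * g k θ) volume 0 1 := fun k =>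
    hiK.mul_continuousOn (hg k).continuousOn
  rw [← intervalIntegral.integral_finsetSum (fun k _ => hint k)]
  set B : ℝ := (𝓕.card : ℝ) ^ (5 / 6 : ℝ) * S ^ (1 / 6 : ℝ) with hB
  have hB0 : 0 ≤ B := by
    have : 0 ≤ S ^ (1 / 6 : ℝ) := Real.rpow_nonneg ((Finset.sum_nonneg fun k _ => by positivity : (0:ℝ) ≤
      ∑ k ∈ 𝓕, g k 0 ^ 6).trans (hS 0 (by simp))) _
    positivity
  have hpt : ∀ θ ∈ Set.Icc (0 : ℝ) 1, ∑ k ∈ 𝓕, cutoffKernel L θ * g k θ ≤ cutoffKernel L θ * B := by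
    intro θ hθ
    rw [← Finset.mul_sum]
    refine mul_le_mul_of_nonneg_left ?_ (PartialSums.cutoffKernel_nonneg (by linarith) hθ.1 hθ.2)
    refine (sum_le_card_rpow_mul_rpow 𝓕 fun k _ => hg0 k θ).trans ?_
    rw [hB]
    exact mul_le_mul_of_nonneg_left (Real.rpow_le_rpow (Finset.sum_nonneg fun k _ => by positivity)
      (hS θ hθ) (by norm_num)) (by positivity)
  calc ∫ θ in (0 : ℝ)..1, ∑ k ∈ 𝓕, cutoffKernel L θ * g k θ
      ≤ ∫ θ in (0 : ℝ)..1, cutoffKernel L θ * B := by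
        refine intervalIntegral.integral_mono_on zero_le_one ?_ (hiK.mul_const _) hpt
        have : (fun θ => ∑ k ∈ 𝓕, cutoffKernel L θ * g k θ) = fun θ => cutoffKernel L θ * ∑ k ∈ 𝓕, g k θ := by
          funext θ; rw [Finset.mul_sum]
        rw [this]
        exact hiK.mul_continuousOn (continuous_finsetSum _ fun k _ => hg k).continuousOn
    _ = (∫ θ in (0 : ℝ)..1, cutoffKernel L θ) * B := by
        rw [intervalIntegral.integral_mul_const]
    _ ≤ (2 + Real.log L) * B := mul_le_mul_of_nonneg_right (PartialSums.integral_cutoffKernel_le hL) hB0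

/-- `θ ↦ ‖hsum5From M₀ H (ε e(-θ)) x‖` is continuous. [folklore] -/
theorem continuous_norm_hsum5From (M₀ H : ℕ) (ε : ℂ) (x : Fin 5 → ℝ) :
    Continuous fun θ : ℝ => ‖hsum5From M₀ H (ε * Complex.exp (-(2 * π * I * θ))) x‖ := by
  unfold hsum5From
  fun_prop

/-- **Main terms of a family of minor blocks.** Assume Corollary 3 (`hC3`). For every `ε > 0` there is
`C` such that for every finite family of minor blocks with common `L`, window parameters `M₀, H` and
box sizes `X₃ ≥ max(κ_k, H^{-1/2})`, `X₅ ≥ (3/32)κ_k`, and a common bound `P` for the prefactors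
`2(1 + 5κ_k H₀(k)^{-3/2})(μ_k q_k N'_k)^{-1/2}`,
`∑_k ‖MT_k‖ ≤ P · 2(2 + log H) (#𝓕)^{5/6} (C (1 + 24X₅(M₀+1)^{-1/2})^{1/2} max(1, X₃H^{-1/2}) H^{6+ε} B^{1/2})^{1/6}`,
`B = bourgainSecondSpacingCount 𝓕 (xvec ∘ data) H 1` (Bourgain's (3.4) + Hölder + (3.8)/(3.10)).
[cite: BourgainJAMS2017, §4 (3.4)–(3.10)] -/
theorem sum_norm_mainTerm_le
    (hC3 : ∀ ε : ℝ, 0 < ε → ∃ C : ℝ, ∀ N : ℕ, 1 ≤ N → ∀ δ Δ : ℝ,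
      1 / (N : ℝ) ^ 2 ≤ δ → δ ≤ 1 → 1 / (N : ℝ) ≤ Δ → Δ ≤ 1 →
        bourgainA6 N δ Δ ≤ C * δ * Δ * (N : ℝ) ^ (9 + ε))
    {ε : ℝ} (hε : 0 < ε) :
    ∃ C : ℝ, 0 ≤ C ∧ ∀ (𝓕 : Finset ℕ) (q : ℕ → ℕ) [∀ k, NeZero (q k)] (a b abar : ℕ → ℤ) (μ s lam : ℕ → ℝ)
      (L : ℕ) (n₁ : ℕ → ℕ) (M₀ H : ℕ) (X₃ X₅ P : ℝ),
      1 ≤ H → (H : ℝ) ^ (-(1 / 2 : ℝ)) ≤ X₃ → 0 < X₅ → 0 ≤ P →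
      (∀ k ∈ 𝓕, ((a k : ℤ) : ZMod (q k)) * ((abar k : ℤ) : ZMod (q k)) = 1) →
      (∀ k ∈ 𝓕, 0 < μ k) → (∀ k ∈ 𝓕, |q k * lam k| ≤ 1 / 2) → (∀ k ∈ 𝓕, 1 ≤ (L : ℝ) + s k) →
      (∀ k ∈ 𝓕, L ≤ n₁ k) → (∀ k ∈ 𝓕, (n₁ k : ℝ) + s k ≤ 2 * (L + s k)) →
      (∀ k ∈ 𝓕, 1 ≤ μ k * q k * (L + s k) ^ 2) →
      (∀ k ∈ 𝓕, q k * lam k + 3 * μ k * q k * (n₁ k + s k) ^ 2 ≤ H) →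
      (∀ k ∈ 𝓕, (M₀ : ℝ) + 1 ≤ q k * lam k + 3 * μ k * q k * (L + s k) ^ 2) →
      (∀ k ∈ 𝓕, kappa (μ k) (q k) ≤ X₃) → (∀ k ∈ 𝓕, 3 / 32 * kappa (μ k) (q k) ≤ X₅) →
      (∀ k ∈ 𝓕, 2 * (1 + 5 * kappa (μ k) (q k) / (μ k * q k * (L + s k) ^ 2 * Real.sqrt (μ k * q k * (L + s k) ^ 2)))
        / Real.sqrt (μ k * q k * (L + s k)) ≤ P) →
      ∑ k ∈ 𝓕, ‖mainTerm (q k) (a k) (b k) (μ k) (s k) (lam k) L (n₁ k)‖ ≤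
        P * (2 * (2 + Real.log H) * ((𝓕.card : ℝ) ^ (5 / 6 : ℝ) *
          (C * Real.sqrt (1 + 24 * X₅ / Real.sqrt ((M₀ : ℝ) + 1)) * max 1 (X₃ / (H : ℝ) ^ (1 / 2 : ℝ)) *
            (H : ℝ) ^ (6 + ε) *
            Real.sqrt (bourgainSecondSpacingCount 𝓕
              (fun k => xvec (q k) (abar k) (b k) (μ k) (s k) (lam k)) H 1)) ^ (1 / 6 : ℝ))) := by
  obtain ⟨C, hC⟩ := sixthMoment5From_of_corollary3 hC3 hε
  refine ⟨max C 0, le_max_right _ _, ?_⟩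
  intro 𝓕 q _ a b abar μ s lam L n₁ M₀ H X₃ X₅ P hH hX₃ hX₅ hP hab hμ hlam hN' hn₁ hN₁' hH₀ hHcap hM₀ hκ₃ hκ₅ hPk
  set x5 : ℕ → Fin 5 → ℝ := fun k => xvec5 (q k) (abar k) (b k) (μ k) (s k) (lam k) with hx5
  -- Step 1: per-block `‖MT_k‖ ≤ P (I⁵₁ + I⁵₋₁)`
  have hblock : ∀ k ∈ 𝓕, ‖mainTerm (q k) (a k) (b k) (μ k) (s k) (lam k) L (n₁ k)‖ ≤
      P * (thetaIntegral5 M₀ H 1 (x5 k) + thetaIntegral5 M₀ H (-1) (x5 k)) := by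
    intro k hk
    have h := norm_mainTerm5_le (b := b k) (hab k hk) (hμ k hk) (hlam k hk) (hN' k hk) (hn₁ k hk) (hN₁' k hk) (hH₀ k hk)
      (hHcap k hk) (hM₀ k hk)
    have hI : 0 ≤ thetaIntegral5 M₀ H 1 (x5 k) + thetaIntegral5 M₀ H (-1) (x5 k) :=
      add_nonneg (thetaIntegral5_nonneg _ _ _ _) (thetaIntegral5_nonneg _ _ _ _)
    exact h.trans (mul_le_mul_of_nonneg_right (hPk k hk) hI)
  -- Step 2: the uniform sixth moment bound for `θ ↦ hsum5From M₀ H (ε e(-θ)) (x5 k)`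
  have hxb : ∀ k ∈ 𝓕, ∀ j, |x5 k j| ≤ xbound5 X₃ X₅ j := fun k hk j =>
    abs_xvec5_le (hμ k hk) (Nat.pos_of_ne_zero (NeZero.ne _)) (hlam k hk) (hκ₃ k hk) (hκ₅ k hk) j
  set S : ℝ := max C 0 * Real.sqrt (1 + 24 * X₅ / Real.sqrt ((M₀ : ℝ) + 1)) * max 1 (X₃ / (H : ℝ) ^ (1 / 2 : ℝ)) *
      (H : ℝ) ^ (6 + ε) * Real.sqrt (bourgainSecondSpacingCount 𝓕 (fun k => proj4 (x5 k)) H 1) with hSdef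
  have hS6 : ∀ ε' : ℂ, ‖ε'‖ ≤ 1 → ∀ θ : ℝ, ∑ k ∈ 𝓕, ‖hsum5From M₀ H (ε' * Complex.exp (-(2 * π * I * θ))) (x5 k)‖ ^ 6 ≤ S := by
    intro ε' hε' θ
    have hα : ‖ε' * Complex.exp (-(2 * π * I * θ))‖ ≤ 1 := by
      rw [norm_mul, show (-(2 * π * I * θ) : ℂ) = ((-(2 * π * θ)) : ℝ) * I by push_cast; ring,
        Complex.norm_exp_ofReal_mul_I, mul_one]
      exact hε'
    have h := hC H hH M₀ X₃ hX₃ X₅ hX₅ 1 le_rfl 𝓕 x5 hxb _ hα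
    rw [one_mul] at h
    refine h.trans ?_
    rw [hSdef]
    have h1 : 0 ≤ Real.sqrt (1 + 24 * X₅ / Real.sqrt ((M₀ : ℝ) + 1)) * max 1 (X₃ / (H : ℝ) ^ (1 / 2 : ℝ)) *
        (H : ℝ) ^ (6 + ε) * Real.sqrt (bourgainSecondSpacingCount 𝓕 (fun k => proj4 (x5 k)) H 1) := by
      have : 0 ≤ max 1 (X₃ / (H : ℝ) ^ (1 / 2 : ℝ)) := le_trans zero_le_one (le_max_left _ _)
      positivity
    calc C * Real.sqrt (1 + 24 * X₅ / Real.sqrt ((M₀ : ℝ) + 1)) * max 1 (X₃ / (H : ℝ) ^ (1 / 2 : ℝ)) *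
          (H : ℝ) ^ (6 + ε) * Real.sqrt (bourgainSecondSpacingCount 𝓕 (fun k => proj4 (x5 k)) H 1)
        = C * (Real.sqrt (1 + 24 * X₅ / Real.sqrt ((M₀ : ℝ) + 1)) * max 1 (X₃ / (H : ℝ) ^ (1 / 2 : ℝ)) *
          (H : ℝ) ^ (6 + ε) * Real.sqrt (bourgainSecondSpacingCount 𝓕 (fun k => proj4 (x5 k)) H 1)) := by ring
      _ ≤ max C 0 * (Real.sqrt (1 + 24 * X₅ / Real.sqrt ((M₀ : ℝ) + 1)) * max 1 (X₃ / (H : ℝ) ^ (1 / 2 : ℝ)) *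
          (H : ℝ) ^ (6 + ε) * Real.sqrt (bourgainSecondSpacingCount 𝓕 (fun k => proj4 (x5 k)) H 1)) :=
          mul_le_mul_of_nonneg_right (le_max_left _ _) h1
      _ = _ := by ring
  -- Step 3: the `θ`-average
  have hH1 : (1 : ℝ) ≤ H := by exact_mod_cast hH
  have hθ : ∀ ε' : ℂ, ‖ε'‖ ≤ 1 → ∑ k ∈ 𝓕, thetaIntegral5 M₀ H ε' (x5 k) ≤
      (2 + Real.log H) * ((𝓕.card : ℝ) ^ (5 / 6 : ℝ) * S ^ (1 / 6 : ℝ)) := by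
    intro ε' hε'
    have := sum_integral_cutoff_le (𝓕 := 𝓕)
      (g := fun k θ => ‖hsum5From M₀ H (ε' * Complex.exp (-(2 * π * I * θ))) (x5 k)‖)
      (fun k => continuous_norm_hsum5From M₀ H ε' (x5 k)) (fun k θ => norm_nonneg _)
      (S := S) (fun θ _ => hS6 ε' hε' θ) hH1
    simpa [thetaIntegral5] using this
  -- Step 4: assemble
  have hproj : (fun k => proj4 (x5 k)) = fun k => xvec (q k) (abar k) (b k) (μ k) (s k) (lam k) := by
    funext k; simp only [hx5, proj4_xvec5]
  calc ∑ k ∈ 𝓕, ‖mainTerm (q k) (a k) (b k) (μ k) (s k) (lam k) L (n₁ k)‖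
      ≤ ∑ k ∈ 𝓕, P * (thetaIntegral5 M₀ H 1 (x5 k) + thetaIntegral5 M₀ H (-1) (x5 k)) := Finset.sum_le_sum hblock
    _ = P * (∑ k ∈ 𝓕, thetaIntegral5 M₀ H 1 (x5 k) + ∑ k ∈ 𝓕, thetaIntegral5 M₀ H (-1) (x5 k)) := by
        rw [← Finset.mul_sum, Finset.sum_add_distrib]
    _ ≤ P * ((2 + Real.log H) * ((𝓕.card : ℝ) ^ (5 / 6 : ℝ) * S ^ (1 / 6 : ℝ)) +
          (2 + Real.log H) * ((𝓕.card : ℝ) ^ (5 / 6 : ℝ) * S ^ (1 / 6 : ℝ))) := by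
        gcongr
        · exact hθ 1 (by simp)
        · exact hθ (-1) (by simp)
    _ = _ := by rw [hSdef, hproj]; ring



namespace Good

variable {T M N : ℝ} {R L ℓ : ℕ} (h : Good T M N R L ℓ)
include h

/-- `M/√N ≤ (M⁶/(N²R))^{1/6}` (since `R ≤ N`). [folklore] -/
theorem M_div_sqrtN_le_scale : M / Real.sqrt N ≤ (M ^ 6 / (N ^ 2 * R)) ^ (1 / 6 : ℝ) := by
  have hN := h.N_pos; have hM := h.M_pos; have hR := h.R_pos
  have hsN := Real.sqrt_pos.2 hN
  have ha : 0 ≤ M / Real.sqrt N := by positivity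
  have h6 : (M / Real.sqrt N) ^ 6 ≤ M ^ 6 / (N ^ 2 * R) := by
    rw [div_pow, show Real.sqrt N ^ 6 = (Real.sqrt N ^ 2) ^ 3 by ring, Real.sq_sqrt hN.le]
    apply div_le_div_of_nonneg_left (by positivity) (by positivity)
    calc N ^ 2 * (R : ℝ) ≤ N ^ 2 * N := by gcongr; exact h.hRN
      _ = N ^ 3 := by ring
  have e : M / Real.sqrt N = ((M / Real.sqrt N) ^ 6) ^ (1 / 6 : ℝ) := by
    rw [one_div, show (6 : ℝ) = ((6 : ℕ) : ℝ) by norm_num, Real.pow_rpow_inv_natCast ha (by norm_num)]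
  rw [e]
  exact Real.rpow_le_rpow (by positivity) h6 (by norm_num)

/-- `ℓ ≤ M/√N`. [folklore] -/
theorem ell_le_M_div_sqrtN : (ℓ : ℝ) ≤ M / Real.sqrt N := by
  have hN := h.N_pos; have hM := h.M_pos
  have hsN := Real.sqrt_pos.2 hN
  obtain ⟨_, hl⟩ := h.ell_bounds
  rw [le_div_iff₀ hsN]
  -- `ℓ √N ≤ (N/16) √N ≤ N²/16 ≤ M` (using `√N ≤ N`, `N² ≤ M`)
  have h1 : Real.sqrt N ≤ N := by rw [Real.sqrt_le_left hN.le]; nlinarith [h.hN0]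
  have h2 := h.N2_le_M
  have hl0 : (0 : ℝ) ≤ ℓ := Nat.cast_nonneg _
  calc (ℓ : ℝ) * Real.sqrt N ≤ (N / 16) * N := mul_le_mul hl h1 (Real.sqrt_nonneg _) (by positivity)
    _ ≤ M := by nlinarith

set_option maxHeartbeats 1000000 in
/-- **The bound for `S` in the regime `Good`:**
`‖S‖ ≤ (5·10¹² + 300 famConst) (log T)³ T^{ε/6} (M⁶/(N²R))^{1/6}`. [cite: BourgainJAMS2017, §4 (3.12)] -/
theorem norm_S_le {ε C6 K : ℝ} (hε : 0 < ε) (hC60 : 0 ≤ C6) (hC6 : MainBound ε C6) (hK0 : 0 ≤ K)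
    (hK : SpacingBound K) :
    ‖bourgainSum Real.log T M‖ ≤
      (5000000000000 + 300 * famConst C6 K) * Real.log T ^ 3 * T ^ (ε / 6) * (M ^ 6 / (N ^ 2 * R)) ^ (1 / 6 : ℝ) := by
  classical
  have hT := h.T_pos; have hM := h.M_pos; have hN := h.N_pos; have hR := h.R_pos
  have hlT := h.log_T_ge
  obtain ⟨n₁, hn₁, hS⟩ := h.norm_S_le_cubic
  set 𝒯 : ℝ := (M ^ 6 / (N ^ 2 * R)) ^ (1 / 6 : ℝ) with h𝒯
  set Lg : ℝ := Real.log T with hLg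
  set Tε : ℝ := T ^ (ε / 6) with hTε
  set Y : ℝ := M / Real.sqrt N with hY
  set Fc : ℝ := famConst C6 K with hFc
  have hY0 : 0 ≤ Y := by positivity
  have hY𝒯 : Y ≤ 𝒯 := h.M_div_sqrtN_le_scale
  have h𝒯0 : 0 ≤ 𝒯 := hY0.trans hY𝒯
  have hL1 : 1 ≤ Lg := by linarith
  have hTε1 : 1 ≤ Tε := Real.one_le_rpow (by linarith [h.hT0]) (by positivity)
  have hFc0 : 0 ≤ Fc := famConst_nonneg C6 hK0
  -- split the sum over blocks into major and minor blocks
  set Kset := Finset.range (blockCount M ℓ) with hKset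
  have hsplit : ∑ k ∈ Kset, cubicB T (blockStart M ℓ L k) R L (n₁ k) ≤
      ∑ k ∈ Kset.filter (fun k => H0 T (blockStart M ℓ L k) R L < 1), errMaj T (blockStart M ℓ L k) R L ℓ +
      (∑ k ∈ Kset, errMin T (blockStart M ℓ L k) R L +
        ∑ k ∈ Kset.filter (fun k => 1 ≤ H0 T (blockStart M ℓ L k) R L), mtB T (blockStart M ℓ L k) R L (n₁ k)) := by
    rw [← Finset.sum_filter_add_sum_filter_not Kset (fun k => H0 T (blockStart M ℓ L k) R L < 1)]
    apply add_le_add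
    · refine Finset.sum_le_sum fun k hk => ?_
      rw [Finset.mem_filter, hKset, Finset.mem_range] at hk
      exact h.cubicB_le_major hk.1 (hn₁ k)
    · have hnot : Kset.filter (fun k => ¬ H0 T (blockStart M ℓ L k) R L < 1) =
          Kset.filter (fun k => 1 ≤ H0 T (blockStart M ℓ L k) R L) := by
        apply Finset.filter_congr; intro k _; exact not_lt
      rw [hnot]
      calc ∑ k ∈ Kset.filter (fun k => 1 ≤ H0 T (blockStart M ℓ L k) R L), cubicB T (blockStart M ℓ L k) R L (n₁ k)
          ≤ ∑ k ∈ Kset.filter (fun k => 1 ≤ H0 T (blockStart M ℓ L k) R L),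
              (errMin T (blockStart M ℓ L k) R L + mtB T (blockStart M ℓ L k) R L (n₁ k)) := by
            refine Finset.sum_le_sum fun k hk => ?_
            rw [Finset.mem_filter, hKset, Finset.mem_range] at hk
            exact h.cubicB_le_minor hk.1 (hn₁ k) hk.2
        _ = ∑ k ∈ Kset.filter (fun k => 1 ≤ H0 T (blockStart M ℓ L k) R L), errMin T (blockStart M ℓ L k) R L +
            ∑ k ∈ Kset.filter (fun k => 1 ≤ H0 T (blockStart M ℓ L k) R L), mtB T (blockStart M ℓ L k) R L (n₁ k) :=
            Finset.sum_add_distrib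
        _ ≤ _ := by
            refine add_le_add ?_ le_rfl
            apply Finset.sum_le_sum_of_subset_of_nonneg (Finset.filter_subset _ _)
            intro k hk _
            rw [hKset, Finset.mem_range] at hk
            exact h.errMin_nonneg hk
  have hmaj := h.sum_major_le
  have hmin := h.sum_errMin_le
  have hmt := h.sum_minor_mtB_le hε hC60 hC6 hK0 hK n₁ hn₁
  rw [← hKset] at hmaj hmin hmt
  rw [← hLg, ← hY] at hmaj hmin
  rw [← hLg, ← hY, ← hTε, ← h𝒯, ← hFc] at hmt
  have hell := h.ell_le_M_div_sqrtN
  -- compare everything with `Z = Lg³ Tε 𝒯`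
  set Z : ℝ := Lg ^ 3 * Tε * 𝒯 with hZ
  have hZ0 : 0 ≤ Z := by positivity
  have hL2 : Lg ≤ Lg ^ 2 := by nlinarith
  have hL3 : Lg ≤ Lg ^ 3 := by nlinarith
  have hL23 : Lg ^ 2 ≤ Lg ^ 3 := by nlinarith
  have hY' : Y ≤ Tε * 𝒯 := by nlinarith
  have h1 : Lg * Y ≤ Z := by
    rw [hZ]; calc Lg * Y ≤ Lg ^ 3 * (Tε * 𝒯) := mul_le_mul hL3 hY' hY0 (by positivity)
      _ = Lg ^ 3 * Tε * 𝒯 := by ring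
  have h2 : Lg ^ 2 * Y ≤ Z := by
    rw [hZ]; calc Lg ^ 2 * Y ≤ Lg ^ 3 * (Tε * 𝒯) := mul_le_mul hL23 hY' hY0 (by positivity)
      _ = Lg ^ 3 * Tε * 𝒯 := by ring
  have h3 : Y ≤ Z := by
    rw [hZ]; calc Y ≤ 1 * (Tε * 𝒯) := by rw [one_mul]; exact hY'
      _ ≤ Lg ^ 3 * (Tε * 𝒯) := by apply mul_le_mul_of_nonneg_right (by nlinarith) (by positivity)
      _ = Lg ^ 3 * Tε * 𝒯 := by ring
  -- assemble
  have hsum : ∑ k ∈ Kset, cubicB T (blockStart M ℓ L k) R L (n₁ k) ≤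
      2000000000000 * Z + (5000000000 * Z + (4400 * Z + 16 * Fc * Z)) := by
    refine hsplit.trans (add_le_add (hmaj.trans (by linarith [h1])) (add_le_add (hmin.trans (by linarith [h2])) (hmt.trans ?_)))
    have e : 4 * Lg * (1100 * Y + 4 * Lg * (Fc * Lg * Tε * 𝒯)) = 4400 * (Lg * Y) + 16 * Fc * Z := by rw [hZ]; ring
    rw [e]; linarith [h1]
  have hFZ : 0 ≤ Fc * Z := mul_nonneg hFc0 hZ0
  calc ‖bourgainSum Real.log T M‖ ≤ 2 * ∑ k ∈ Kset, cubicB T (blockStart M ℓ L k) R L (n₁ k) + ℓ := hS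
    _ ≤ 2 * (2000000000000 * Z + (5000000000 * Z + (4400 * Z + 16 * Fc * Z))) + Z := by
        have := hell.trans h3; linarith
    _ ≤ (5000000000000 + 300 * Fc) * Z := by linarith
    _ = (5000000000000 + 300 * Fc) * Lg ^ 3 * Tε * 𝒯 := by rw [hZ]; ring

end Good

/-! ### The final theorem: (3.12)–(3.13) of Bourgain for `F = log`, `c = 1` -/

set_option maxHeartbeats 1000000 in
/-- **Bourgain's (3.13) for `F = log` (with `c = 1`) from Corollary 3:** for every `ε > 0` there are
`C, T₀` with `|S|⁶ ≤ C M^{6+ε} N⁻³ (N/R)` whenever `T ≥ T₀`, `M ≤ T^{1/2}`, `N = M T^{-2/7} ∈ (1, M)`,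
`R = ⌈(2M³/(NT))^{1/2}⌉ ∈ [N^{1/2}, N]`. This is the hypothesis `h312` of
`Bourgain2017_eq313_log_of_eq312`. [cite: BourgainJAMS2017, §4 (3.4)–(3.13)] -/
theorem eq312_log_of_corollary3
    (hC3 : ∀ ε : ℝ, 0 < ε → ∃ C : ℝ, ∀ N : ℕ, 1 ≤ N → ∀ δ Δ : ℝ,
      1 / (N : ℝ) ^ 2 ≤ δ → δ ≤ 1 → 1 / (N : ℝ) ≤ Δ → Δ ≤ 1 →
        bourgainA6 N δ Δ ≤ C * δ * Δ * (N : ℝ) ^ (9 + ε)) :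
    ∀ ε : ℝ, 0 < ε → ∃ C T₀ : ℝ, ∀ T M N : ℝ, T₀ ≤ T → M ≤ Real.sqrt T →
      N = M * T ^ (-(2 / 7) : ℝ) → 1 < N → N < M →
      (bourgainR 1 M N T : ℝ) ≤ N → N ≤ (bourgainR 1 M N T : ℝ) ^ 2 →
        ‖bourgainSum Real.log T M‖ ^ 6 ≤
          C * (M ^ (6 + ε) / N ^ 3 * (N / (bourgainR 1 M N T : ℝ))) := by
  intro ε' hε'
  -- the constants
  have hε : 0 < ε' / 6 := by positivity
  obtain ⟨C6, hC60, hC6⟩ := sum_norm_mainTerm_le hC3 hε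
  obtain ⟨K, hKpos, hK⟩ := SecondSpacingLog.secondSpacingCount_le
  have hK0 : 0 ≤ K := hKpos.le
  have hC6' : MainBound (ε' / 6) C6 := ⟨hC6⟩
  have hK' : SpacingBound K := ⟨@hK⟩
  set Ctot : ℝ := 5000000000000 + 300 * famConst C6 K with hCtot
  have hCtot0 : 0 ≤ Ctot := by have := famConst_nonneg C6 hK0; positivity
  set δ : ℝ := ε' / 108 with hδ
  have hδ0 : 0 < δ := by positivity
  set Cbig : ℝ := Ctot ^ 6 * ((1 / δ) ^ 18 * (2 : ℝ) ^ (7 * ε' / 3)) with hCbig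
  have hCbig0 : 0 ≤ Cbig := by positivity
  refine ⟨max (64 * 2 ^ 60) Cbig, 2 ^ 70, ?_⟩
  intro T M N hT0 hMT hNdef h1N hNM hRN hNR
  set R := bourgainR 1 M N T with hRdef
  have hT : 0 < T := lt_of_lt_of_le (by norm_num) hT0
  have hN : 0 < N := by linarith
  have hM : 0 < M := by linarith
  have hR1 : (1 : ℝ) < (R : ℝ) ^ 2 := lt_of_lt_of_le h1N hNR
  have hRpos : (0 : ℝ) < R := by
    have : (R : ℝ) ≠ 0 := by intro h0; rw [h0] at hR1; norm_num at hR1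
    have h0 : (0 : ℝ) ≤ R := Nat.cast_nonneg _
    exact lt_of_le_of_ne h0 (Ne.symm this)
  have hM1 : 1 ≤ M := by linarith
  -- the target is monotone in the constant
  have hRHS0 : 0 ≤ M ^ (6 + ε') / N ^ 3 * (N / R) := by positivity
  have hmono : ∀ {C : ℝ}, ‖bourgainSum Real.log T M‖ ^ 6 ≤ C * (M ^ (6 + ε') / N ^ 3 * (N / R)) →
      C ≤ max (64 * 2 ^ 60) Cbig →
      ‖bourgainSum Real.log T M‖ ^ 6 ≤ max (64 * 2 ^ 60) Cbig * (M ^ (6 + ε') / N ^ 3 * (N / R)) :=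
    fun h1 h2 => h1.trans (mul_le_mul_of_nonneg_right h2 hRHS0)
  -- `M^{6+ε'} ≥ M⁶` and `N/R ≥ 1`
  have hM6 : M ^ 6 ≤ M ^ (6 + ε') := by
    calc M ^ 6 = M ^ ((6 : ℕ) : ℝ) := (Real.rpow_natCast M 6).symm
      _ ≤ M ^ (6 + ε') := Real.rpow_le_rpow_of_exponent_le hM1 (by push_cast; linarith)
  have hNR1 : 1 ≤ N / R := by rw [le_div_iff₀ hRpos]; linarith
  by_cases hN20 : (2 : ℝ) ^ 20 ≤ N
  swap
  · -- small `N`: trivial bound `‖S‖ ≤ 2M`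
    rw [not_le] at hN20
    refine hmono ?_ (le_max_left _ _)
    have hS : ‖bourgainSum Real.log T M‖ ≤ 2 * M := by
      rw [bourgainSum]
      refine (norm_sum_le _ _).trans ?_
      have : ∀ m ∈ Finset.Icc ⌈M / 2⌉₊ ⌊M⌋₊,
          ‖Complex.exp (2 * ↑π * Complex.I * ↑(T * Real.log ((m : ℝ) / M)))‖ ≤ 1 := by
        intro m _
        rw [show (2 * ↑π * Complex.I * ↑(T * Real.log ((m : ℝ) / M)) : ℂ) =
          ((2 * π * (T * Real.log ((m : ℝ) / M)) : ℝ) : ℂ) * Complex.I by push_cast; ring, Complex.norm_exp_ofReal_mul_I]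
      refine (Finset.sum_le_sum this).trans ?_
      rw [Finset.sum_const, nsmul_eq_mul, mul_one, Nat.card_Icc]
      have h1 : ((⌊M⌋₊ + 1 - ⌈M / 2⌉₊ : ℕ) : ℝ) ≤ ((⌊M⌋₊ + 1 : ℕ) : ℝ) := by exact_mod_cast Nat.sub_le _ _
      have h2 : (⌊M⌋₊ : ℝ) ≤ M := Nat.floor_le hM.le
      push_cast at h1; linarith
    have h6 : ‖bourgainSum Real.log T M‖ ^ 6 ≤ (2 * M) ^ 6 := pow_le_pow_left₀ (norm_nonneg _) hS 6
    refine h6.trans ?_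
    -- `(2M)⁶ = 64 M⁶ ≤ 64 · 2⁶⁰ · M^{6+ε'}/N³ · (N/R)` since `N³ < 2⁶⁰`
    have hN3 : N ^ 3 < 2 ^ 60 := by
      calc N ^ 3 < ((2 : ℝ) ^ 20) ^ 3 := pow_lt_pow_left₀ hN20 hN.le (by norm_num)
        _ = 2 ^ 60 := by norm_num
    have : M ^ 6 ≤ 2 ^ 60 * (M ^ (6 + ε') / N ^ 3 * (N / R)) := by
      rw [show (2 : ℝ) ^ 60 * (M ^ (6 + ε') / N ^ 3 * (N / R)) = (2 ^ 60 / N ^ 3) * (M ^ (6 + ε') * (N / R)) by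
        field_simp]
      have h1 : (1 : ℝ) ≤ 2 ^ 60 / N ^ 3 := by rw [le_div_iff₀ (by positivity)]; linarith
      calc M ^ 6 = 1 * (M ^ 6 * 1) := by ring
        _ ≤ (2 ^ 60 / N ^ 3) * (M ^ (6 + ε') * (N / R)) := by
            apply mul_le_mul h1 (mul_le_mul hM6 hNR1 zero_le_one (by positivity)) (by positivity) (by positivity)
    nlinarith
  · -- the regime `Good`
    set L := ⌊N / 8⌋₊ with hL
    set ℓ := L / 2 with hℓ
    -- `T² N⁷ = M⁷`
    have hT7 : T ^ 2 * N ^ 7 = M ^ 7 := by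
      rw [hNdef, mul_pow, ← Real.rpow_natCast (T ^ (-(2 / 7) : ℝ)) 7, ← Real.rpow_mul hT.le]
      norm_num
      field_simp
    -- `2M³ ≤ NTR²` and `NTR² ≤ 8M³`
    set y : ℝ := 2 * M ^ 3 / (1 * N * T) with hy
    have hy0 : 0 < y := by positivity
    have hRy : Real.sqrt y ≤ R := by rw [hRdef, bourgainR]; exact Nat.le_ceil _
    have hyNT : y * (N * T) = 2 * M ^ 3 := by rw [hy]; field_simp
    have hrel1 : 2 * M ^ 3 ≤ N * T * R ^ 2 := by
      have h1 : y ≤ (R : ℝ) ^ 2 := by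
        calc y = Real.sqrt y ^ 2 := (Real.sq_sqrt hy0.le).symm
          _ ≤ (R : ℝ) ^ 2 := pow_le_pow_left₀ (Real.sqrt_nonneg _) hRy 2
      calc 2 * M ^ 3 = y * (N * T) := hyNT.symm
        _ ≤ (R : ℝ) ^ 2 * (N * T) := by gcongr
        _ = N * T * R ^ 2 := by ring
    have hy1 : 1 ≤ y := by
      by_contra hlt
      rw [not_le] at hlt
      have hs : Real.sqrt y < 1 := by rw [Real.sqrt_lt' one_pos]; simpa using hlt
      have hR1' : R ≤ 1 := by
        rw [hRdef, bourgainR]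
        exact Nat.ceil_le.2 (by exact_mod_cast hs.le)
      have : (R : ℝ) ≤ 1 := by exact_mod_cast hR1'
      have hR0 : (0 : ℝ) ≤ R := Nat.cast_nonneg _
      nlinarith
    have hrel2 : N * T * R ^ 2 ≤ 8 * M ^ 3 := by
      have hs1 : 1 ≤ Real.sqrt y := by rw [show (1:ℝ) = Real.sqrt 1 by simp]; exact Real.sqrt_le_sqrt hy1
      have hRlt : (R : ℝ) < Real.sqrt y + 1 := by rw [hRdef, bourgainR]; exact Nat.ceil_lt_add_one (Real.sqrt_nonneg _)
      have hRle : (R : ℝ) ≤ 2 * Real.sqrt y := by linarith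
      have h2 : (R : ℝ) ^ 2 ≤ 4 * y := by
        calc (R : ℝ) ^ 2 ≤ (2 * Real.sqrt y) ^ 2 := pow_le_pow_left₀ hRpos.le hRle 2
          _ = 4 * y := by rw [mul_pow, Real.sq_sqrt hy0.le]; ring
      calc N * T * R ^ 2 = (R : ℝ) ^ 2 * (N * T) := by ring
        _ ≤ 4 * y * (N * T) := by gcongr
        _ = 4 * (y * (N * T)) := by ring
        _ = 8 * M ^ 3 := by rw [hyNT]; ring
    have hMT2 : M ^ 2 ≤ T := by
      calc M ^ 2 ≤ Real.sqrt T ^ 2 := pow_le_pow_left₀ hM.le hMT 2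
        _ = T := Real.sq_sqrt hT.le
    have hg : Good T M N R L ℓ := ⟨hN20, hT0, hMT2, hT7, hNM, hrel1, hrel2, hRN, hNR, rfl, rfl⟩
    -- the bound for `‖S‖` and its sixth power
    have hS := hg.norm_S_le hε hC60 hC6' hK0 hK'
    rw [← hCtot] at hS
    have hlT := hg.log_T_ge
    have h𝒯6 : ((M ^ 6 / (N ^ 2 * R)) ^ (1 / 6 : ℝ)) ^ 6 = M ^ 6 / (N ^ 2 * R) := by
      rw [one_div, show (6 : ℝ) = ((6 : ℕ) : ℝ) by norm_num, Real.rpow_inv_natCast_pow (by positivity) (by norm_num)]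
    have hTε6 : (T ^ (ε' / 6 / 6)) ^ 6 = T ^ (ε' / 6) := by
      rw [← Real.rpow_natCast _ 6, ← Real.rpow_mul hT.le]; norm_num
    have h6 : ‖bourgainSum Real.log T M‖ ^ 6 ≤
        Ctot ^ 6 * Real.log T ^ 18 * T ^ (ε' / 6) * (M ^ 6 / (N ^ 2 * R)) := by
      have := pow_le_pow_left₀ (norm_nonneg _) hS 6
      rw [mul_pow, mul_pow, mul_pow, h𝒯6, hTε6, ← pow_mul] at this
      exact this
    -- `log¹⁸ T ≤ T^{ε'/6}/δ¹⁸`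
    have hlog : Real.log T ^ 18 ≤ (1 / δ) ^ 18 * T ^ (ε' / 6) := by
      have h1 : Real.log T ≤ T ^ δ / δ := Real.log_le_rpow_div hT.le hδ0
      have h2 : Real.log T ^ 18 ≤ (T ^ δ / δ) ^ 18 := pow_le_pow_left₀ (by linarith) h1 18
      refine h2.trans (le_of_eq ?_)
      rw [div_pow, ← Real.rpow_natCast _ 18, ← Real.rpow_mul hT.le, hδ]
      rw [show ε' / 108 * ((18 : ℕ) : ℝ) = ε' / 6 by push_cast; ring]
      ring
    -- `T^{ε'/3} ≤ 2^{7ε'/3} M^{ε'}`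
    have hT3 := hg.T3_le
    have hTpow : T ^ (ε' / 6) * T ^ (ε' / 6) ≤ (2 : ℝ) ^ (7 * ε' / 3) * M ^ ε' := by
      rw [← Real.rpow_add hT, show ε' / 6 + ε' / 6 = ε' / 3 by ring]
      have e1 : T ^ (ε' / 3) = (T ^ 3) ^ (ε' / 9) := by
        rw [← Real.rpow_natCast _ 3, ← Real.rpow_mul hT.le]; congr 1; push_cast; ring
      rw [e1]
      calc (T ^ 3) ^ (ε' / 9) ≤ ((2 : ℝ) ^ 21 * M ^ 7) ^ (ε' / 9) := Real.rpow_le_rpow (by positivity) hT3 (by positivity)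
        _ = ((2 : ℝ) ^ 21) ^ (ε' / 9) * (M ^ 7) ^ (ε' / 9) := Real.mul_rpow (by positivity) (by positivity)
        _ = (2 : ℝ) ^ (7 * ε' / 3) * M ^ (7 * ε' / 9) := by
            rw [← Real.rpow_natCast _ 21, ← Real.rpow_mul (by norm_num), ← Real.rpow_natCast _ 7, ← Real.rpow_mul hM.le]
            congr 1 <;> (congr 1; push_cast; ring)
        _ ≤ (2 : ℝ) ^ (7 * ε' / 3) * M ^ ε' := by
            apply mul_le_mul_of_nonneg_left _ (by positivity)
            exact Real.rpow_le_rpow_of_exponent_le hM1 (by linarith)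
    -- assemble
    refine hmono ?_ (le_max_right _ _)
    have e6 : M ^ (6 + ε') = M ^ 6 * M ^ ε' := by
      rw [Real.rpow_add hM]; congr 1; exact_mod_cast Real.rpow_natCast M 6
    have e : M ^ (6 + ε') / N ^ 3 * (N / R) = M ^ ε' * (M ^ 6 / (N ^ 2 * R)) := by
      rw [e6]
      field_simp
    rw [e, hCbig]
    have hW0 : 0 ≤ M ^ 6 / (N ^ 2 * R) := by positivity
    calc ‖bourgainSum Real.log T M‖ ^ 6 ≤ Ctot ^ 6 * Real.log T ^ 18 * T ^ (ε' / 6) * (M ^ 6 / (N ^ 2 * R)) := h6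
      _ ≤ Ctot ^ 6 * ((1 / δ) ^ 18 * T ^ (ε' / 6)) * T ^ (ε' / 6) * (M ^ 6 / (N ^ 2 * R)) := by gcongr
      _ = Ctot ^ 6 * (1 / δ) ^ 18 * (T ^ (ε' / 6) * T ^ (ε' / 6)) * (M ^ 6 / (N ^ 2 * R)) := by ring
      _ ≤ Ctot ^ 6 * (1 / δ) ^ 18 * ((2 : ℝ) ^ (7 * ε' / 3) * M ^ ε') * (M ^ 6 / (N ^ 2 * R)) := by gcongr
      _ = Ctot ^ 6 * ((1 / δ) ^ 18 * (2 : ℝ) ^ (7 * ε' / 3)) * (M ^ ε' * (M ^ 6 / (N ^ 2 * R))) := by ring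


end ZetaSum
end Literature.NumberTheory.LFunctions
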